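import Mathlib.NumberTheory.EulerProduct.DirichletLSeries
import Mathlib.NumberTheory.LSeries.Dirichlet
import Mathlib.NumberTheory.LSeries.Injectivity
import Literature.NumberTheory.Automorphic.LanglandsTunnellProofs
import Literature.NumberTheory.Automorphic.ArtinLFunctions
import Literature.NumberTheory.EllipticCurves.NewformGaloisRepProofs
import Literature.NumberTheory.EllipticCurves.Gamma1NewformLSeries
import Literature.NumberTheory.EllipticCurves.HeckeOperatorsGamma1QExpansionProofs
import Literature.NumberTheory.LFunctions.FiniteEulerProducts
import Literature.NumberTheory.GaloisRepresentations.OddArtinRepGammaFactor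
import Literature.NumberTheory.GaloisRepresentations.IntegralGaloisActionProofs
import Literature.NumberTheory.GaloisRepresentations.HeckeCharacterProofs
import HarnessLib

/-!
# Deligne–Serre 1974, Thm. 4.6 (b): `L(s, ρ_f) = L(s, f)` — decomposition of
`Literature.NumberTheory.Automorphic.artinLFunction_eq_cuspFormLSeries` and proof of its Deligne–Serre layers
(companion to `Literature.NumberTheory.Automorphic.LanglandsTunnell`; sibling of
`Literature.NumberTheory.Automorphic.LanglandsTunnellProofs`, which carries Thm. 4.6 (a))

D-0014 keeps `Literature/` sorry-free by stating cited results as named facts `def X : Prop`.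
The named fact `Literature.NumberTheory.Automorphic.artinLFunction_eq_cuspFormLSeries` of `LanglandsTunnell` says: if the
continuous representation `ρ : Γ_ℚ → GL_2(ℂ)` (`Literature.FramedArtinRep ℚ 2`, `ℂ` with its usual
topology) is attached away from `N` (`IsGaloisRepOfNewform1`: unramified at every `p ∤ N` with
`charpoly ρ(Frob_p) = X² - a_p X + ε(p)`, arithmetic Frobenius) to the **newform**
`f = ∑ aₙ qⁿ ∈ S_1(Γ₁(N))` (`IsNewform1`), then `L(s, ρ) = ∑ aₙ n^{-s}` for `re s > 1`
(`Literature.NumberTheory.GaloisRepresentations.artinLFunction`, a `tprod` of inverted Euler factors `det(1 - ρ(Frob_𝔓) N v^{-s} | V^{I_𝔓})⁻¹`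
over the finite places `v` of `ℚ`; `Literature.NumberTheory.EllipticCurves.ModularForms.cuspFormLSeries`, an `LSeries`).

Its source is Deligne–Serre, *Formes modulaires de poids 1*, Ann. Sci. ÉNS (4) 7 (1974),
Thm. 4.6, p. 514: "Supposons `f` parabolique primitive, de coefficients `a_n`, `n ≥ 1`.  Soit
`ρ` la représentation de `G` correspondante.  Alors : (a) Le conducteur d'Artin de `ρ` est
égal à `N`; (b) La fonction `L` d'Artin de `ρ` est égale à `L(s, ρ) = Σ a_n n^{-s}`."  Here
"la représentation correspondante" is the representation of Thm. 4.1 (`G → GL₂(ℂ)`, `ℂ`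
*discrete*, §3 (a): finite image), unique up to isomorphism by Rem. 4.3 (Lemma 3.2,
`DeligneSerre1974.lemma32_complex` of `ArtinRepFrobenius`); the region `re s > 1` is Thm. 9.1
(Cor. 9.2).  The printed proof (pp. 515–516, steps (i)–(iv) and Lemma 4.9) proves (a) and (b)
*together*: the top layer of (a) is the sibling file `LanglandsTunnellProofs`
(`DeligneSerre1974.thm46a_artinConductorNat_eq`, `Lang.artinConductorNat_eq_level_of`), and
the one genuinely analytic input of (b) vendored here,
`Lang.deligneSerre_eulerPolynomial_eq_of_dvd_level` ("`F_p = 1` pour tout `p ∣ N`"), sits in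
the **same DAG** as `thm46a_artinConductorNat_eq` ("`A = 1`") over the shared lower layers
listed below.  Over the tree's honest definitions the proof of (b) is a theory (functional
equations of `Λ(s, f)` for newforms with nebentypus and of `Λ(s, ρ)`, Hecke theory of
newforms on `Γ₁(N)`), none of which is in Mathlib; this file records the *architecture* of the
printed proof, vendors its inputs as named facts with their printed locators, and proves every
reduction between them.

## Main result

* `Lang.artinLFunction_eq_cuspFormLSeries_of_functionalEquations` — **Thm. 4.6 (b) from its
  printed inputs**: `artinLFunction_eq_cuspFormLSeries` holds for every weight-one newform `f`
  and every `ρ` attached to it, given (i) the weight-one functional equation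
  `DeligneSerre1974.weightOne_functionalEquation` (Hecke; Li 1975), (ii) Artin's functional
  equation `Lang.artin_functional_equation` (Artin–Brauer), Rem. 4.5
  (`DeligneSerre1974.rem45_isOdd`), 1.8 (`IsNewform1.cuspCoeff_of_dvd_level`, Li–Ogg) and the
  Hecke relations of Diamond–Shurman Prop. 5.8.5 (3), (2) (`IsNewform1.cuspCoeff_mul_of_coprime`,
  `IsNewform1.cuspCoeff_prime_pow_add_two`, vendored here) — all standard theorems stated as
  named facts elsewhere in the tree or below.  **Everything specific to Deligne–Serre's proof is
  proved**: the agreement of the unramified Euler factors (Thm. 4.1 ⇒ step (iii),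
  `eulerFactorAt_eq_of_not_dvd_level`), the finite Euler quotient of step (iii)
  (`artinLFunction_mul_finiteEulerNum_eq`), the passage through the two functional equations
  (`dsStar_identity`, an identity principle for Mathlib-meromorphic functions), Lemma 4.9
  (`DeligneSerre1974.lemma49_holds` of `FiniteEulerProducts`, used through its
  two-exponential form `lemma49_exp`, which avoids identifying the conductors of `ρ` and `ρ^∨`),
  step (iv) on the `ρ`-side (`ArtinRep.exists_eulerFactorAt_eq_prod`: the inverse roots of the
  Euler factors of a finite-image representation are roots of unity), the resulting local
  statement `deligneSerre_eulerFactorAt_eq_of_dvd_level`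
  (`deligneSerre_eulerFactorAt_eq_of_dvd_level_of_functionalEquations`), Thm. 9.1 for a form with
  an attached `ρ` (`norm_cuspCoeff_le_card_divisors_of_isGaloisRepOfNewform1`) and the Euler
  product (1.7.2) on `re s > 1` (`hasProd_cuspFormLSeries_of_norm_le`).  So
  `theorem artinLFunction_eq_cuspFormLSeries_holds` is
  `artinLFunction_eq_cuspFormLSeries_of_functionalEquations` applied to the `_holds` theorems of
  these standard inputs, once they are discharged.  **Part D** discharges the two Hecke
  relations (`IsNewform1.cuspCoeff_mul_of_coprime_holds`,
  `IsNewform1.cuspCoeff_prime_pow_add_two_holds`, from the `q`-expansion of `T_p` on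
  `S_k(Γ₁(N))`, `qExpansion_coeff_heckeT_gamma1_holds`), so the four-input form
  `Lang.artinLFunction_eq_cuspFormLSeries_of_functionalEquations'` needs only (i), (ii),
  Rem. 4.5 and 1.8.

## The shared lower layers of Thm. 4.6 and where they live in the tree

1. (i) For `f = Σ a_n qⁿ` primitive of type `(1, ε)` on `Γ₀(N)` there is `λ ≠ 0` with
   `f(−1/Nz) = λ z f̃(z)`, `f̃ = Σ ā_n qⁿ` (Hecke; Li 1975), whence by Mellin transform
   `Λ_f(1 − s) = a Λ_{f̃}(s)`, `Λ_f(s) = N^{s/2} (2π)^{−s} Γ(s) Φ_f(s)`, `Φ_f(s) = Σ a_n n^{−s}`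
   — named fact `Literature.NumberTheory.EllipticCurves.ModularForms.DeligneSerre1974.weightOne_functionalEquation`
   (`Literature.NumberTheory.EllipticCurves.Gamma1NewformLSeries`, through the
   conjugate-coefficient series `Φ_{f̃}(s) = Σ ā_n n^{−s}`).
2. (ii) Artin's functional equation `ζ(1 − s, ρ) = v ζ(s, ρ̄)`,
   `ζ(s, ρ) = M^{s/2} (2π)^{−s} Γ(s) L(s, ρ)`, `M` the Artin conductor, the factor at infinity
   being `(2π)^{−s} Γ(s)` because `ρ` is odd (Rem. 4.5) — named fact
   `Literature.NumberTheory.Automorphic.artin_functional_equation` (`ArtinLFunctions`), with the archimedean data for odd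
   `ρ` **proved** in `Literature.NumberTheory.GaloisRepresentations.OddArtinRepGammaFactor`
   (`FramedArtinRep.gammaFactor_eq_of_isOdd`, `ArtinRep.artinConductorNorm_eq_artinConductorNat`)
   and oddness of any finite-image `ρ` attached to `f` the named fact
   `DeligneSerre1974.rem45_isOdd` (`NewformGaloisRepProofs`).
3. (iii) By (4.1.1) the Euler factors of `Φ_f` and of `L(s, ρ)` agree at every `p ∤ N`
   (**proved** here: `Lang.eulerFactorAt_eq_of_not_dvd_level`), so
   `F(s) = (N/M)^{s/2} Λ_f(s) / ζ(s, ρ) = A^s ∏_{p ∣ N} F_p(s)`, `A = (N/M)^{1/2}`,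
   `F_p(s) = (1 − b_p p^{−s})(1 − c_p p^{−s})/(1 − a_p p^{−s})`, is a *finite* Euler product with
   `F(1 − s) = ω F̃(s)`; this needs the Euler product (1.7.2) of `Φ_f` — named fact
   `IsNewform1.hasProd_cuspFormLSeries` of `Gamma1NewformLSeries` (any weight `k`, Hecke region
   `re s > k/2 + 1`), and, on `re s > 1` in weight one, `IsNewform1.hasProd_cuspFormLSeries_weight_one`
   of this file (**proved** from the Hecke relations and Thm. 9.1, see below).
4. (iv) **Lemma 4.9** (finite Euler products with a functional equation are trivial) — named
   fact `DeligneSerre1974.lemma49`, **proved** (`lemma49_holds`) in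
   `Literature.NumberTheory.LFunctions.FiniteEulerProducts`; applied with `|a_p| ≤ 1` for
   `p ∣ N` (1.8: named fact `IsNewform1.cuspCoeff_of_dvd_level` with the proved corollary
   `IsNewform1.norm_cuspCoeff_le_one_of_dvd_level`, `Gamma1NewformLSeries`) and `b_p, c_p`
   roots of unity or `0` (**proved** here on the `ρ`-side in the form needed for Thm. 9.1:
   `ArtinRep.norm_le_one_of_eulerFactorAt_eq`), it gives `A = 1`, i.e. `M = N` (a), and
   `F_p = 1` for all `p ∣ N` (b).

The step-(iii) bookkeeping between these layers and the local statement of (b) — matching the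
tree's completed `L`-functions (`completedCuspFormLContinuations`, `completedArtinLFunction`)
with the cross-multiplied finite Euler products of `lemma49`, and reading `F_p = 1` back as an
identity of local polynomials — is **Part C** of this file (proved); for (a) (`A = 1`, i.e.
`M = N`) one needs in addition `𝔣(ρ^∨) = 𝔣(ρ)`, and for the all-pairs form
`deligneSerre_eulerPolynomial_eq_of_dvd_level` the independence of the choices
(`ArtinRep.eulerFactorAt_spec`); neither is used for `artinLFunction_eq_cuspFormLSeries`.

## This file

Thm. 4.6 (b) compares two Euler products prime by prime:

* `p ∤ N`.  "Si `p` est un nombre premier ne divisant pas `N`, les `p`-facteurs de `Λ_f(s)`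
  et de `ξ(s, ρ)` coïncident d'après 4.1" (proof of 4.6, step (iii)).  **Proved**:
  `Lang.eulerFactorAt_eq_of_not_dvd_level` — from `IsGaloisRepOfNewform1` alone (unramified at
  `p`, so `V^{I_𝔓} = V`, `ArtinRep.eulerPolynomial_eq_reverse_charpoly`; and
  `det(1 - T ρ(Frob_𝔓))` is the reverse of `charpoly ρ(Frob_𝔓) = X² - a_p X + ε(p)`), the Euler
  factor `ArtinRep.eulerFactorAt` of `ρ` at `p` is `1 - a_p T + ε(p) T²`.  The pair
  `(𝔓, Frob_𝔓)` chosen inside `eulerFactorAt` exists by the discharged fact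
  `HeightOneSpectrum.exists_isArithFrobAt_of_mem_primesAbove_holds`
  (`IntegralGaloisActionProofs`), so no junk branch and no appeal to the (undischarged)
  `ArtinRep.eulerFactorAt_spec` is needed (`ArtinRep.eulerFactorAt_eq_of_forall_eulerPolynomial_eq`).
* `p ∣ N`.  Steps (i)–(iv) above; conclusion: "`A = 1` et `F_p = 1` pour tout `p`", i.e. the
  local Euler factor of `L(s, ρ)` at `p ∣ N` is `1 - a_p T`.  **Named fact**
  `Lang.deligneSerre_eulerPolynomial_eq_of_dvd_level` (this local conclusion, for every `𝔓 ∣ p`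
  and every arithmetic Frobenius), with its per-place consequence
  `Lang.deligneSerre_eulerFactorAt_eq_of_dvd_level` (the form the comparison consumes).
* The Euler product of `L(f, s)` itself, (1.7.2): `ψ_f(s) = ∏_{p ∣ N} (1 - a_p p^{-s})⁻¹
  ∏_{p ∤ N} (1 - a_p p^{-s} + ε(p) p^{-2s})⁻¹`, valid as an identity of values on `re s > 1`
  by Thm. 9.1 (`|aₙ| ≤ d(n)`).  **Named fact** `IsNewform1.hasProd_cuspFormLSeries_weight_one`
  (region `re s > 1`, genuinely stronger in weight one than the Hecke-region fact
  `IsNewform1.hasProd_cuspFormLSeries` of `Gamma1NewformLSeries`, `re s > 3/2`), itself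
  **proved** (`IsNewform1.hasProd_cuspFormLSeries_weight_one_of`) from three printed
  statements: multiplicativity `a_{mn} = a_m a_n` and the recursion
  `a_{p^{r+2}} = a_p a_{p^{r+1}} - ε(p) p^{k-1} a_{p^r}` for newforms on `Γ₁(N)`
  (Diamond–Shurman, GTM 228, Prop. 5.8.5 (3), (2) with Def. 5.8.1 and Thm. 5.8.2; the `Γ₁(N)`
  companions of the tree's `IsNewform0.coeff_mul_of_coprime`), vendored as
  `IsNewform1.cuspCoeff_mul_of_coprime` and `IsNewform1.cuspCoeff_prime_pow_add_two`, and the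
  weight-one Ramanujan bound `|aₙ| ≤ d(n)` (Deligne–Serre 1974, Thm. 9.1, (9.3)), vendored as
  `norm_cuspCoeff_le_card_divisors_weight_one`.  The proof is Diamond–Shurman's proof of
  Thm. 5.9.2 ((5.24)–(5.26)): Mathlib's `EulerProduct.eulerProduct_hasProd` for the
  multiplicative summands `aₙ n^{-s}`, absolute convergence by comparison with
  `∑ d(n) n^{-σ} = ζ(σ)²` (`summable_norm_term_card_divisors`, from Mathlib's
  `ArithmeticFunction.LSeriesSummable_mul` and `LSeriesSummable_zeta_iff`), and the evaluation
  `∑_r a_{p^r} x^r · (1 - a_p x + ε(p) x²) = 1` of the local factor from the recursion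
  (`tsum_mul_eq_one_of_recurrence`, (5.24)).
* Assembly.  **Proved**: `Lang.artinLFunction_eq_cuspFormLSeries_of_hasProd` (one `s`),
  `Lang.artinLFunction_eq_cuspFormLSeries_of_deligneSerre` (from the two named facts of the
  first layer) and `Lang.artinLFunction_eq_cuspFormLSeries_of_leaves` (from the four leaves):
  the Euler factors of `L(s, ρ)` agree with the factors of (1.7.2) at every `p` (`N v = p`,
  `Rat.residueCard_eq_natGenerator`; `ε(p) = 0` at `p ∣ N`,
  `dirichletCharacter_apply_eq_zero_of_prime_dvd`), so the `tprod` defining `L(s, ρ)` is the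
  value `L(f, s)` of the convergent product (1.7.2) transported along
  `Rat.HeightOneSpectrum.primesEquiv` (`Equiv.hasProd_iff`, `HasProd.tprod_eq`).
* Thm. 9.1 is then *eliminated* from the inputs.  **Proved**:
  `Lang.norm_cuspCoeff_le_card_divisors_of_isGaloisRepOfNewform1` — for a newform `f` with an
  attached `ρ`, the Hecke relations and the local factors `1 - a_p T` at `p ∣ N` give
  `|aₙ| ≤ d(n)`, exactly as in the printed proof of Thm. 9.1 (§9.1): at `p ∤ N` the Frobenius
  has finite order (`ArtinRep.finite_range_holds`, `exists_pow_eq_one_of_finite_range`) and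
  characteristic polynomial `X² - a_p X + ε(p)`, so `a_p = λ + μ` with roots of unity `λ, μ`
  (`exists_eigenvalues_of_charpoly_eq`) and `|a_{p^r}| ≤ r + 1` by the recursion
  (`norm_le_of_recurrence`); at `p ∣ N`, `1 - a_p T = det(1 - T Frob | V^{I_𝔓})` with
  `Frob` of finite order forces `dim V^{I_𝔓} ≤ 1` and `a_p ∈ {0} ∪ μ_∞`
  (`norm_le_one_of_charpoly_reverse_eq`, `ArtinRep.norm_le_one_of_eulerFactorAt_eq`), so
  `|a_{p^r}| = |a_p|^r ≤ 1`; multiplicativity assembles `|aₙ| ≤ d(n)`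
  (`Nat.recOnPosPrimePosCoprime`).  Whence the three-leaf assembly
  `Lang.artinLFunction_eq_cuspFormLSeries_of_hecke` (Prop. 5.8.5 (3), (2) and Thm. 4.6 (b) at
  `p ∣ N` in the per-place form `Lang.deligneSerre_eulerFactorAt_eq_of_dvd_level`), and the
  named fact `norm_cuspCoeff_le_card_divisors_weight_one` itself from Thm. 4.1
  (`DeligneSerre1974.thm41_exists`) and the same three leaves
  (`norm_cuspCoeff_le_card_divisors_weight_one_of`).

* **Part C — Thm. 4.6 (b) at `p ∣ N` proved from (i), (ii), Rem. 4.5, 1.8 and the Hecke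
  relations** (steps (iii)–(iv) of the printed proof, for the pair `(f, ρ)` and its "conjugate"
  `(f̃, ρ^∨)`, `ρ^∨ = FramedRep.dual ρ` the contragredient):
  - Euler products on the Hecke half-plane `re s > 3/2` from the Hecke relations alone
    (`LSeries_hasProd_of_recurrence`; `hasProd_cuspFormLSeries_of_hecke`,
    `hasProd_conjCuspFormLSeries_of_hecke` for `Φ_f` and `Φ_{f̃}(s) = Σ ā_n n^{-s}`);
  - the Euler factors of `ρ^∨` at `p ∤ N` are `1 - ā_p T + ε̄(p) T²`
    (`dual_eulerFactorAt_eq_of_not_dvd_level`: `charpoly (ρ(F)⁻¹)ᵀ = X² - ā_p X + ε̄(p)` for the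
    finite-order `ρ(F)`, `Matrix.charpoly_transpose_inv_of_pow_eq_one`), `ρ^∨` is odd
    (`isOdd_dual`), and every Euler factor of a finite-image representation is
    `∏ (1 - μ T)` with roots of unity `μ` (`ArtinRep.exists_eulerFactorAt_eq_prod`, step (iv):
    "`b_p`, `c_p` sont, soit `0`, soit des racines de l'unité");
  - step (iii): with Deligne–Serre's local data `F_p = ∏_μ (1 - μ p^{-s})/(1 - a_p p^{-s})`
    (`dsLocalData`, an `EulerFactorData` of `FiniteEulerProducts`),
    `L(s, ρ) N_G(s) = Φ_f(s) D_G(s)` and `L(s, ρ^∨) N_H(s) = Φ_{f̃}(s) D_H(s)` on `re s > 3/2`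
    (`artinLFunction_mul_finiteEulerNum_eq`: the two Euler products differ by finitely many
    factors); completing with `Λ(ρ, s) = 2 M^{s/2} (2π)^{-s} Γ(s) L(s, ρ)`
    (`FramedArtinRep.completedArtinLFunction_eq_of_isOdd`, `M = artinConductorNat ρ`) and
    `Λ_f(s) = N^{s/2} (2π)^{-s} Γ(s) Φ_f(s)`, the functional equations `Λ(1 - s, ρ) = W Λ(s, ρ^∨)`
    and `Λ_f(1 - s) = a Λ_{f̃}(s)` yield, for all `s`,
    `W M'^{s/2} N^{(1-s)/2} D_H(s) N_G(1-s) = a M^{(1-s)/2} N^{s/2} D_G(1-s) N_H(s)` (★)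
    (`dsStar_identity`; `M' = artinConductorNat ρ^∨`).  Since Artin's functional equation is
    stated with Mathlib-`Meromorphic` witnesses (arbitrary values on a discrete set), the
    half-plane identity is propagated by the meromorphic identity principle
    (`Meromorphic.eventually_nhdsNE_eq_zero`: `meromorphicOrderAt = ⊤` spreads over the
    connected plane) to punctured neighbourhoods, and (★), an identity of entire functions, by
    `AnalyticOnNhd.eq_of_frequently_eq`;
  - step (iv): (★) is (4.9.1) in the form `c₁ e^{κ₁ s} N_G(1-s) D_H(s) = c₂ e^{κ₂ s} N_H(s) D_G(1-s)`;
    `lemma49_exp` reduces this to `lemma49` with `A = e^{(κ₂-κ₁)/2}` (so the conductors `M`,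
    `M'` need not be compared), and (4.9.2) holds since the `ρ`-roots have absolute value `1`
    and `|a_p| ≤ 1 < p^{1/2}` (`norm_lt_sqrt_of_mem_dsLocalData`); the conclusion
    `N_{G,p} = D_{G,p}`, i.e. `L_p(ρ, p^{-s}) = 1 - a_p p^{-s}` for all `s`, is a polynomial
    identity (`Polynomial.eq_of_forall_eval_natCast_cpow_neg_eq`):
    `eulerFactorAt_eq_of_dvd_level_of_functionalEquations`, whence
    `deligneSerre_eulerFactorAt_eq_of_dvd_level_of_functionalEquations` and
    `artinLFunction_eq_cuspFormLSeries_of_functionalEquations`.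

* **Part D — the Hecke relations proved** (Diamond–Shurman Prop. 5.8.5 (2), (3) for
  newforms on `Γ₁(N)`).  From the `q`-expansion of `T_p` on `S_k(Γ₁(N))`
  (`qExpansion_coeff_heckeT_gamma1_holds`, op. cit. (5.3):
  `a_n(T_p f) = a_{pn}(f) + 𝟙_N(p) p^{k-1} a_{n/p}(⟨p⟩ f)`), `T_p f = a_p f`
  (`IsNewform1.heckeEigenvalue_eq_coeff_holds`, discharging the named fact of `Newforms`) and
  `⟨d⟩ f = χ(d) f` (`IsNewform1.mem_nebentypusSubspace_nebentypus_holds`, discharging the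
  named fact of `Newforms`: the diamond eigenvalues of a newform form a character of
  `(ℤ/Nℤ)ˣ` by `diamondOp_mul_holds` and `⟨1⟩ = id`), one gets the relation
  `a_p a_n = a_{pn} + 𝟙_N(p) p^{k-1} χ(p) a_{n/p}` (`IsNewform1.cuspCoeff_prime_mul`), whence
  the recursion `IsNewform1.cuspCoeff_prime_pow_add_two_holds` and, by induction over the
  factorisation, multiplicativity `IsNewform1.cuspCoeff_mul_of_coprime_holds`.

So `artinLFunction_eq_cuspFormLSeries` rests on exactly four standard named facts: (i)
`weightOne_functionalEquation`, (ii) `artin_functional_equation`, Rem. 4.5 `rem45_isOdd`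
(itself Thm. 4.1 with `det ρ = ε`, `ε(-1) = -1`) and 1.8 `cuspCoeff_of_dvd_level`
(`Lang.artinLFunction_eq_cuspFormLSeries_of_functionalEquations'`).  When these are
discharged, `theorem artinLFunction_eq_cuspFormLSeries_holds` is
`artinLFunction_eq_cuspFormLSeries_of_functionalEquations'` applied to their `_holds`
theorems.  The general-purpose lemmas on `ArtinRep` Euler factors
(`eulerPolynomial_eq_reverse_charpoly`, `eulerFactorAt_eq_of_forall_eulerPolynomial_eq`,
`norm_le_one_of_eulerFactorAt_eq`) and on Dirichlet series (`tsum_mul_eq_one_of_recurrence`,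
`summable_norm_term_card_divisors`) carry no Langlands–Tunnell content and may be moved to
`GaloisRepresentations/ArtinLFunctionProofs` resp. an `LFunctions` file by their next user.

## References

* P. Deligne, J.-P. Serre, *Formes modulaires de poids 1*, Ann. Sci. ÉNS (4) 7 (1974),
  507–530, doi:10.24033/asens.1277 — §1.7 (1.7.2), 1.8, §3 (a), Lemma 3.2, Rem. 3.4, Thm. 4.1,
  Rem. 4.3, 4.5, Thm. 4.6 and its proof (i)–(iv), Lemma 4.9, §9 Thm. 9.1, (9.3), Cor. 9.2
  (`DeligneSerreASENS1974`).
* F. Diamond, J. Shurman, *A First Course in Modular Forms*, GTM 228, Springer 2005, Def. 5.8.1,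
  Thm. 5.8.2, Prop. 5.8.5, Thm. 5.9.2 and its proof, (5.14), (5.23)–(5.26) (`DiamondShurman2005`).
* W.-C. W. Li, *Newforms and functional equations*, Math. Ann. 212 (1975), 285–315 (`Li1975`).
* J. Neukirch, *Algebraic Number Theory*, Grundlehren 322 (1999), Ch. VII §10 (`NeukirchANT1999`).
* J.-P. Serre, *Abelian ℓ-adic representations and elliptic curves* (1968), Ch. I §1.1,
  Remark (finite image of continuous complex representations) (`SerreAbelianLadic1968`).
-/

noncomputable section

open scoped MatrixGroups ModularForm NumberField

open CongruenceSubgroup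

namespace Literature.NumberTheory.Automorphic

section DeligneSerre46b

open IsDedekindDomain Polynomial Field Complex


/-! ### Euler factors of Artin representations: two algebraic lemmas -/

section ArtinRep
open Literature.NumberTheory.GaloisRepresentations (ArtinRep)
open Literature.NumberTheory.GaloisRepresentations.ArtinRep

variable {K : Type*} [Field K] {V : Type*} [AddCommGroup V] [Module ℂ V] [TopologicalSpace V]
  [FiniteDimensional ℂ V]

/-- If the inertia group `I_𝔓` acts trivially on `V` (so that `V^{I_𝔓} = V`), the Euler
polynomial `det(1 - T ρ(σ) | V^{I_𝔓})` of `σ ∈ D_𝔓` is the reversed characteristic polynomial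
`det(1 - T ρ(σ) | V)` of `ρ σ` on all of `V`.
Ref: Neukirch, *Algebraic Number Theory*, Ch. VII §10, (10.1) and the lines following it (at an
unramified prime the factor is `det(1 - ρ(φ_𝔓) N(𝔭)^{-s})` on the whole of `V`). [folklore] -/
theorem _root_.Literature.NumberTheory.GaloisRepresentations.ArtinRep.eulerPolynomial_eq_reverse_charpoly (ρ : ArtinRep K V)
    {𝔓 : Ideal (GaloisRepresentations.absIntegers (𝓞 K) K)}
    (h : ∀ τ ∈ 𝔓.inertia (absoluteGaloisGroup K), ρ τ = 1)
    (σ : 𝔓.decompositionSubgroup (absoluteGaloisGroup K)) :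
    ρ.eulerPolynomial 𝔓 σ = (ρ (σ : absoluteGaloisGroup K)).charpoly.reverse := by
  have htop : ρ.fixedSubmodule (𝔓.inertia (absoluteGaloisGroup K)) = ⊤ :=
    ρ.fixedSubmodule_eq_top_of_forall_eq_one h
  unfold ArtinRep.eulerPolynomial
  congr 1
  rw [← LinearEquiv.charpoly_conj (LinearEquiv.ofTop _ htop) (ρ.restrictInertiaInvariants 𝔓 σ)]
  congr 1

variable [NumberField K]

/-- Computation of `eulerFactorAt` from the Euler polynomials: if, for **every** prime `𝔓 ∣ v`
of `\bar ℤ_K` and **every** arithmetic Frobenius `σ` at `𝔓`, `det(1 - T ρ(σ) | V^{I_𝔓}) = Q`,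
then `L_v(ρ, T) = ρ.eulerFactorAt v = Q` (the pair `(𝔓, σ)` chosen in `eulerFactorAt` exists,
`HeightOneSpectrum.primesAbove_nonempty` and
`HeightOneSpectrum.exists_isArithFrobAt_of_mem_primesAbove_holds`, so the junk branch is not
taken).  A weak, hypothesis-driven form of `ArtinRep.eulerFactorAt_spec` that suffices whenever
the Euler polynomial is known at all `(𝔓, σ)` above `v`.
Ref: Neukirch, *Algebraic Number Theory*, Ch. VII §10, before (10.2) (independence of the
choices). [folklore] -/
theorem _root_.Literature.NumberTheory.GaloisRepresentations.ArtinRep.eulerFactorAt_eq_of_forall_eulerPolynomial_eq (ρ : ArtinRep K V)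
    {v : HeightOneSpectrum (𝓞 K)} {Q : ℂ[X]}
    (hQ : ∀ {𝔓 : Ideal (GaloisRepresentations.absIntegers (𝓞 K) K)} (h𝔓 : 𝔓 ∈ v.primesAbove)
      {σ : absoluteGaloisGroup K} (hσ : IsArithFrobAt (𝓞 K) σ 𝔓),
      ρ.eulerPolynomial 𝔓 ⟨σ, by haveI := h𝔓.1; exact hσ.mem_stabilizer⟩ = Q) :
    ρ.eulerFactorAt v = Q := by
  obtain ⟨𝔓, h𝔓⟩ := HeightOneSpectrum.primesAbove_nonempty v
  obtain ⟨σ, hσ⟩ := HeightOneSpectrum.exists_isArithFrobAt_of_mem_primesAbove_holds h𝔓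
  have h : ∃ 𝔓σ : Ideal (GaloisRepresentations.absIntegers (𝓞 K) K) × absoluteGaloisGroup K,
      𝔓σ.1 ∈ v.primesAbove ∧ IsArithFrobAt (𝓞 K) 𝔓σ.2 𝔓σ.1 := ⟨(𝔓, σ), h𝔓, hσ⟩
  rw [eulerFactorAt, dif_pos h]
  exact hQ h.choose_spec.1 h.choose_spec.2

end ArtinRep

/-! ### Finite order and roots of unity: four algebraic lemmas -/

/-- **Pigeonhole.**  If a homomorphism `φ` out of a group takes finitely many values, every
value `φ g` has a positive power equal to `1` (two of the powers `φ(gⁿ)` coincide, and `φ(gᵐ)`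
is invertible with inverse `φ(g⁻ᵐ)`).  Used with `ArtinRep.finite_range_holds`: the images of
an Artin representation have finite order (Deligne–Serre 1974, §3 (a): "l'image de `ρ` est
finie"). [folklore] -/
theorem exists_pow_eq_one_of_finite_range {F G M : Type*} [Group G] [Monoid M] [FunLike F G M]
    [MonoidHomClass F G M] (φ : F) (h : (Set.range (φ : G → M)).Finite) (g : G) :
    ∃ k : ℕ, 0 < k ∧ φ g ^ k = 1 := by
  obtain ⟨m, n, hmn, he⟩ := h.exists_lt_map_eq_of_forall_mem (f := fun n : ℕ ↦ φ (g ^ n))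
    (fun n ↦ Set.mem_range_self _)
  refine ⟨n - m, Nat.sub_pos_of_lt hmn, ?_⟩
  have hg : g ^ (n - m) = g ^ n * (g ^ m)⁻¹ := by
    rw [← zpow_natCast, Nat.cast_sub hmn.le, zpow_sub, zpow_natCast, zpow_natCast]
  rw [← map_pow, hg, map_mul, ← he, ← map_mul, mul_inv_cancel, map_one]

/-- **A reversed characteristic polynomial of the shape `1 - a T` has `|a| ≤ 1`** when the
endomorphism has finite order.  Let `M` be an endomorphism of a finite-dimensional complex
space `W` with `Mᵏ = 1` (`k ≥ 1`) and `det(1 - T M) = 1 - a T` (Mathlib: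
`M.charpoly.reverse`).  Then `dim W ≤ 1` (the coefficient of `T^{dim W}` in `det(1 - T M)` is
`± det M ≠ 0`), and `a = 0` if `W = 0`, `a = det M` (a `k`-th root of unity) if `dim W = 1`;
in either case `|a| ≤ 1`.  This is the shape of the local factor of an Artin `L`-function at a
ramified prime with at most one-dimensional inertia invariants (Deligne–Serre 1974, proof of
Thm. 4.6, (iv): "`b_p` et `c_p` sont, soit `0`, soit des racines de l'unité").
[cite: DeligneSerreASENS1974, proof of Thm. 4.6 (iv)] -/
theorem norm_le_one_of_charpoly_reverse_eq {W : Type*} [AddCommGroup W] [Module ℂ W]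
    [FiniteDimensional ℂ W] (M : Module.End ℂ W) {k : ℕ} (hk : 0 < k) (hM : M ^ k = 1) {a : ℂ}
    (h : M.charpoly.reverse = 1 - C a * X) : ‖a‖ ≤ 1 := by
  have hdet : LinearMap.det M ^ k = 1 := by rw [← map_pow, hM, map_one]
  have hdet1 : ‖LinearMap.det M‖ = 1 := Complex.norm_eq_one_of_pow_eq_one hdet hk.ne'
  have hdet0 : LinearMap.det M ≠ 0 := fun h0 => by simp [h0] at hdet1
  set d := Module.finrank ℂ W with hd
  have hnat : M.charpoly.natDegree = d := M.charpoly_natDegree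
  have hc0 : M.charpoly.coeff 0 = (-1) ^ d * LinearMap.det M := by
    rw [LinearMap.det_eq_sign_charpoly_coeff, ← hd, ← mul_assoc, ← mul_pow, neg_one_mul, neg_neg,
      one_pow, one_mul]
  have hcoeff : ∀ n, M.charpoly.coeff (revAt d n) = (1 - C a * X : ℂ[X]).coeff n := fun n ↦ by
    rw [← h, coeff_reverse, hnat]
  have h1 : (1 - C a * X : ℂ[X]).coeff 1 = -a := by simp [coeff_one]
  have hd1 : d ≤ 1 := by
    by_contra hlt
    push Not at hlt
    have hdd := hcoeff d
    rw [revAt_le le_rfl, Nat.sub_self, hc0] at hdd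
    have h0 : (1 - C a * X : ℂ[X]).coeff d = 0 := by
      simp [coeff_one, coeff_X, show d ≠ 0 by omega, show (1 : ℕ) ≠ d by omega]
    rw [h0] at hdd
    exact mul_ne_zero (pow_ne_zero _ (neg_ne_zero.mpr one_ne_zero)) hdet0 hdd
  rcases Nat.le_one_iff_eq_zero_or_eq_one.mp hd1 with hd0 | hd1
  · -- `W = 0`: `charpoly M = 1`, so `a = 0`
    have h := hcoeff 1
    rw [hd0, revAt_eq_self_of_lt Nat.zero_lt_one, h1,
      coeff_eq_zero_of_natDegree_lt (by omega)] at h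
    rw [show a = 0 from neg_eq_zero.mp h.symm, norm_zero]
    exact zero_le_one
  · -- `dim W = 1`: `a = det M`, a root of unity
    have h := hcoeff 1
    rw [hd1, revAt_le le_rfl, Nat.sub_self, hc0, hd1, h1, pow_one, neg_one_mul, neg_inj] at h
    rw [← h, hdet1]

/-- **Eigenvalues of a finite-order endomorphism with quadratic characteristic polynomial.**
If `Lᵏ = 1` (`k ≥ 1`) and `charpoly L = X² - a X + e`, then `a = λ + μ` and `e = λ μ` with
`|λ| = |μ| = 1`: `X² - a X + e` has a complex root `λ` (`Complex.exists_root`), `μ = a - λ` is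
the other one, and every root of `charpoly L` is an eigenvalue
(`Module.End.hasEigenvalue_iff_isRoot_charpoly`), hence a `k`-th root of unity.  This is
"`a_p = λ + μ` où `λ` et `μ` sont des racines de l'unité" for the Frobenius of a finite-image
representation (Deligne–Serre 1974, proof of Thm. 9.1, second paragraph of §9.1).
[cite: DeligneSerreASENS1974, §9.1] -/
theorem exists_eigenvalues_of_charpoly_eq {V : Type*} [AddCommGroup V] [Module ℂ V]
    [FiniteDimensional ℂ V] (L : Module.End ℂ V) {k : ℕ} (hk : 0 < k) (hL : L ^ k = 1)
    {a e : ℂ} (h : L.charpoly = X ^ 2 - C a * X + C e) :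
    ∃ l m : ℂ, ‖l‖ = 1 ∧ ‖m‖ = 1 ∧ l + m = a ∧ l * m = e := by
  -- every root of the characteristic polynomial is a `k`-th root of unity
  have hroot : ∀ z : ℂ, z ^ 2 - a * z + e = 0 → ‖z‖ = 1 := by
    intro z hz
    have hz' : L.charpoly.IsRoot z := by
      rw [h, IsRoot.def]
      simp only [eval_add, eval_sub, eval_pow, eval_X, eval_mul, eval_C]
      exact hz
    obtain ⟨v, hv⟩ :=
      ((Module.End.hasEigenvalue_iff_isRoot_charpoly L z).mpr hz').exists_hasEigenvector
    have hkv : (L ^ k) v = z ^ k • v := hv.pow_apply k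
    rw [hL, Module.End.one_apply] at hkv
    have hz1 : z ^ k = 1 := by
      by_contra hne
      apply hv.2
      have : (z ^ k - 1) • v = 0 := by rw [sub_smul, one_smul, ← hkv, sub_self]
      exact (smul_eq_zero.mp this).resolve_left (sub_ne_zero.mpr hne)
    exact Complex.norm_eq_one_of_pow_eq_one hz1 hk.ne'
  obtain ⟨l, hl⟩ := Complex.exists_root (f := X ^ 2 - C a * X + C e)
    (by
      have : (X ^ 2 - C a * X + C e : ℂ[X]).natDegree = 2 := by compute_degree!
      rw [degree_eq_natDegree (fun h0 => by simp [h0] at this), this]; norm_num)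
  have hl' : l ^ 2 - a * l + e = 0 := by
    have := hl
    rw [IsRoot.def] at this
    simpa only [eval_add, eval_sub, eval_pow, eval_X, eval_mul, eval_C] using this
  refine ⟨l, a - l, hroot l hl', hroot (a - l) ?_, by ring, ?_⟩
  · linear_combination hl'
  · linear_combination -hl'

/-- **The Hecke recursion at an unramified prime gives `|a_{p^r}| ≤ r + 1`.**  If `c₀ = 1`,
`c₁ = λ + μ`, `c_{r+2} = (λ + μ) c_{r+1} - λ μ c_r` with `|λ| = |μ| = 1`, then
`c_{r+1} - λ c_r = μ^{r+1}` (induction), so `|c_{r+1}| ≤ |c_r| + 1` and `|c_r| ≤ r + 1`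
(equivalently `c_r = λ^r + λ^{r-1} μ + ⋯ + μ^r`, Deligne–Serre 1974, proof of Thm. 9.1:
"`a_n = λ^m + λ^{m-1} μ + … + μ^m`, d'où `|a_n| ≤ m + 1`"). [cite: DeligneSerreASENS1974, §9.1] -/
theorem norm_le_of_recurrence {l m : ℂ} (hl : ‖l‖ = 1) (hm : ‖m‖ = 1) {c : ℕ → ℂ}
    (h0 : c 0 = 1) (h1 : c 1 = l + m)
    (hrec : ∀ r, c (r + 2) = (l + m) * c (r + 1) - l * m * c r) (r : ℕ) :
    ‖c r‖ ≤ r + 1 := by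
  have hu : ∀ r, c (r + 1) - l * c r = m ^ (r + 1) := by
    intro r
    induction r with
    | zero => rw [h1, h0]; ring
    | succ r ih => rw [hrec, pow_succ, ← ih]; ring
  induction r with
  | zero => simp [h0]
  | succ r ih =>
    have hc : c (r + 1) = l * c r + m ^ (r + 1) := by rw [← hu]; ring
    rw [hc]
    calc ‖l * c r + m ^ (r + 1)‖ ≤ ‖l * c r‖ + ‖m ^ (r + 1)‖ := norm_add_le _ _
      _ = ‖c r‖ + 1 := by rw [norm_mul, hl, one_mul, norm_pow, hm, one_pow]
      _ ≤ (r + 1) + 1 := by gcongr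
      _ = ((r + 1 : ℕ) : ℝ) + 1 := by push_cast; ring

/-- **The Hecke recursion at a prime dividing the level gives `|a_{p^r}| ≤ 1`.**  If `c₀ = 1`,
`c₁ = a` with `|a| ≤ 1` and `c_{r+2} = a c_{r+1}` (the recursion with `ε(p) = 0`), then
`|c_r| ≤ 1` (`c_r = a^r`; Deligne–Serre 1974, proof of Thm. 9.1: "`a_n = (a_p)^m` … de sorte
que `|a_n|` est égal à `0` ou `1`"). [cite: DeligneSerreASENS1974, §9.1] -/
theorem norm_le_one_of_recurrence {a : ℂ} (ha : ‖a‖ ≤ 1) {c : ℕ → ℂ} (h0 : c 0 = 1)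
    (h1 : c 1 = a) (hrec : ∀ r, c (r + 2) = a * c (r + 1)) (r : ℕ) : ‖c r‖ ≤ 1 := by
  induction r using Nat.twoStepInduction with
  | zero => simp [h0]
  | one => simpa [h1] using ha
  | more r _ ih =>
    rw [hrec, norm_mul]
    calc ‖a‖ * ‖c (r + 1)‖ ≤ 1 * 1 := by gcongr
      _ = 1 := one_mul _

section ArtinRep
open Literature.NumberTheory.GaloisRepresentations (ArtinRep)
open Literature.NumberTheory.GaloisRepresentations.ArtinRep

variable {K : Type*} [Field K] {V : Type*} [AddCommGroup V] [Module ℂ V] [TopologicalSpace V]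

/-- If `ρ(σ)ᵏ = 1` on `V` then `ρ(σ)ᵏ = 1` on the inertia invariants `V^{I_𝔓}`
(`ContinuousRep.restrictInertiaInvariants` is a restriction, Mathlib `Module.End.pow_restrict`).
Ref: Neukirch, *Algebraic Number Theory*, Ch. VII §10 (the Euler factor at a ramified prime).
[folklore] -/
theorem _root_.Literature.NumberTheory.GaloisRepresentations.ArtinRep.restrictInertiaInvariants_pow_eq_one (ρ : ArtinRep K V)
    (𝔓 : Ideal (GaloisRepresentations.absIntegers (𝓞 K) K)) (σ : 𝔓.decompositionSubgroup (absoluteGaloisGroup K))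
    {k : ℕ} (h : (ρ (σ : absoluteGaloisGroup K)) ^ k = 1) :
    ρ.restrictInertiaInvariants 𝔓 σ ^ k = 1 := by
  unfold GaloisRepresentations.ContinuousRep.restrictInertiaInvariants
  rw [Module.End.pow_restrict]
  ext ⟨w, hw⟩
  simp [h]

variable [FiniteDimensional ℂ V] [NumberField K] [IsModuleTopology ℂ V]

/-- **An Euler factor of the shape `1 - a T` has `|a| ≤ 1`.**  For an Artin representation
`ρ` on `V` (module topology, so the image is finite: `ArtinRep.finite_range_holds`) and a finite
place `v` of the number field `K`: if `L_v(ρ, T) = det(1 - T ρ(Frob_𝔓) | V^{I_𝔓}) = 1 - a T`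
(`ArtinRep.eulerFactorAt`; the chosen pair `(𝔓, Frob_𝔓)` exists,
`HeightOneSpectrum.exists_isArithFrobAt_of_mem_primesAbove_holds`), then `|a| ≤ 1`, indeed
`a = 0` or `a` is a root of unity (`norm_le_one_of_charpoly_reverse_eq`, the Frobenius having
finite order on `V^{I_𝔓}` by `exists_pow_eq_one_of_finite_range`).  This is Deligne–Serre
1974, proof of Thm. 4.6, (iv) for the `L(s, ρ)`-side ("`b_p` et `c_p` sont, soit `0`, soit
des racines de l'unité"), in the degree `≤ 1` case relevant to Thm. 9.1.
[cite: DeligneSerreASENS1974, proof of Thm. 4.6 (iv)] -/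
theorem _root_.Literature.NumberTheory.GaloisRepresentations.ArtinRep.norm_le_one_of_eulerFactorAt_eq (ρ : ArtinRep K V) {v : HeightOneSpectrum (𝓞 K)}
    {a : ℂ} (h : ρ.eulerFactorAt v = 1 - C a * X) : ‖a‖ ≤ 1 := by
  obtain ⟨𝔓, h𝔓⟩ := HeightOneSpectrum.primesAbove_nonempty v
  obtain ⟨σ, hσ⟩ := HeightOneSpectrum.exists_isArithFrobAt_of_mem_primesAbove_holds h𝔓
  have hex : ∃ 𝔓σ : Ideal (GaloisRepresentations.absIntegers (𝓞 K) K) × absoluteGaloisGroup K,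
      𝔓σ.1 ∈ v.primesAbove ∧ IsArithFrobAt (𝓞 K) 𝔓σ.2 𝔓σ.1 := ⟨(𝔓, σ), h𝔓, hσ⟩
  rw [eulerFactorAt, dif_pos hex, ArtinRep.eulerPolynomial] at h
  obtain ⟨k, hk, hk1⟩ := exists_pow_eq_one_of_finite_range ρ (finite_range_holds ρ) hex.choose.2
  exact norm_le_one_of_charpoly_reverse_eq _ hk (restrictInertiaInvariants_pow_eq_one ρ _ _ hk1) h

end ArtinRep


/-! ### The modular-form side: Hecke-theory inputs and the Euler product (1.7.2) -/

namespace ModularForms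

/-! #### Two analytic lemmas -/

/-- **Local factor from the Hecke recursion** (Diamond–Shurman, proof of Thm. 5.9.2, (5.24)):
if `c₀ = 1`, `c₁ = a`, `c_{r+2} = a c_{r+1} - b c_r` and `∑ c_r x^r` converges, then
`(∑_r c_r x^r) · (1 - a x + b x²) = 1`.  (Shift the series twice, `Summable.tsum_eq_zero_add`,
and take the linear combination dictated by the recursion.) [cite: DiamondShurman2005, proof of Thm. 5.9.2, (5.24)] -/
theorem tsum_mul_eq_one_of_recurrence {a b x : ℂ} {c : ℕ → ℂ} (h0 : c 0 = 1) (h1 : c 1 = a)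
    (hrec : ∀ r, c (r + 2) = a * c (r + 1) - b * c r) (hs : Summable fun r ↦ c r * x ^ r) :
    (∑' r, c r * x ^ r) * (1 - a * x + b * x ^ 2) = 1 := by
  set u : ℕ → ℂ := fun r ↦ c r * x ^ r with hu
  have hs1 : Summable fun r ↦ u (r + 1) := (summable_nat_add_iff 1).mpr hs
  have e0 : ∑' r, u r = 1 + ∑' r, u (r + 1) := by
    rw [hs.tsum_eq_zero_add]
    simp [hu, h0]
  have e1 : ∑' r, u (r + 1) = a * x + ∑' r, u (r + 2) := by
    rw [hs1.tsum_eq_zero_add]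
    simp [hu, h1]
  have e2 : ∑' r, u (r + 2) = a * x * ∑' r, u (r + 1) - b * x ^ 2 * ∑' r, u r := by
    rw [← tsum_mul_left, ← tsum_mul_left, ← (hs1.mul_left _).tsum_sub (hs.mul_left _)]
    refine tsum_congr fun r ↦ ?_
    simp only [hu, hrec]
    ring
  change (∑' r, u r) * _ = 1
  linear_combination (1 - a * x) * e0 + e1 + e2

/-- **`∑ d(n) n^{-s}` converges absolutely for `re s > 1`** (`= ζ(s)²`): the Dirichlet
series of the divisor-counting function `d = σ₀ = ζ * ζ` (Mathlib `ArithmeticFunction.sigma`,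
`coe_zeta_mul_apply`) is summable there (Mathlib `ArithmeticFunction.LSeriesSummable_mul`,
`LSeriesSummable_zeta_iff`), and in `ℂ` summability is absolute (`summable_norm_iff`).
Ref: Hardy–Wright, *An Introduction to the Theory of Numbers*, Ch. XVII (`ζ(s)² = ∑ d(n) n^{-s}`,
`σ > 1`), as used in Deligne–Serre 1974, §9 (Cor. 9.2). [folklore] -/
theorem summable_norm_term_card_divisors {s : ℂ} (hs : 1 < s.re) :
    Summable fun n : ℕ ↦ ‖LSeries.term (fun n ↦ (n.divisors.card : ℂ)) s n‖ := by
  have hζ : LSeriesSummable (fun n ↦ ((ArithmeticFunction.zeta : ArithmeticFunction ℂ) n : ℂ))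
      s := by
    refine (LSeriesSummable_congr s fun {n} _ ↦ ?_).mp
      (ArithmeticFunction.LSeriesSummable_zeta_iff.mpr hs)
    simp [ArithmeticFunction.natCoe_apply]
  have hmul := ArithmeticFunction.LSeriesSummable_mul hζ hζ
  have heq : ∀ n : ℕ, (((ArithmeticFunction.zeta : ArithmeticFunction ℂ) *
      (ArithmeticFunction.zeta : ArithmeticFunction ℂ)) n : ℂ) = (n.divisors.card : ℂ) := by
    intro n
    rw [ArithmeticFunction.coe_zeta_mul_apply, Finset.card_eq_sum_ones, Nat.cast_sum]
    refine Finset.sum_congr rfl fun i hi ↦ ?_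
    rw [ArithmeticFunction.natCoe_apply,
      ArithmeticFunction.zeta_apply_ne (Nat.pos_of_mem_divisors hi).ne']
  have hmul' : LSeriesSummable (fun n ↦ (n.divisors.card : ℂ)) s :=
    (LSeriesSummable_congr s fun {n} _ ↦ heq n).mp hmul
  exact summable_norm_iff.mpr hmul'

/-! #### Hecke theory of newforms on `Γ₁(N)`: two named facts (Diamond–Shurman Prop. 5.8.5) -/

/-- **Multiplicativity of the Fourier coefficients of a newform on `Γ₁(N)`**
(Diamond–Shurman, GTM 228, Prop. 5.8.5 (3), with Def. 5.8.1 and Thm. 5.8.2).  Let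
`f = ∑ aₙ qⁿ ∈ S_k(Γ₁(N))` be a newform (`IsNewform1`: a normalised Hecke eigenform in the new
subspace, eigen for the diamond operators; by Thm. 5.8.2 it lies in some `S_k(N, χ)` and
`T_n f = a_n(f) f` for all `n ≥ 1`, so it is a normalised eigenform in the sense of
Def. 5.8.1 and Prop. 5.8.5 applies).  Then `a_{mn}(f) = a_m(f) a_n(f)` whenever `(m, n) = 1`.
(For `m = 0` coprimality forces `n = 1` and the identity is `a₀ = a₀ a₁`, true as `a₁ = 1`.)
The `Γ₁(N)` companion of `IsNewform0.coeff_mul_of_coprime` (`Newforms`); `cuspCoeff f n` is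
the `n`-th coefficient of the period-`1` `q`-expansion. [cite: DiamondShurman2005, Prop. 5.8.5 (3)] -/
def _root_.Literature.NumberTheory.EllipticCurves.ModularForms.IsNewform1.cuspCoeff_mul_of_coprime : Prop :=
  ∀ {N : ℕ} [NeZero N] {k : ℤ} {f : CuspForm (Gamma1 N) k} (_hf : EllipticCurves.ModularForms.IsNewform1 f) {m n : ℕ}
    (_hmn : m.Coprime n), EllipticCurves.ModularForms.cuspCoeff f (m * n) = EllipticCurves.ModularForms.cuspCoeff f m * EllipticCurves.ModularForms.cuspCoeff f n

/-- **Hecke recursion at prime powers for a newform on `Γ₁(N)`** (Diamond–Shurman, GTM 228,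
Prop. 5.8.5 (2), with Def. 5.8.1 and Thm. 5.8.2): for `f = ∑ aₙ qⁿ ∈ S_k(Γ₁(N))` a newform
with nebentypus `χ = nebentypus f` (a Dirichlet character mod `N`, so `χ(p) = 0` for `p ∣ N`),
every prime `p` and every `r ≥ 0`,
`a_{p^{r+2}}(f) = a_p(f) a_{p^{r+1}}(f) - χ(p) p^{k-1} a_{p^r}(f)`
(printed as `a_{p^r} = a_p a_{p^{r-1}} - χ(p) p^{k-1} a_{p^{r-2}}` for `r ≥ 2`).  Equivalently
(Diamond–Shurman (5.25)), `∑_r a_{p^r} p^{-rs} = (1 - a_p p^{-s} + χ(p) p^{k-1-2s})⁻¹`, the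
`p`-Euler factor of Deligne–Serre 1974, (1.7.2). [cite: DiamondShurman2005, Prop. 5.8.5 (2)] -/
def _root_.Literature.NumberTheory.EllipticCurves.ModularForms.IsNewform1.cuspCoeff_prime_pow_add_two : Prop :=
  ∀ {N : ℕ} [NeZero N] {k : ℤ} {f : CuspForm (Gamma1 N) k} (_hf : EllipticCurves.ModularForms.IsNewform1 f) {p : ℕ}
    (_hp : p.Prime) (r : ℕ),
    EllipticCurves.ModularForms.cuspCoeff f (p ^ (r + 2)) =
      EllipticCurves.ModularForms.cuspCoeff f p * EllipticCurves.ModularForms.cuspCoeff f (p ^ (r + 1)) -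
        EllipticCurves.ModularForms.nebentypus f (p : ZMod N) * (p : ℂ) ^ (k - 1) * EllipticCurves.ModularForms.cuspCoeff f (p ^ r)

/-- The recursion of `IsNewform1.cuspCoeff_prime_pow_add_two` in weight one (`p^{k-1} = 1`):
`a_{p^{r+2}} = a_p a_{p^{r+1}} - ε(p) a_{p^r}`. [cite: DiamondShurman2005, Prop. 5.8.5 (2)] -/
theorem _root_.Literature.NumberTheory.EllipticCurves.ModularForms.IsNewform1.cuspCoeff_prime_pow_add_two.weight_one
    (hrec : EllipticCurves.ModularForms.IsNewform1.cuspCoeff_prime_pow_add_two) {N : ℕ} [NeZero N]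
    {f : CuspForm (Gamma1 N) 1} (hf : EllipticCurves.ModularForms.IsNewform1 f) {p : ℕ} (hp : p.Prime) (r : ℕ) :
    EllipticCurves.ModularForms.cuspCoeff f (p ^ (r + 2)) =
      EllipticCurves.ModularForms.cuspCoeff f p * EllipticCurves.ModularForms.cuspCoeff f (p ^ (r + 1)) - EllipticCurves.ModularForms.nebentypus f (p : ZMod N) * EllipticCurves.ModularForms.cuspCoeff f (p ^ r) := by
  have := hrec hf hp r
  simp only [sub_self, zpow_zero, mul_one] at this
  exact this

/-! #### The weight-one Ramanujan bound (Deligne–Serre Thm. 9.1) -/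

/-- **Deligne–Serre 1974, Thm. 9.1, in the precise form (9.3) for primitive forms.**  Let
`f = ∑ aₙ qⁿ ∈ S_1(Γ₁(N))` be a newform of weight one (a primitive cusp form of type `(1, ε)`
on `Γ₀(N)` in the terminology of loc. cit. §1.7).  Then `|aₙ| ≤ d_N(n) ≤ d(n)` for every
`n ≥ 1`, where `d(n)` is the number of positive divisors of `n` (`Nat.divisors`); we record the
printed bound `|aₙ| ≤ d(n)`.  (Loc. cit.: by multiplicativity it suffices to treat `n = p^m`;
for `p ∣ N`, `aₙ = a_p^m` with `a_p` zero or a root of unity by Thm. 4.6; for `p ∤ N`,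
`aₙ = λ^m + λ^{m-1} μ + ⋯ + μ^m` with `λ`, `μ` roots of unity by Thm. 4.1.)  Consequence used
here: `∑ aₙ n^{-s}` converges absolutely for `re s > 1` (Cor. 9.2).
[cite: DeligneSerreASENS1974, §9 Thm. 9.1 and (9.3)] -/
def norm_cuspCoeff_le_card_divisors_weight_one : Prop :=
  ∀ {N : ℕ} [NeZero N] {f : CuspForm (Gamma1 N) 1} (_hf : EllipticCurves.ModularForms.IsNewform1 f) {n : ℕ} (_hn : n ≠ 0),
    ‖EllipticCurves.ModularForms.cuspCoeff f n‖ ≤ (n.divisors.card : ℝ)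

/-! #### The Euler product of a weight-one newform on `re s > 1` -/

/-- **Euler product of a weight-one newform on `re s > 1`** (Deligne–Serre 1974, §1.7,
(1.7.2), with §9, Thm. 9.1 / Cor. 9.2 for the region of convergence).  Let `f = ∑ aₙ qⁿ` be a
newform (primitive cusp form) in `S_1(Γ₁(N))` with nebentypus `ε` (`IsNewform1`,
`nebentypus`).  Then `f` is an eigenfunction of all `T_p` and `U_p` with eigenvalues `a_p`, and
the Dirichlet series `L(f, s) = ∑ aₙ n^{-s}` (`cuspFormLSeries`) has the Euler product
`L(f, s) = ∏_{p ∣ N} (1 - a_p p^{-s})⁻¹ ∏_{p ∤ N} (1 - a_p p^{-s} + ε(p) p^{-2s})⁻¹`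
(loc. cit. (1.7.2) with `k = 1`; the two cases are one formula since the Dirichlet character
`ε` mod `N` vanishes at `p ∣ N`, and `p^{-2s}` is written `(p^{-s})²`).  Region: by loc. cit.
Thm. 9.1 (`|aₙ| ≤ d(n)`) both sides converge absolutely for `re s > 1`, and the product
converges (unconditionally, `HasProd` over `Nat.Primes`) to `L(f, s)` there.  Relation to
the tree: `IsNewform1.hasProd_cuspFormLSeries` (`Gamma1NewformLSeries`) is (1.7.2) for
newforms of any weight `k` on the Hecke region `re s > k/2 + 1` of absolute convergence from the
trivial bound, i.e. `re s > 3/2` in weight one; the present fact is the genuinely stronger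
weight-one statement on `re s > 1` (the region of `artinLFunction_eq_cuspFormLSeries`), whose
extra input is Thm. 9.1.  It is **proved** below from `IsNewform1.cuspCoeff_mul_of_coprime`,
`IsNewform1.cuspCoeff_prime_pow_add_two` and `norm_cuspCoeff_le_card_divisors_weight_one`
(`hasProd_cuspFormLSeries_weight_one_of`), and, for a form with an attached `ρ`, without
Thm. 9.1 (`hasProd_cuspFormLSeries_of_norm_le` with
`Lang.norm_cuspCoeff_le_card_divisors_of_isGaloisRepOfNewform1`).
[cite: DeligneSerreASENS1974, §1.7 (1.7.2) and §9 Thm. 9.1] -/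
def _root_.Literature.NumberTheory.EllipticCurves.ModularForms.IsNewform1.hasProd_cuspFormLSeries_weight_one : Prop :=
  ∀ {N : ℕ} [NeZero N] {f : CuspForm (Gamma1 N) 1} (_hf : EllipticCurves.ModularForms.IsNewform1 f) {s : ℂ}
    (_hs : 1 < s.re),
    HasProd (fun p : Nat.Primes ↦
      (1 - EllipticCurves.ModularForms.cuspCoeff f p * (p : ℂ) ^ (-s) +
        EllipticCurves.ModularForms.nebentypus f ((p : ℕ) : ZMod N) * ((p : ℂ) ^ (-s)) ^ 2)⁻¹)
      (EllipticCurves.ModularForms.cuspFormLSeries f s)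

/-- **The Euler product (1.7.2) on `re s > 1` for one form, from its Hecke relations and the
bound `|aₙ| ≤ d(n)`** (Diamond–Shurman, proof of Thm. 5.9.2, (5.24)–(5.26); Deligne–Serre 1974,
§1.7 and Cor. 9.2).  Let `f = ∑ aₙ qⁿ ∈ S_1(Γ₁(N))` be a newform whose coefficients are
multiplicative on coprime arguments, satisfy `a_{p^{r+2}} = a_p a_{p^{r+1}} - ε(p) a_{p^r}` at
every prime `p`, and `|aₙ| ≤ d(n)` for `n ≥ 1`.  Then for `re s > 1`,
`L(f, s) = ∏_p (1 - a_p p^{-s} + ε(p) p^{-2s})⁻¹` (`HasProd` over `Nat.Primes`).  The summands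
`G(n) = aₙ n^{-s}` are multiplicative (`Complex.natCast_mul_natCast_cpow`), `G(1) = 1`
(`a₁ = 1`), and `∑ ‖G(n)‖ < ∞` since `‖G(n)‖ ≤ d(n) n^{-re s}`
(`summable_norm_term_card_divisors`); so Mathlib's `EulerProduct.eulerProduct_hasProd` gives
`∏_p ∑_e G(p^e) = ∑ G(n) = L(f, s)`, and each local factor is
`∑_e a_{p^e} p^{-es} = (1 - a_p p^{-s} + ε(p) p^{-2s})⁻¹` by the recursion
(`tsum_mul_eq_one_of_recurrence`).  Per-form core of
`IsNewform1.hasProd_cuspFormLSeries_weight_one_of`; the bound `|aₙ| ≤ d(n)` is supplied either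
by the named fact `norm_cuspCoeff_le_card_divisors_weight_one` (Thm. 9.1) or, when a
representation `ρ` attached to `f` is at hand, by the theorem
`Lang.norm_cuspCoeff_le_card_divisors_of_isGaloisRepOfNewform1` below.
[cite: DiamondShurman2005, Thm. 5.9.2 and its proof] -/
theorem hasProd_cuspFormLSeries_of_norm_le {N : ℕ} [NeZero N] {f : CuspForm (Gamma1 N) 1}
    (hf : EllipticCurves.ModularForms.IsNewform1 f)
    (hmulc : ∀ {m n : ℕ}, m.Coprime n → EllipticCurves.ModularForms.cuspCoeff f (m * n) = EllipticCurves.ModularForms.cuspCoeff f m * EllipticCurves.ModularForms.cuspCoeff f n)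
    (hrec : ∀ {p : ℕ}, p.Prime → ∀ r : ℕ, EllipticCurves.ModularForms.cuspCoeff f (p ^ (r + 2)) =
      EllipticCurves.ModularForms.cuspCoeff f p * EllipticCurves.ModularForms.cuspCoeff f (p ^ (r + 1)) - EllipticCurves.ModularForms.nebentypus f (p : ZMod N) * EllipticCurves.ModularForms.cuspCoeff f (p ^ r))
    (hbound : ∀ {n : ℕ}, n ≠ 0 → ‖EllipticCurves.ModularForms.cuspCoeff f n‖ ≤ (n.divisors.card : ℝ)) {s : ℂ}
    (hs : 1 < s.re) :
    HasProd (fun p : Nat.Primes ↦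
      (1 - EllipticCurves.ModularForms.cuspCoeff f p * (p : ℂ) ^ (-s) +
        EllipticCurves.ModularForms.nebentypus f ((p : ℕ) : ZMod N) * ((p : ℂ) ^ (-s)) ^ 2)⁻¹)
      (EllipticCurves.ModularForms.cuspFormLSeries f s) := by
  have hs0 : s ≠ 0 := Complex.ne_zero_of_one_lt_re hs
  have ha1 : EllipticCurves.ModularForms.cuspCoeff f 1 = 1 := hf.2.2.2
  -- the summands `a_n n^{-s}` of `L(f, s)`
  set G : ℕ → ℂ := fun n ↦ EllipticCurves.ModularForms.cuspCoeff f n * (n : ℂ) ^ (-s) with hG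
  have hterm : ∀ n, LSeries.term (EllipticCurves.ModularForms.cuspCoeff f) s n = G n := fun n ↦ by
    rw [hG, LSeries.term_of_ne_zero' hs0, div_eq_mul_inv, ← cpow_neg]
  -- absolute convergence for `re s > 1`, by comparison with `∑ d(n) n^{-s} = ζ(s)²`
  have hsumT : Summable fun n ↦ ‖LSeries.term (EllipticCurves.ModularForms.cuspCoeff f) s n‖ := by
    refine (summable_norm_term_card_divisors hs).of_nonneg_of_le (fun _ ↦ norm_nonneg _)
      fun n ↦ ?_
    rcases eq_or_ne n 0 with rfl | hn
    · simp [LSeries.term_zero]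
    · exact LSeries.norm_term_le s (by simpa using hbound hn)
  have hsum : Summable fun n ↦ ‖G n‖ := by simpa only [hterm] using hsumT
  have hG0 : G 0 = 0 := by simp [hG, zero_cpow (neg_ne_zero.mpr hs0)]
  have hG1 : G 1 = 1 := by simp [hG, ha1]
  -- multiplicativity on coprime arguments
  have hGmul : ∀ {m n : ℕ}, m.Coprime n → G (m * n) = G m * G n := by
    intro m n hmn
    simp only [hG]
    rw [hmulc hmn, Nat.cast_mul, natCast_mul_natCast_cpow]
    ring
  have hEP := EulerProduct.eulerProduct_hasProd hG1 hGmul hsum hG0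
  -- the local factors: `∑_e a_{p^e} x^e = (1 - a_p x + ε(p) x²)⁻¹`, `x = p^{-s}`
  have hfactor : ∀ p : Nat.Primes, ∑' e : ℕ, G ((p : ℕ) ^ e) =
      (1 - EllipticCurves.ModularForms.cuspCoeff f p * (p : ℂ) ^ (-s) +
        EllipticCurves.ModularForms.nebentypus f ((p : ℕ) : ZMod N) * ((p : ℂ) ^ (-s)) ^ 2)⁻¹ := by
    intro p
    have hp : (p : ℕ).Prime := p.2
    have hGp : ∀ e : ℕ, G ((p : ℕ) ^ e) = EllipticCurves.ModularForms.cuspCoeff f ((p : ℕ) ^ e) * ((p : ℂ) ^ (-s)) ^ e :=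
      fun e ↦ by
        simp only [hG]
        rw [Nat.cast_pow, ← natCast_cpow_natCast_mul, ← cpow_nat_mul]
    have hsx : Summable fun e : ℕ ↦ EllipticCurves.ModularForms.cuspCoeff f ((p : ℕ) ^ e) * ((p : ℂ) ^ (-s)) ^ e := by
      have := hsum.of_norm.comp_injective (Nat.pow_right_injective hp.two_le)
      simpa only [Function.comp_def, hGp] using this
    have hrec' : ∀ r : ℕ, EllipticCurves.ModularForms.cuspCoeff f ((p : ℕ) ^ (r + 2)) =
        EllipticCurves.ModularForms.cuspCoeff f p * EllipticCurves.ModularForms.cuspCoeff f ((p : ℕ) ^ (r + 1)) -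
          EllipticCurves.ModularForms.nebentypus f ((p : ℕ) : ZMod N) * EllipticCurves.ModularForms.cuspCoeff f ((p : ℕ) ^ r) := fun r ↦ hrec hp r
    have key := tsum_mul_eq_one_of_recurrence (x := (p : ℂ) ^ (-s)) (a := EllipticCurves.ModularForms.cuspCoeff f p)
      (b := EllipticCurves.ModularForms.nebentypus f ((p : ℕ) : ZMod N)) (c := fun e ↦ EllipticCurves.ModularForms.cuspCoeff f ((p : ℕ) ^ e))
      (by simp only [pow_zero, ha1]) (by simp only [pow_one]) hrec' hsx
    simp_rw [hGp]
    exact eq_inv_of_mul_eq_one_left key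
  have hL : EllipticCurves.ModularForms.cuspFormLSeries f s = ∑' n, G n := tsum_congr hterm
  rw [hL, show (fun p : Nat.Primes ↦ (1 - EllipticCurves.ModularForms.cuspCoeff f p * (p : ℂ) ^ (-s) +
      EllipticCurves.ModularForms.nebentypus f ((p : ℕ) : ZMod N) * ((p : ℂ) ^ (-s)) ^ 2)⁻¹) =
      fun p : Nat.Primes ↦ ∑' e : ℕ, G ((p : ℕ) ^ e) from funext fun p ↦ (hfactor p).symm]
  exact hEP

/-- **Proof of the Euler product (1.7.2) on `re s > 1` from Prop. 5.8.5 (2)–(3) and Thm. 9.1**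
(Diamond–Shurman, proof of Thm. 5.9.2, (5.24)–(5.26); Deligne–Serre 1974, §1.7 and Cor. 9.2):
`hasProd_cuspFormLSeries_of_norm_le` fed with the three named facts
`IsNewform1.cuspCoeff_mul_of_coprime`, `IsNewform1.cuspCoeff_prime_pow_add_two`
(weight `k = 1`, so `p^{k-1} = 1`) and `norm_cuspCoeff_le_card_divisors_weight_one`.
[cite: DiamondShurman2005, Thm. 5.9.2 and its proof] -/
theorem _root_.Literature.NumberTheory.EllipticCurves.ModularForms.IsNewform1.hasProd_cuspFormLSeries_weight_one_of
    (hmulc : EllipticCurves.ModularForms.IsNewform1.cuspCoeff_mul_of_coprime)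
    (hrec : EllipticCurves.ModularForms.IsNewform1.cuspCoeff_prime_pow_add_two)
    (hbound : norm_cuspCoeff_le_card_divisors_weight_one) :
    EllipticCurves.ModularForms.IsNewform1.hasProd_cuspFormLSeries_weight_one := by
  intro N _ f hf s hs
  exact hasProd_cuspFormLSeries_of_norm_le hf (hmulc hf) (hrec.weight_one hf) (hbound hf) hs

end ModularForms

section Lang

open EllipticCurves.ModularForms ModularForms Rat.HeightOneSpectrum

/-! ### The Galois side: Deligne–Serre Thm. 4.6 (b) at the primes `p ∣ N` (named fact) -/

/-- **Deligne–Serre 1974, Thm. 4.6 (b), the local statement at the primes dividing the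
level.**  Let `f = ∑ aₙ qⁿ ∈ S_1(Γ₁(N))` be a newform (primitive cusp form of type `(1, ε)`)
and let `ρ : Γ_ℚ → GL_2(ℂ)` be a continuous representation attached to `f` away from `N`
(`IsGaloisRepOfNewform1`: unramified at `p ∤ N` with `charpoly ρ(Frob_p) = X² - a_p X + ε(p)`,
arithmetic Frobenius; by loc. cit. Thm. 4.1, Rem. 4.3 and Lemma 3.2 such a `ρ` is the
Deligne–Serre representation of `f`, unique up to isomorphism).  Then for every prime `p ∣ N`,
every prime `𝔓` of `\bar ℤ` above `p` and every arithmetic Frobenius `σ` at `𝔓`, the local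
Euler factor of the Artin L-function `L(s, ρ)` at `p` (Artin's definition,
`det(1 - ρ(σ) T | V^{I_𝔓})`, `ArtinRep.eulerPolynomial`) is `1 - a_p T`, the `p`-factor of
`L(f, s)` (loc. cit. (1.7.2)).  This is statement (b) of Thm. 4.6, `L(s, ρ) = ∑ aₙ n^{-s}`,
read off prime by prime at `p ∣ N` (at `p ∤ N` the factors agree by Thm. 4.1, loc. cit. proof
of 4.6, step (iii)); in the printed proof it is the conclusion "`A = 1` and `F_p = 1` for
`p ∣ N`" of step (iii), obtained from the functional equations of `Λ_f` (step (i): `f | W_N`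
is a multiple of `f̄`, Li, Miyake) and of `Λ(s, ρ)` (step (ii), Artin), the elementary
Lemma 4.9 on finite Euler products, and the bounds `|a_p| ≤ 1` (§1.8), `|b_p|, |c_p| ≤ 1`
(step (iv)) — the *same* computation that gives Thm. 4.6 (a), so this fact sits in one DAG
with `DeligneSerre1974.thm46a_artinConductorNat_eq` (`LanglandsTunnellProofs`) over the shared lower layers
`DeligneSerre1974.weightOne_functionalEquation` (i), `Lang.artin_functional_equation` with
`FramedArtinRep.gammaFactor_eq_of_isOdd` and `DeligneSerre1974.rem45_isOdd` (ii),
`IsNewform1.cuspCoeff_of_dvd_level` (1.8) and `DeligneSerre1974.lemma49_holds` (Lemma 4.9,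
proved); the analytic argument delivers the per-place form
`deligneSerre_eulerFactorAt_eq_of_dvd_level` below (one Euler factor per place, the one
`L(s, ρ)` sees), the all-pairs form stated here being that one combined with the independence
of the choices (`ArtinRep.eulerFactorAt_spec`).  Here `p = primesEquiv v` for the finite place
`v` of `ℚ` (Mathlib `Rat.HeightOneSpectrum.primesEquiv`).
[cite: DeligneSerreASENS1974, Thm. 4.6 (b) and its proof, step (iii)] -/
def deligneSerre_eulerPolynomial_eq_of_dvd_level : Prop :=
  ∀ {N : ℕ} [NeZero N] {f : CuspForm (Gamma1 N) 1} {ρ : GaloisRepresentations.FramedArtinRep ℚ 2} (_hf : IsNewform1 f)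
    (_hρ : IsGaloisRepOfNewform1 f (algebraMap (coeffCharField f) ℂ) {p | p ∣ N} ρ)
    {v : HeightOneSpectrum (𝓞 ℚ)} (_hv : ((primesEquiv v : Nat.Primes) : ℕ) ∣ N)
    {𝔓 : Ideal (GaloisRepresentations.absIntegers (𝓞 ℚ) ℚ)} (h𝔓 : 𝔓 ∈ v.primesAbove) {σ : absoluteGaloisGroup ℚ}
    (hσ : IsArithFrobAt (𝓞 ℚ) σ 𝔓),
    ρ.toArtinRep.eulerPolynomial 𝔓 ⟨σ, by haveI := h𝔓.1; exact hσ.mem_stabilizer⟩ =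
      1 - C (cuspCoeff f (primesEquiv v : Nat.Primes)) * X

/-! ### Euler factors of `ρ` attached to `f`: the unramified primes (proved) -/

section EulerFactors

variable {N : ℕ} [NeZero N] {f : CuspForm (Gamma1 N) 1} {ρ : GaloisRepresentations.FramedArtinRep ℚ 2}

/-- In weight one the Hecke polynomial at `q`, mapped to `ℂ[X]`, is `X² - a_q X + ε(q)`
(`map_heckePolynomial` with `q^{k-1} = q⁰ = 1`). [folklore] -/
theorem map_heckePolynomial_weight_one (f : CuspForm (Gamma1 N) 1) (q : ℕ) :
    (heckePolynomial f q).map (algebraMap (coeffCharField f) ℂ) =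
      X ^ 2 - C (cuspCoeff f q) * X + C (nebentypus f (q : ZMod N)) := by
  rw [map_heckePolynomial, sub_self, zpow_zero, mul_one]
  rfl

/-- `reverse (X² - a X + b) = 1 - a T + b T²`: passage from `det(X - F)` to `det(1 - T F)`
for a `2 × 2` matrix `F` with trace `a` and determinant `b`. [folklore] -/
theorem reverse_X_sq_sub_add (a b : ℂ) :
    (X ^ 2 - C a * X + C b : ℂ[X]).reverse = 1 - C a * X + C b * X ^ 2 := by
  have hnat : (X ^ 2 - C a * X + C b : ℂ[X]).natDegree = 2 := by compute_degree!
  rw [Polynomial.reverse, hnat,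
    show (X ^ 2 - C a * X + C b : ℂ[X]) = X ^ 2 - C a * X ^ 1 + C b by rw [pow_one],
    reflect_add, reflect_sub, reflect_C_mul, reflect_monomial, reflect_monomial, reflect_C]
  simp [revAt_le]

/-- **Euler factors at the unramified primes.**  If `ρ` is attached to `f ∈ S_1(Γ₁(N))` away
from `N` (`IsGaloisRepOfNewform1`), then at every prime `p ∤ N` the Euler factor of `L(s, ρ)`
is `L_p(ρ, T) = 1 - a_p T + ε(p) T²`: `ρ` is unramified at `p`, so `V^{I_𝔓} = V`
(`ArtinRep.eulerPolynomial_eq_reverse_charpoly`) and `det(1 - T ρ(Frob_𝔓))` is the reverse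
of `charpoly ρ(Frob_𝔓) = X² - a_p X + ε(p)`, for every `𝔓 ∣ p` and every arithmetic Frobenius
(`ArtinRep.eulerFactorAt_eq_of_forall_eulerPolynomial_eq`).  This is the (easy) agreement of
the Euler factors of `L(s, f)` and `L(s, ρ)` at `p ∤ N` used in Deligne–Serre 1974, proof of
Thm. 4.6, step (iii) ("si `p` ne divise pas `N`, les `p`-facteurs coïncident d'après 4.1").
[cite: DeligneSerreASENS1974, proof of Thm. 4.6, step (iii)] -/
theorem eulerFactorAt_eq_of_not_dvd_level
    (hρ : IsGaloisRepOfNewform1 f (algebraMap (coeffCharField f) ℂ) {p | p ∣ N} ρ)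
    {v : HeightOneSpectrum (𝓞 ℚ)} (hv : ¬ ((primesEquiv v : Nat.Primes) : ℕ) ∣ N) :
    ρ.toArtinRep.eulerFactorAt v =
      1 - C (cuspCoeff f (primesEquiv v : Nat.Primes)) * X +
        C (nebentypus f ((primesEquiv v : Nat.Primes) : ZMod N)) * X ^ 2 := by
  obtain ⟨hur, hchar⟩ := hρ v hv
  rw [← GaloisRepresentations.FramedGaloisRep.isUnramifiedAt_toGaloisRep_iff] at hur
  rw [← GaloisRepresentations.FramedGaloisRep.hasFrobCharpolyAt_toGaloisRep_iff] at hchar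
  refine GaloisRepresentations.ArtinRep.eulerFactorAt_eq_of_forall_eulerPolynomial_eq _ fun h𝔓 σ hσ => ?_
  rw [GaloisRepresentations.ArtinRep.eulerPolynomial_eq_reverse_charpoly _ (hur _ h𝔓)]
  change (ρ.toGaloisRep σ).charpoly.reverse = _
  rw [hchar _ h𝔓 σ hσ, map_heckePolynomial_weight_one, reverse_X_sq_sub_add]

/-- **Euler factors at the primes dividing the level**, from the named fact
`deligneSerre_eulerPolynomial_eq_of_dvd_level` (Deligne–Serre 1974, Thm. 4.6 (b)): for a
newform `f` and `ρ` attached to it, `L_p(ρ, T) = 1 - a_p T` at every `p ∣ N`.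
[cite: DeligneSerreASENS1974, Thm. 4.6 (b)] -/
theorem eulerFactorAt_eq_of_dvd_level (hloc : deligneSerre_eulerPolynomial_eq_of_dvd_level)
    (hf : IsNewform1 f)
    (hρ : IsGaloisRepOfNewform1 f (algebraMap (coeffCharField f) ℂ) {p | p ∣ N} ρ)
    {v : HeightOneSpectrum (𝓞 ℚ)} (hv : ((primesEquiv v : Nat.Primes) : ℕ) ∣ N) :
    ρ.toArtinRep.eulerFactorAt v = 1 - C (cuspCoeff f (primesEquiv v : Nat.Primes)) * X :=
  GaloisRepresentations.ArtinRep.eulerFactorAt_eq_of_forall_eulerPolynomial_eq _ fun h𝔓 _ hσ => hloc hf hρ hv h𝔓 hσ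

omit [NeZero N] in
/-- A Dirichlet character mod `N` vanishes at the primes dividing `N` (they are not units
mod `N`); in particular `ε(p) = 0` for the nebentypus at `p ∣ N`, so that the uniform local
factor `1 - a_p T + ε(p) T²` of (1.7.2) is `1 - a_p T` there. [folklore] -/
theorem dirichletCharacter_apply_eq_zero_of_prime_dvd (χ : DirichletCharacter ℂ N) {p : ℕ}
    (hp : p.Prime) (hpN : p ∣ N) : χ (p : ZMod N) = 0 := by
  apply MulChar.map_nonunit
  rw [ZMod.isUnit_iff_coprime]
  exact fun h => hp.one_lt.ne' (Nat.Coprime.eq_one_of_dvd h hpN)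

end EulerFactors

/-! ### Thm. 4.6 (b) at `p ∣ N`, per-place form (the input the comparison consumes) -/

section PerPlace

/-- **Deligne–Serre 1974, Thm. 4.6 (b) at the primes dividing the level, per-place form.**
Let `f = ∑ aₙ qⁿ ∈ S_1(Γ₁(N))` be a newform and `ρ : Γ_ℚ → GL_2(ℂ)` a continuous representation
attached to `f` away from `N` (`IsGaloisRepOfNewform1`).  Then for every finite place `v` of
`ℚ` with residue characteristic `p ∣ N`, the Euler factor `L_v(ρ, T)` of the Artin
`L`-function (`ArtinRep.eulerFactorAt`, `det(1 - T ρ(Frob_𝔓) | V^{I_𝔓})` for the pair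
`(𝔓, Frob_𝔓)` chosen there) is `1 - a_p T`, the `p`-factor of `L(f, s)` (loc. cit. (1.7.2)).
This is the consequence of `deligneSerre_eulerPolynomial_eq_of_dvd_level` (all pairs
`(𝔓, Frob_𝔓)`; `deligneSerre_eulerFactorAt_eq_of_dvd_level_of`) that the comparison
`L(s, ρ) = L(s, f)` actually consumes, and the form in which the printed proof (steps
(i)–(iv) and Lemma 4.9, an argument about `L(s, ρ)`, which sees one Euler factor per place)
delivers "`F_p = 1` pour tout `p`". [cite: DeligneSerreASENS1974, Thm. 4.6 (b) and its proof, step (iii)] -/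
def deligneSerre_eulerFactorAt_eq_of_dvd_level : Prop :=
  ∀ {N : ℕ} [NeZero N] {f : CuspForm (Gamma1 N) 1} {ρ : GaloisRepresentations.FramedArtinRep ℚ 2} (_hf : IsNewform1 f)
    (_hρ : IsGaloisRepOfNewform1 f (algebraMap (coeffCharField f) ℂ) {p | p ∣ N} ρ)
    {v : HeightOneSpectrum (𝓞 ℚ)} (_hv : ((primesEquiv v : Nat.Primes) : ℕ) ∣ N),
    ρ.toArtinRep.eulerFactorAt v = 1 - C (cuspCoeff f (primesEquiv v : Nat.Primes)) * X

/-- The all-pairs local statement of Thm. 4.6 (b) implies its per-place form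
(`eulerFactorAt_eq_of_dvd_level`). [cite: DeligneSerreASENS1974, Thm. 4.6 (b)] -/
theorem deligneSerre_eulerFactorAt_eq_of_dvd_level_of
    (hloc : deligneSerre_eulerPolynomial_eq_of_dvd_level) :
    deligneSerre_eulerFactorAt_eq_of_dvd_level :=
  fun hf hρ _ hv ↦ eulerFactorAt_eq_of_dvd_level hloc hf hρ hv

end PerPlace

/-! ### Thm. 9.1 for a newform with an attached representation: `|aₙ| ≤ d(n)` (proved) -/

section Ramanujan

variable {N : ℕ} [NeZero N] {f : CuspForm (Gamma1 N) 1} {ρ : GaloisRepresentations.FramedArtinRep ℚ 2}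

/-- **`|a_{p^r}| ≤ r + 1` at the unramified primes** (Deligne–Serre 1974, proof of Thm. 9.1,
case `p ∤ N`).  Let `ρ` be attached to the weight-one newform `f` away from `N` and let
`p ∤ N`.  The Frobenius `ρ(Frob_𝔓)` (which exists:
`HeightOneSpectrum.exists_isArithFrobAt_of_mem_primesAbove_holds`) has characteristic
polynomial `X² - a_p X + ε(p)` (`IsGaloisRepOfNewform1`) and finite order
(`ArtinRep.finite_range_holds`, `exists_pow_eq_one_of_finite_range`), so `a_p = λ + μ`,
`ε(p) = λ μ` with `λ`, `μ` roots of unity (`exists_eigenvalues_of_charpoly_eq`); the Hecke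
recursion `a_{p^{r+2}} = a_p a_{p^{r+1}} - ε(p) a_{p^r}` then gives
`a_{p^r} = λ^r + λ^{r-1} μ + ⋯ + μ^r`, `|a_{p^r}| ≤ r + 1` (`norm_le_of_recurrence`).
[cite: DeligneSerreASENS1974, §9.1, proof of Thm. 9.1] -/
theorem norm_cuspCoeff_prime_pow_le_of_not_dvd (hf : IsNewform1 f)
    (hρ : IsGaloisRepOfNewform1 f (algebraMap (coeffCharField f) ℂ) {p | p ∣ N} ρ)
    (hrec : ∀ {p : ℕ}, p.Prime → ∀ r : ℕ, cuspCoeff f (p ^ (r + 2)) =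
      cuspCoeff f p * cuspCoeff f (p ^ (r + 1)) - nebentypus f (p : ZMod N) * cuspCoeff f (p ^ r))
    {p : ℕ} (hp : p.Prime) (hpN : ¬ p ∣ N) (r : ℕ) :
    ‖cuspCoeff f (p ^ r)‖ ≤ r + 1 := by
  set v : HeightOneSpectrum (𝓞 ℚ) := (primesEquiv (R := 𝓞 ℚ)).symm ⟨p, hp⟩ with hv
  have hpv : (primesEquiv v : Nat.Primes) = ⟨p, hp⟩ := by rw [hv, Equiv.apply_symm_apply]
  obtain ⟨-, hchar⟩ := hρ v (by rw [hpv]; exact hpN)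
  rw [← GaloisRepresentations.FramedGaloisRep.hasFrobCharpolyAt_toGaloisRep_iff] at hchar
  obtain ⟨𝔓, h𝔓⟩ := HeightOneSpectrum.primesAbove_nonempty v
  obtain ⟨σ, hσ⟩ := HeightOneSpectrum.exists_isArithFrobAt_of_mem_primesAbove_holds h𝔓
  have hc : (ρ.toArtinRep σ).charpoly =
      X ^ 2 - C (cuspCoeff f p) * X + C (nebentypus f (p : ZMod N)) := by
    have := hchar 𝔓 h𝔓 σ hσ
    rw [hpv, map_heckePolynomial_weight_one] at this
    exact this
  obtain ⟨k, hk, hk1⟩ := exists_pow_eq_one_of_finite_range ρ.toArtinRep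
    (GaloisRepresentations.ArtinRep.finite_range_holds (K := ℚ) (V := Fin 2 → ℂ) ρ.toArtinRep) σ
  obtain ⟨l, m, hl, hm, hlm, hlm'⟩ := exists_eigenvalues_of_charpoly_eq _ hk hk1 hc
  refine norm_le_of_recurrence hl hm (c := fun r ↦ cuspCoeff f (p ^ r)) ?_ ?_ (fun r ↦ ?_) r
  · simp only [pow_zero]
    exact hf.2.2.2
  · simp only [pow_one]
    exact hlm.symm
  · rw [hrec hp r, hlm, hlm']

/-- **`|a_{p^r}| ≤ 1` at the primes dividing the level** (Deligne–Serre 1974, proof of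
Thm. 9.1, case `p ∣ N`).  If the Euler factor of `L(s, ρ)` at `p ∣ N` is `1 - a_p T`
(Thm. 4.6 (b), per-place form) then `|a_p| ≤ 1` (`ArtinRep.norm_le_one_of_eulerFactorAt_eq`:
`a_p` is `0` or a root of unity), and the Hecke recursion with `ε(p) = 0`
(`dirichletCharacter_apply_eq_zero_of_prime_dvd`) gives `a_{p^r} = a_p^r`, `|a_{p^r}| ≤ 1`
(`norm_le_one_of_recurrence`). [cite: DeligneSerreASENS1974, §9.1, proof of Thm. 9.1] -/
theorem norm_cuspCoeff_prime_pow_le_of_dvd (hf : IsNewform1 f)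
    (hrec : ∀ {p : ℕ}, p.Prime → ∀ r : ℕ, cuspCoeff f (p ^ (r + 2)) =
      cuspCoeff f p * cuspCoeff f (p ^ (r + 1)) - nebentypus f (p : ZMod N) * cuspCoeff f (p ^ r))
    (hloc : ∀ {v : HeightOneSpectrum (𝓞 ℚ)}, ((primesEquiv v : Nat.Primes) : ℕ) ∣ N →
      ρ.toArtinRep.eulerFactorAt v = 1 - C (cuspCoeff f (primesEquiv v : Nat.Primes)) * X)
    {p : ℕ} (hp : p.Prime) (hpN : p ∣ N) (r : ℕ) :
    ‖cuspCoeff f (p ^ r)‖ ≤ 1 := by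
  set v : HeightOneSpectrum (𝓞 ℚ) := (primesEquiv (R := 𝓞 ℚ)).symm ⟨p, hp⟩ with hv
  have hpv : (primesEquiv v : Nat.Primes) = ⟨p, hp⟩ := by rw [hv, Equiv.apply_symm_apply]
  have hap : ‖cuspCoeff f p‖ ≤ 1 := by
    have h := hloc (v := v) (by rw [hpv]; exact hpN)
    rw [hpv] at h
    exact GaloisRepresentations.ArtinRep.norm_le_one_of_eulerFactorAt_eq _ h
  refine norm_le_one_of_recurrence hap (c := fun r ↦ cuspCoeff f (p ^ r)) ?_ ?_ (fun r ↦ ?_) r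
  · simp only [pow_zero]
    exact hf.2.2.2
  · simp only [pow_one]
  · rw [hrec hp r, dirichletCharacter_apply_eq_zero_of_prime_dvd _ hp hpN, zero_mul, sub_zero]

/-- **Deligne–Serre 1974, Thm. 9.1 in the form (9.3), proved for a newform with an attached
representation.**  Let `f = ∑ aₙ qⁿ ∈ S_1(Γ₁(N))` be a newform whose coefficients are
multiplicative on coprime arguments and satisfy the Hecke recursion at every prime
(Diamond–Shurman Prop. 5.8.5 (3), (2)), let `ρ : Γ_ℚ → GL_2(ℂ)` be attached to `f` away from
`N`, and suppose the Euler factors of `L(s, ρ)` at the `p ∣ N` are `1 - a_p T` (Thm. 4.6 (b),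
per-place form).  Then `|aₙ| ≤ d(n)` for every `n ≥ 1` (`d(n) = #Nat.divisors n`).  This is
the printed proof of Thm. 9.1: "il suffit de considérer le cas où `f` est primitive … comme
`n ↦ aₙ` est multiplicative, il suffit de vérifier (9.3) lorsque `n = p^m`"; `p ∣ N`:
`norm_cuspCoeff_prime_pow_le_of_dvd` (via Thm. 4.6); `p ∤ N`:
`norm_cuspCoeff_prime_pow_le_of_not_dvd` (via Thm. 4.1); assembled by induction over the
factorisation (`Nat.recOnPosPrimePosCoprime`, `Nat.Coprime.card_divisors_mul`,
`ArithmeticFunction.sigma_zero_apply_prime_pow`).  It removes Thm. 9.1 from the inputs of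
`artinLFunction_eq_cuspFormLSeries` (`artinLFunction_eq_cuspFormLSeries_of_hecke`).
[cite: DeligneSerreASENS1974, §9 Thm. 9.1, (9.3) and its proof] -/
theorem norm_cuspCoeff_le_card_divisors_of_isGaloisRepOfNewform1 (hf : IsNewform1 f)
    (hρ : IsGaloisRepOfNewform1 f (algebraMap (coeffCharField f) ℂ) {p | p ∣ N} ρ)
    (hmulc : ∀ {m n : ℕ}, m.Coprime n → cuspCoeff f (m * n) = cuspCoeff f m * cuspCoeff f n)
    (hrec : ∀ {p : ℕ}, p.Prime → ∀ r : ℕ, cuspCoeff f (p ^ (r + 2)) =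
      cuspCoeff f p * cuspCoeff f (p ^ (r + 1)) - nebentypus f (p : ZMod N) * cuspCoeff f (p ^ r))
    (hloc : ∀ {v : HeightOneSpectrum (𝓞 ℚ)}, ((primesEquiv v : Nat.Primes) : ℕ) ∣ N →
      ρ.toArtinRep.eulerFactorAt v = 1 - C (cuspCoeff f (primesEquiv v : Nat.Primes)) * X)
    {n : ℕ} (hn : n ≠ 0) : ‖cuspCoeff f n‖ ≤ (n.divisors.card : ℝ) := by
  induction n using Nat.recOnPosPrimePosCoprime with
  | zero => exact absurd rfl hn
  | one =>
    rw [show cuspCoeff f 1 = 1 from hf.2.2.2, norm_one, Nat.divisors_one, Finset.card_singleton,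
      Nat.cast_one]
  | prime_pow p k hp hk =>
    have hcard : ((p ^ k).divisors.card : ℝ) = k + 1 := by
      rw [← ArithmeticFunction.sigma_zero_apply, ArithmeticFunction.sigma_zero_apply_prime_pow hp]
      push_cast
      rfl
    rw [hcard]
    by_cases hpN : p ∣ N
    · exact (norm_cuspCoeff_prime_pow_le_of_dvd hf hrec hloc hp hpN k).trans
        (le_add_of_nonneg_left k.cast_nonneg)
    · exact norm_cuspCoeff_prime_pow_le_of_not_dvd hf hρ hrec hp hpN k
  | coprime a b ha hb hab iha ihb =>
    rw [hmulc hab, Nat.Coprime.card_divisors_mul hab, Nat.cast_mul, norm_mul]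
    exact mul_le_mul (iha (by omega)) (ihb (by omega)) (norm_nonneg _) (Nat.cast_nonneg _)

/-- **Thm. 9.1 (9.3) for all weight-one newforms, from its printed inputs**: the existence of a
finite-image representation attached to `f` (Thm. 4.1, `DeligneSerre1974.thm41_exists` of
`NewformGaloisRepProofs`), the Hecke relations (Diamond–Shurman Prop. 5.8.5 (3), (2):
`IsNewform1.cuspCoeff_mul_of_coprime`, `IsNewform1.cuspCoeff_prime_pow_add_two`) and Thm. 4.6
(b) at `p ∣ N` (`deligneSerre_eulerFactorAt_eq_of_dvd_level`) imply the named fact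
`norm_cuspCoeff_le_card_divisors_weight_one` (`|aₙ| ≤ d(n)`), by
`norm_cuspCoeff_le_card_divisors_of_isGaloisRepOfNewform1`.
[cite: DeligneSerreASENS1974, §9 Thm. 9.1 and its proof] -/
theorem ModularForms.norm_cuspCoeff_le_card_divisors_weight_one_of
    (h41 : ∀ {N : ℕ} [NeZero N], DeligneSerre1974.thm41_exists (N := N))
    (hmulc : IsNewform1.cuspCoeff_mul_of_coprime) (hrec : IsNewform1.cuspCoeff_prime_pow_add_two)
    (hloc : deligneSerre_eulerFactorAt_eq_of_dvd_level) :
    norm_cuspCoeff_le_card_divisors_weight_one := by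
  intro N _ f hf n hn
  obtain ⟨ρ, hρ, -⟩ := h41 hf
  exact norm_cuspCoeff_le_card_divisors_of_isGaloisRepOfNewform1 hf hρ (hmulc hf)
    (hrec.weight_one hf) (hloc hf hρ) hn

end Ramanujan


/-! ### The reduction: Thm. 4.6 (b) from its inputs -/

section Reduction

variable {N : ℕ} [NeZero N] {f : CuspForm (Gamma1 N) 1} {ρ : GaloisRepresentations.FramedArtinRep ℚ 2}

/-- **`L(s, ρ) = L(f, s)` at one `s`, from the Euler product of `f` at `s` and the local
factors at `p ∣ N`.**  If `ρ` is attached to `f` away from `N`, the Euler factors of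
`L(s, ρ)` at the `p ∣ N` are `1 - a_p T`, and `∏_p (1 - a_p p^{-s} + ε(p) p^{-2s})⁻¹`
converges (`HasProd` over `Nat.Primes`) to `L(f, s)`, then `L(s, ρ) = L(f, s)`: the Euler
factors of `L(s, ρ) = ∏_v L_v(ρ, N v^{-s})⁻¹` (`Literature.NumberTheory.GaloisRepresentations.artinLFunction`, a `tprod` over the finite
places `v` of `ℚ`, `N v = p`, `Rat.residueCard_eq_natGenerator`) are
`1 - a_p p^{-s} + ε(p) p^{-2s}` at `p ∤ N` (`eulerFactorAt_eq_of_not_dvd_level`, i.e. Thm. 4.1)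
and `1 - a_p p^{-s}` at `p ∣ N` (hypothesis; `ε(p) = 0` there,
`dirichletCharacter_apply_eq_zero_of_prime_dvd`), which are exactly the factors of the given
product transported along `Rat.HeightOneSpectrum.primesEquiv`; hence the `tprod` is `L(f, s)`
(`Equiv.hasProd_iff`, `HasProd.tprod_eq`).  This is Deligne–Serre 1974, proof of Thm. 4.6,
step (iii), read backwards: once `F_p = 1` for all `p ∣ N`, the two Dirichlet series coincide.
[cite: DeligneSerreASENS1974, Thm. 4.6 (b), proof step (iii)] -/
theorem artinLFunction_eq_cuspFormLSeries_of_hasProd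
    (hρ : IsGaloisRepOfNewform1 f (algebraMap (coeffCharField f) ℂ) {p | p ∣ N} ρ)
    (hloc : ∀ {v : HeightOneSpectrum (𝓞 ℚ)}, ((primesEquiv v : Nat.Primes) : ℕ) ∣ N →
      ρ.toArtinRep.eulerFactorAt v = 1 - C (cuspCoeff f (primesEquiv v : Nat.Primes)) * X)
    {s : ℂ} (hEP : HasProd (fun p : Nat.Primes ↦
      (1 - cuspCoeff f p * (p : ℂ) ^ (-s) +
        nebentypus f ((p : ℕ) : ZMod N) * ((p : ℂ) ^ (-s)) ^ 2)⁻¹) (cuspFormLSeries f s)) :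
    GaloisRepresentations.artinLFunction ρ.toArtinRep s = cuspFormLSeries f s := by
  have hfac : ∀ v : HeightOneSpectrum (𝓞 ℚ),
      ((ρ.toArtinRep.eulerFactorAt v).eval ((v.residueCard : ℂ) ^ (-s)))⁻¹ =
        (1 - cuspCoeff f (primesEquiv v : Nat.Primes) *
              (((primesEquiv v : Nat.Primes) : ℕ) : ℂ) ^ (-s) +
            nebentypus f (((primesEquiv v : Nat.Primes) : ℕ) : ZMod N) *
              ((((primesEquiv v : Nat.Primes) : ℕ) : ℂ) ^ (-s)) ^ 2)⁻¹ := by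
    intro v
    rw [GaloisRepresentations.Rat.residueCard_eq_natGenerator,
      show natGenerator v = ((primesEquiv v : Nat.Primes) : ℕ) from rfl]
    by_cases hv : ((primesEquiv v : Nat.Primes) : ℕ) ∣ N
    · rw [hloc hv, dirichletCharacter_apply_eq_zero_of_prime_dvd _ (primesEquiv v).2 hv]
      simp
    · rw [eulerFactorAt_eq_of_not_dvd_level hρ hv]
      simp
  unfold GaloisRepresentations.artinLFunction
  simp_rw [hfac]
  exact ((Equiv.hasProd_iff (primesEquiv (R := 𝓞 ℚ))
    (f := fun p : Nat.Primes ↦ (1 - cuspCoeff f p * (p : ℂ) ^ (-s) +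
      nebentypus f ((p : ℕ) : ZMod N) * ((p : ℂ) ^ (-s)) ^ 2)⁻¹)).mpr hEP).tprod_eq

/-- **`L(s, ρ) = L(s, f)` on `re s > 1` from the two inputs of the printed proof.**  Given
(1) the Euler product of the weight-one newform `f` on `re s > 1`
(`IsNewform1.hasProd_cuspFormLSeries_weight_one`, Deligne–Serre 1974 (1.7.2) with Thm. 9.1)
and (2) the local statement of Deligne–Serre 1974, Thm. 4.6 (b) at the primes `p ∣ N`
(`deligneSerre_eulerPolynomial_eq_of_dvd_level`), the named fact
`artinLFunction_eq_cuspFormLSeries` of `LanglandsTunnell` holds for `f` and `ρ`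
(`artinLFunction_eq_cuspFormLSeries_of_hasProd` with `eulerFactorAt_eq_of_dvd_level`).
[cite: DeligneSerreASENS1974, Thm. 4.6 (b), proof step (iii)] -/
theorem artinLFunction_eq_cuspFormLSeries_of_deligneSerre
    (hEP : IsNewform1.hasProd_cuspFormLSeries_weight_one)
    (hloc : deligneSerre_eulerPolynomial_eq_of_dvd_level) :
    artinLFunction_eq_cuspFormLSeries (f := f) (ρ := ρ) := by
  intro hf hρ s hs
  exact artinLFunction_eq_cuspFormLSeries_of_hasProd hρ
    (fun hv ↦ eulerFactorAt_eq_of_dvd_level hloc hf hρ hv) (hEP hf hs)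

/-- **`artinLFunction_eq_cuspFormLSeries` from three leaves: the Hecke relations and
Thm. 4.6 (b) at `p ∣ N`.**  The comparison `L(s, ρ) = L(s, f)` (`re s > 1`) for a weight-one
newform `f` and `ρ` attached to it follows from Diamond–Shurman Prop. 5.8.5 (3) and (2) for
newforms on `Γ₁(N)` (`IsNewform1.cuspCoeff_mul_of_coprime`,
`IsNewform1.cuspCoeff_prime_pow_add_two`) and Deligne–Serre 1974 Thm. 4.6 (b) at the primes
dividing the level in its per-place form (`deligneSerre_eulerFactorAt_eq_of_dvd_level`): the
weight-one Ramanujan bound `|aₙ| ≤ d(n)` (Thm. 9.1) needed for the region `re s > 1` is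
*proved* from these and `ρ` itself (`norm_cuspCoeff_le_card_divisors_of_isGaloisRepOfNewform1`),
then `hasProd_cuspFormLSeries_of_norm_le` and `artinLFunction_eq_cuspFormLSeries_of_hasProd`.
Once the three leaves are discharged, `artinLFunction_eq_cuspFormLSeries_holds` is this
theorem applied to their `_holds` versions. [cite: DeligneSerreASENS1974, Thm. 4.6 (b)] -/
theorem artinLFunction_eq_cuspFormLSeries_of_hecke
    (hmulc : IsNewform1.cuspCoeff_mul_of_coprime) (hrec : IsNewform1.cuspCoeff_prime_pow_add_two)
    (hloc : deligneSerre_eulerFactorAt_eq_of_dvd_level) :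
    artinLFunction_eq_cuspFormLSeries (f := f) (ρ := ρ) := by
  intro hf hρ s hs
  exact artinLFunction_eq_cuspFormLSeries_of_hasProd hρ (hloc hf hρ)
    (hasProd_cuspFormLSeries_of_norm_le hf (hmulc hf) (hrec.weight_one hf)
      (norm_cuspCoeff_le_card_divisors_of_isGaloisRepOfNewform1 hf hρ (hmulc hf)
        (hrec.weight_one hf) (hloc hf hρ)) hs)

/-- **`artinLFunction_eq_cuspFormLSeries` from the four leaves of the first decomposition**
(Diamond–Shurman Prop. 5.8.5 (3), (2), Deligne–Serre 1974 Thm. 9.1 and Thm. 4.6 (b) at the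
primes dividing the level, all-pairs form), via `IsNewform1.hasProd_cuspFormLSeries_weight_one_of`
and `artinLFunction_eq_cuspFormLSeries_of_deligneSerre`.  Superseded by
`artinLFunction_eq_cuspFormLSeries_of_hecke`, which needs neither Thm. 9.1 nor the all-pairs
form. [cite: DeligneSerreASENS1974, Thm. 4.6 (b)] -/
theorem artinLFunction_eq_cuspFormLSeries_of_leaves
    (hmulc : IsNewform1.cuspCoeff_mul_of_coprime)
    (hrec : IsNewform1.cuspCoeff_prime_pow_add_two)
    (hbound : norm_cuspCoeff_le_card_divisors_weight_one)
    (hloc : deligneSerre_eulerPolynomial_eq_of_dvd_level) :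
    artinLFunction_eq_cuspFormLSeries (f := f) (ρ := ρ) :=
  artinLFunction_eq_cuspFormLSeries_of_deligneSerre
    (IsNewform1.hasProd_cuspFormLSeries_weight_one_of hmulc hrec hbound) hloc

end Reduction

end Lang

end DeligneSerre46b

end Literature.NumberTheory.Automorphic


/-! ## Part C — Steps (iii)–(iv) of the printed proof: Thm. 4.6 (b) at `p ∣ N` from the
functional equations (i), (ii) -/

namespace Literature.NumberTheory.Automorphic

open IsDedekindDomain Polynomial Field Complex

/-! ### Euler products from the Hecke relations (generic Dirichlet series) -/

/-- **Euler product of a Dirichlet series with Hecke-type coefficients** (Diamond–Shurman,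
proof of Thm. 5.9.2, (5.24)–(5.26)).  Let `a : ℕ → ℂ` satisfy `a 1 = 1`, `a (m n) = a m · a n`
for coprime `m, n`, and `a (p^{r+2}) = a p · a (p^{r+1}) - e p · a (p^r)` for every prime `p`;
if `∑ a n n^{-s}` converges absolutely at `s`, then
`∑ a n n^{-s} = ∏_p (1 - a p · p^{-s} + e p · p^{-2s})⁻¹` (`HasProd` over `Nat.Primes`).
[cite: DiamondShurman2005, Thm. 5.9.2 and its proof] -/
theorem LSeries_hasProd_of_recurrence {a e : ℕ → ℂ} (h1 : a 1 = 1)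
    (hmulc : ∀ {m n : ℕ}, m.Coprime n → a (m * n) = a m * a n)
    (hrec : ∀ {p : ℕ}, p.Prime → ∀ r : ℕ, a (p ^ (r + 2)) = a p * a (p ^ (r + 1)) - e p * a (p ^ r))
    {s : ℂ} (hs : LSeriesSummable a s) :
    HasProd (fun p : Nat.Primes ↦
      (1 - a p * (p : ℂ) ^ (-s) + e p * ((p : ℂ) ^ (-s)) ^ 2)⁻¹) (LSeries a s) := by
  set G : ℕ → ℂ := LSeries.term a s with hG
  have hGn : ∀ {n : ℕ}, n ≠ 0 → G n = a n * (n : ℂ) ^ (-s) := fun hn ↦ by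
    rw [hG, LSeries.term_of_ne_zero hn, div_eq_mul_inv, ← cpow_neg]
  have hG0 : G 0 = 0 := LSeries.term_zero a s
  have hG1 : G 1 = 1 := by rw [hGn one_ne_zero, h1, Nat.cast_one, one_cpow, mul_one]
  have hGmul : ∀ {m n : ℕ}, m.Coprime n → G (m * n) = G m * G n := by
    intro m n hmn
    rcases eq_or_ne m 0 with rfl | hm
    · rw [zero_mul, hG0, zero_mul]
    rcases eq_or_ne n 0 with rfl | hn
    · rw [mul_zero, hG0, mul_zero]
    rw [hGn (mul_ne_zero hm hn), hGn hm, hGn hn, hmulc hmn, Nat.cast_mul,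
      natCast_mul_natCast_cpow]
    ring
  have hsum : Summable fun n ↦ ‖G n‖ := summable_norm_iff.mpr hs
  have hEP := EulerProduct.eulerProduct_hasProd hG1 hGmul hsum hG0
  have hfactor : ∀ p : Nat.Primes, ∑' r : ℕ, G ((p : ℕ) ^ r) =
      (1 - a p * (p : ℂ) ^ (-s) + e p * ((p : ℂ) ^ (-s)) ^ 2)⁻¹ := by
    intro p
    have hp : (p : ℕ).Prime := p.2
    have hGp : ∀ r : ℕ, G ((p : ℕ) ^ r) = a ((p : ℕ) ^ r) * ((p : ℂ) ^ (-s)) ^ r := fun r ↦ by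
      rw [hGn (pow_ne_zero _ hp.ne_zero), Nat.cast_pow, ← natCast_cpow_natCast_mul,
        ← cpow_nat_mul]
    have hsx : Summable fun r : ℕ ↦ a ((p : ℕ) ^ r) * ((p : ℂ) ^ (-s)) ^ r := by
      have := hsum.of_norm.comp_injective (Nat.pow_right_injective hp.two_le)
      simpa only [Function.comp_def, hGp] using this
    have key := ModularForms.tsum_mul_eq_one_of_recurrence (x := (p : ℂ) ^ (-s)) (a := a p)
      (b := e p) (c := fun r ↦ a ((p : ℕ) ^ r))
      (by simp only [pow_zero, h1]) (by simp only [pow_one]) (hrec hp) hsx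
    simp_rw [hGp]
    exact eq_inv_of_mul_eq_one_left key
  rw [LSeries, show (fun p : Nat.Primes ↦ (1 - a p * (p : ℂ) ^ (-s) +
      e p * ((p : ℂ) ^ (-s)) ^ 2)⁻¹) = fun p : Nat.Primes ↦ ∑' r : ℕ, G ((p : ℕ) ^ r) from
      funext fun p ↦ (hfactor p).symm]
  exact hEP

namespace ModularForms

variable {N : ℕ} [NeZero N]

/-- **(1.7.2) on the Hecke half-plane `re s > 3/2` from the Hecke relations alone.**  For a
weight-one newform `f` on `Γ₁(N)` whose coefficients satisfy Diamond–Shurman Prop. 5.8.5 (3),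
(2), the Euler product `∏_p (1 - a_p p^{-s} + ε(p) p^{-2s})⁻¹` converges to `Φ_f(s)` for
`re s > 3/2` (absolute convergence from the trivial bound, `LSeriesSummable_cuspCoeff`).  This
is the instance `k = 1` of the named fact `IsNewform1.hasProd_cuspFormLSeries`
(`Gamma1NewformLSeries`) for such `f`. [cite: DeligneSerreASENS1974, (1.7.2)] -/
theorem hasProd_cuspFormLSeries_of_hecke {f : CuspForm (Gamma1 N) 1} (hf : EllipticCurves.ModularForms.IsNewform1 f)
    (hmulc : ∀ {m n : ℕ}, m.Coprime n → EllipticCurves.ModularForms.cuspCoeff f (m * n) = EllipticCurves.ModularForms.cuspCoeff f m * EllipticCurves.ModularForms.cuspCoeff f n)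
    (hrec : ∀ {p : ℕ}, p.Prime → ∀ r : ℕ, EllipticCurves.ModularForms.cuspCoeff f (p ^ (r + 2)) =
      EllipticCurves.ModularForms.cuspCoeff f p * EllipticCurves.ModularForms.cuspCoeff f (p ^ (r + 1)) - EllipticCurves.ModularForms.nebentypus f (p : ZMod N) * EllipticCurves.ModularForms.cuspCoeff f (p ^ r))
    {s : ℂ} (hs : 3 / 2 < s.re) :
    HasProd (fun p : Nat.Primes ↦
      (1 - EllipticCurves.ModularForms.cuspCoeff f p * (p : ℂ) ^ (-s) +
        EllipticCurves.ModularForms.nebentypus f ((p : ℕ) : ZMod N) * ((p : ℂ) ^ (-s)) ^ 2)⁻¹)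
      (EllipticCurves.ModularForms.cuspFormLSeries f s) :=
  LSeries_hasProd_of_recurrence (e := fun p ↦ EllipticCurves.ModularForms.nebentypus f (p : ZMod N))
    (show EllipticCurves.ModularForms.cuspCoeff f 1 = 1 from hf.2.2.2) hmulc hrec
    (EllipticCurves.ModularForms.LSeriesSummable_cuspCoeff (strictWidthInfty_Gamma1 N) f (by norm_num; exact hs))

/-- **Euler product of the conjugate series `Φ_{f̃}(s) = Σ ā_n n^{-s}` on `re s > 3/2`**: the
conjugate coefficients satisfy the conjugate Hecke relations, so
`Φ_{f̃}(s) = ∏_p (1 - ā_p p^{-s} + ε̄(p) p^{-2s})⁻¹` (`conjCuspFormLSeries`,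
`LSeriesSummable_conj_cuspCoeff`).  Used for the `(f̃, ρ^∨)` side of Deligne–Serre's
functional-equation argument (proof of Thm. 4.6, (i)–(iii)). [cite: DeligneSerreASENS1974, (1.7.2)] -/
theorem hasProd_conjCuspFormLSeries_of_hecke {f : CuspForm (Gamma1 N) 1} (hf : EllipticCurves.ModularForms.IsNewform1 f)
    (hmulc : ∀ {m n : ℕ}, m.Coprime n → EllipticCurves.ModularForms.cuspCoeff f (m * n) = EllipticCurves.ModularForms.cuspCoeff f m * EllipticCurves.ModularForms.cuspCoeff f n)
    (hrec : ∀ {p : ℕ}, p.Prime → ∀ r : ℕ, EllipticCurves.ModularForms.cuspCoeff f (p ^ (r + 2)) =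
      EllipticCurves.ModularForms.cuspCoeff f p * EllipticCurves.ModularForms.cuspCoeff f (p ^ (r + 1)) - EllipticCurves.ModularForms.nebentypus f (p : ZMod N) * EllipticCurves.ModularForms.cuspCoeff f (p ^ r))
    {s : ℂ} (hs : 3 / 2 < s.re) :
    HasProd (fun p : Nat.Primes ↦
      (1 - (starRingEnd ℂ) (EllipticCurves.ModularForms.cuspCoeff f p) * (p : ℂ) ^ (-s) +
        (starRingEnd ℂ) (EllipticCurves.ModularForms.nebentypus f ((p : ℕ) : ZMod N)) * ((p : ℂ) ^ (-s)) ^ 2)⁻¹)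
      (EllipticCurves.ModularForms.conjCuspFormLSeries f s) := by
  refine LSeries_hasProd_of_recurrence (a := fun n ↦ (starRingEnd ℂ) (EllipticCurves.ModularForms.cuspCoeff f n))
    (e := fun p ↦ (starRingEnd ℂ) (EllipticCurves.ModularForms.nebentypus f (p : ZMod N))) ?_ ?_ ?_
    (EllipticCurves.ModularForms.LSeriesSummable_conj_cuspCoeff (strictWidthInfty_Gamma1 N) f (by norm_num; exact hs))
  · simp only [show EllipticCurves.ModularForms.cuspCoeff f 1 = 1 from hf.2.2.2, map_one]
  · intro m n hmn
    simp only [hmulc hmn, map_mul]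
  · intro p hp r
    simp only [hrec hp r, map_sub, map_mul]

end ModularForms

/-! ### Euler factors of finite-image representations: roots of unity -/

/-- `reverse (X - μ) = 1 - μ T`. [folklore] -/
theorem reverse_X_sub_C' (μ : ℂ) : (X - C μ : ℂ[X]).reverse = 1 - C μ * X := by
  rw [Polynomial.reverse, natDegree_X_sub_C, show (X - C μ : ℂ[X]) = X ^ 1 - C μ by rw [pow_one],
    reflect_sub, reflect_monomial, reflect_C]
  simp [revAt_le]

/-- **Characteristic polynomial of a finite-order endomorphism over `ℂ`.**  If `F^k = 1`
(`k ≥ 1`) on a finite-dimensional complex space `W`, then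
`charpoly F = ∏_{μ} (X - μ)` and `det(1 - T F) = (charpoly F).reverse = ∏_{μ} (1 - μ T)` over
the multiset of roots `μ` (eigenvalues with multiplicity, `dim W` of them), each a `k`-th root
of unity, so `|μ| = 1` ("`b_p` et `c_p` sont … des racines de l'unité", Deligne–Serre 1974,
proof of Thm. 4.6 (iv); §9.1). [cite: DeligneSerreASENS1974, proof of Thm. 4.6 (iv)] -/
theorem Module.End.exists_charpoly_reverse_eq_prod_of_pow_eq_one {W : Type*} [AddCommGroup W]
    [Module ℂ W] [FiniteDimensional ℂ W] (F : Module.End ℂ W) {k : ℕ} (hk : 0 < k)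
    (hF : F ^ k = 1) :
    ∃ m : Multiset ℂ, Multiset.card m = Module.finrank ℂ W ∧ (∀ μ ∈ m, ‖μ‖ = 1) ∧
      F.charpoly = (m.map fun μ ↦ X - C μ).prod ∧
      F.charpoly.reverse = (m.map fun μ ↦ 1 - C μ * X).prod := by
  have hsplit : F.charpoly.Splits := IsAlgClosed.splits _
  have hprod := hsplit.eq_prod_roots_of_monic F.charpoly_monic
  refine ⟨F.charpoly.roots, ?_, ?_, hprod, ?_⟩
  · rw [← F.charpoly_natDegree]
    exact (splits_iff_card_roots.mp hsplit)
  · intro μ hμ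
    have hz' : F.charpoly.IsRoot μ := (mem_roots F.charpoly_monic.ne_zero).mp hμ
    obtain ⟨v, hv⟩ :=
      ((Module.End.hasEigenvalue_iff_isRoot_charpoly F μ).mpr hz').exists_hasEigenvector
    have hkv : (F ^ k) v = μ ^ k • v := hv.pow_apply k
    rw [hF, Module.End.one_apply] at hkv
    have hz1 : μ ^ k = 1 := by
      by_contra hne
      apply hv.2
      have : (μ ^ k - 1) • v = 0 := by rw [sub_smul, one_smul, ← hkv, sub_self]
      exact (smul_eq_zero.mp this).resolve_left (sub_ne_zero.mpr hne)
    exact Complex.norm_eq_one_of_pow_eq_one hz1 hk.ne'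
  · conv_lhs => rw [hprod]
    generalize F.charpoly.roots = m
    induction m using Multiset.induction_on with
    | empty => simpa using reverse_C (1 : ℂ)
    | cons μ m ih =>
      rw [Multiset.map_cons, Multiset.prod_cons, reverse_mul_of_domain, ih, reverse_X_sub_C',
        Multiset.map_cons, Multiset.prod_cons]

section ArtinRep
open Literature.NumberTheory.GaloisRepresentations (ArtinRep)
open Literature.NumberTheory.GaloisRepresentations.ArtinRep

variable {K : Type*} [Field K] [NumberField K] {V : Type*} [AddCommGroup V] [Module ℂ V]
  [TopologicalSpace V] [FiniteDimensional ℂ V] [IsModuleTopology ℂ V]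

/-- **The Euler factors of an Artin representation are products of terms `1 - μ T` with roots
of unity `μ`.**  For every finite place `v`, `L_v(ρ, T) = det(1 - T ρ(Frob_𝔓) | V^{I_𝔓})
= ∏_{μ} (1 - μ T)` over a multiset of complex numbers of absolute value `1` (the eigenvalues of
the Frobenius on the inertia invariants, which has finite order since the image of `ρ` is
finite, `ArtinRep.finite_range_holds`).  In particular `|μ| < N v^{1/2}`, hypothesis (4.9.2)
of Deligne–Serre's Lemma 4.9 for the `L(s, ρ)`-side. [cite: DeligneSerreASENS1974, proof of Thm. 4.6 (iv)] -/
theorem _root_.Literature.NumberTheory.GaloisRepresentations.ArtinRep.exists_eulerFactorAt_eq_prod (ρ : ArtinRep K V) (v : HeightOneSpectrum (𝓞 K)) :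
    ∃ m : Multiset ℂ, (∀ μ ∈ m, ‖μ‖ = 1) ∧
      ρ.eulerFactorAt v = (m.map fun μ ↦ 1 - C μ * X).prod := by
  obtain ⟨𝔓, h𝔓⟩ := HeightOneSpectrum.primesAbove_nonempty v
  obtain ⟨σ, hσ⟩ := HeightOneSpectrum.exists_isArithFrobAt_of_mem_primesAbove_holds h𝔓
  have hex : ∃ 𝔓σ : Ideal (GaloisRepresentations.absIntegers (𝓞 K) K) × absoluteGaloisGroup K,
      𝔓σ.1 ∈ v.primesAbove ∧ IsArithFrobAt (𝓞 K) 𝔓σ.2 𝔓σ.1 := ⟨(𝔓, σ), h𝔓, hσ⟩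
  rw [eulerFactorAt, dif_pos hex, ArtinRep.eulerPolynomial]
  obtain ⟨k, hk, hk1⟩ := exists_pow_eq_one_of_finite_range ρ (finite_range_holds ρ) hex.choose.2
  obtain ⟨m, -, hm, -, hrev⟩ := Module.End.exists_charpoly_reverse_eq_prod_of_pow_eq_one _ hk
    (restrictInertiaInvariants_pow_eq_one ρ hex.choose.1
      ⟨hex.choose.2, by haveI := hex.choose_spec.1.1; exact hex.choose_spec.2.mem_stabilizer⟩ hk1)
  exact ⟨m, hm, hrev⟩

end ArtinRep


/-! ### The contragredient `ρ^∨` of a representation attached to `f` -/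

open scoped Matrix in

/-- **Characteristic polynomial of the inverse transpose of a finite-order `2 × 2` matrix.**
If `A ∈ GL₂(ℂ)` has finite order and `charpoly A = X² - a X + e`, then
`charpoly ((A⁻¹)ᵀ) = X² - ā X + ē`: the eigenvalues `λ, μ` of `A` are roots of unity, so
`tr A⁻¹ = λ⁻¹ + μ⁻¹ = λ̄ + μ̄` and `det A⁻¹ = (λ μ)⁻¹ = \overline{λ μ}`.  For the Frobenius of
the contragredient `ρ̄ = ρ^∨` of a finite-image representation (Deligne–Serre 1974, proof of
Thm. 4.6, (ii): "`ζ(1 - s, ρ) = v · ζ(s, ρ̄)`"). [folklore] -/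
theorem Matrix.charpoly_transpose_inv_of_pow_eq_one (A : GL (Fin 2) ℂ) {k : ℕ} (hk : 0 < k)
    (hA : A ^ k = 1) {a e : ℂ}
    (h : (A : Matrix (Fin 2) (Fin 2) ℂ).charpoly = X ^ 2 - C a * X + C e) :
    (((A⁻¹ : GL (Fin 2) ℂ) : Matrix (Fin 2) (Fin 2) ℂ)ᵀ).charpoly =
      X ^ 2 - C ((starRingEnd ℂ) a) * X + C ((starRingEnd ℂ) e) := by
  set M : Matrix (Fin 2) (Fin 2) ℂ := (A : Matrix (Fin 2) (Fin 2) ℂ) with hM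
  -- trace and determinant of `A`
  have h2 := Matrix.charpoly_fin_two M
  rw [h] at h2
  have htr : M.trace = a := by
    have := congrArg (fun q : ℂ[X] ↦ q.coeff 1) h2
    simp [coeff_C] at this
    exact this.symm
  have hdet : M.det = e := by
    have := congrArg (fun q : ℂ[X] ↦ q.coeff 0) h2
    simp [coeff_X, coeff_C] at this
    exact this.symm
  -- eigenvalues are roots of unity
  have hL : (Matrix.toLin' M) ^ k = 1 := by
    rw [← Matrix.toLin'_pow, hM, ← Units.val_pow_eq_pow_val, hA, Units.val_one, Matrix.toLin'_one,
      Module.End.one_eq_id]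
  obtain ⟨l, m, hl, hm, hlm, hlm'⟩ := exists_eigenvalues_of_charpoly_eq (Matrix.toLin' M) hk hL
    (by rw [Matrix.charpoly_toLin', h])
  have hl0 : l ≠ 0 := fun h0 ↦ by simp [h0] at hl
  have hm0 : m ≠ 0 := fun h0 ↦ by simp [h0] at hm
  have he0 : e ≠ 0 := by rw [← hlm']; exact mul_ne_zero hl0 hm0
  have hdet0 : M.det ≠ 0 := hdet ▸ he0
  -- the inverse
  have hinv : ((A⁻¹ : GL (Fin 2) ℂ) : Matrix (Fin 2) (Fin 2) ℂ) = M⁻¹ := Matrix.coe_units_inv A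
  rw [hinv, Matrix.charpoly_transpose, Matrix.charpoly_fin_two]
  have hdet' : M⁻¹.det = (starRingEnd ℂ) e := by
    rw [Matrix.det_nonsing_inv, Ring.inverse_eq_inv, hdet, ← hlm', mul_inv, map_mul,
      Complex.inv_eq_conj hl, Complex.inv_eq_conj hm]
  have htr' : M⁻¹.trace = (starRingEnd ℂ) a := by
    rw [Matrix.inv_def, Matrix.trace_smul, Ring.inverse_eq_inv, smul_eq_mul]
    have hadj : M.adjugate.trace = M.trace := by
      rw [Matrix.adjugate_fin_two, Matrix.trace_fin_two_of, Matrix.trace_fin_two, add_comm]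
    rw [hadj, htr, hdet, ← hlm, ← hlm', map_add, ← Complex.inv_eq_conj hl,
      ← Complex.inv_eq_conj hm]
    field_simp
    ring
  rw [hdet', htr']

section Lang

open EllipticCurves.ModularForms ModularForms Rat.HeightOneSpectrum

variable {N : ℕ} [NeZero N] {f : CuspForm (Gamma1 N) 1} {ρ : GaloisRepresentations.FramedArtinRep ℚ 2}

/-- A continuous `ρ : Γ_ℚ → GL₂(ℂ)` has finite image (`ArtinRep.finite_range_holds`
transported by `FramedRep.finite_range_toContinuousRep_iff`; Deligne–Serre 1974, §3 (a)).
[folklore] -/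
theorem finite_range_framed (ρ : GaloisRepresentations.FramedArtinRep ℚ 2) :
    (Set.range (ρ : absoluteGaloisGroup ℚ → GL (Fin 2) ℂ)).Finite :=
  (GaloisRepresentations.FramedRep.finite_range_toContinuousRep_iff ρ).mp
    (GaloisRepresentations.ArtinRep.finite_range_holds (K := ℚ) (V := Fin 2 → ℂ) ρ.toArtinRep)

/-- The contragredient of an odd representation is odd: `det (ρ(c)⁻¹)ᵀ = (det ρ(c))⁻¹ = -1`.
[folklore] -/
theorem isOdd_dual (hodd : GaloisRepresentations.FramedGaloisRep.IsOdd ρ) : GaloisRepresentations.FramedGaloisRep.IsOdd (GaloisRepresentations.FramedRep.dual ρ) := by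
  intro φ c hc
  have h := hodd φ c hc
  have hdet : Matrix.GeneralLinearGroup.det (GaloisRepresentations.FramedRep.dual ρ c) =
      (Matrix.GeneralLinearGroup.det (ρ c))⁻¹ := by
    rw [← map_inv]
    ext
    rw [Matrix.GeneralLinearGroup.val_det_apply, Matrix.GeneralLinearGroup.val_det_apply,
      GaloisRepresentations.FramedRep.coe_dual_apply, Matrix.det_transpose]
  rw [hdet, h, inv_neg, inv_one]

/-- The contragredient is unramified wherever `ρ` is. [folklore] -/
theorem isUnramifiedAt_dual {v : HeightOneSpectrum (𝓞 ℚ)} (h : GaloisRepresentations.FramedGaloisRep.IsUnramifiedAt v ρ) :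
    GaloisRepresentations.FramedGaloisRep.IsUnramifiedAt v (GaloisRepresentations.FramedRep.dual ρ) := by
  intro 𝔓 h𝔓 τ hτ
  change GaloisRepresentations.glTransposeInv (Fin 2) ℂ (ρ τ) = 1
  rw [h 𝔓 h𝔓 τ hτ, map_one]

/-- The representation on column vectors of a framed representation acts by `Matrix.toLin'`,
so its characteristic polynomials are the matrix ones (`Matrix.charpoly_toLin'`). [folklore] -/
theorem charpoly_toGaloisRep_apply (ρ : GaloisRepresentations.FramedArtinRep ℚ 2) (σ : absoluteGaloisGroup ℚ) :
    (ρ.toGaloisRep σ : (Fin 2 → ℂ) →ₗ[ℂ] (Fin 2 → ℂ)).charpoly = GaloisRepresentations.FramedRep.charpoly ρ σ := by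
  have e : (ρ.toGaloisRep σ : (Fin 2 → ℂ) →ₗ[ℂ] (Fin 2 → ℂ)) =
      Matrix.toLin' ((ρ σ : GL (Fin 2) ℂ) : Matrix (Fin 2) (Fin 2) ℂ) :=
    LinearMap.ext fun v => by simp
  rw [e, Matrix.charpoly_toLin']
  rfl

/-- **Euler factors of the contragredient at the unramified primes.**  If `ρ` is attached to
the weight-one newform `f` away from `N`, then at every `p ∤ N` the Euler factor of
`L(s, ρ^∨)` (`ρ^∨ = FramedRep.dual ρ`, inverse transpose) is `1 - ā_p T + ε̄(p) T²`: `ρ^∨` is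
unramified at `p` and `charpoly ρ^∨(Frob_p) = X² - ā_p X + ε̄(p)`
(`Matrix.charpoly_transpose_inv_of_pow_eq_one`, the Frobenius having finite order).  These are
the Euler factors of `Φ_{f̃}(s) = Σ ā_n n^{-s}` at `p ∤ N`, i.e. `ρ^∨` plays for `f̃` the role
`ρ` plays for `f` (Deligne–Serre 1974, proof of Thm. 4.6, (i)–(iii): `Λ_{f̃}`, `ζ(s, ρ̄)`).
[cite: DeligneSerreASENS1974, proof of Thm. 4.6, steps (ii)–(iii)] -/
theorem dual_eulerFactorAt_eq_of_not_dvd_level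
    (hρ : IsGaloisRepOfNewform1 f (algebraMap (coeffCharField f) ℂ) {p | p ∣ N} ρ)
    {v : HeightOneSpectrum (𝓞 ℚ)} (hv : ¬ ((primesEquiv v : Nat.Primes) : ℕ) ∣ N) :
    (GaloisRepresentations.FramedArtinRep.toArtinRep (GaloisRepresentations.FramedRep.dual ρ)).eulerFactorAt v =
      1 - C ((starRingEnd ℂ) (cuspCoeff f (primesEquiv v : Nat.Primes))) * X +
        C ((starRingEnd ℂ) (nebentypus f ((primesEquiv v : Nat.Primes) : ZMod N))) * X ^ 2 := by
  obtain ⟨hur, hchar⟩ := hρ v hv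
  have hur' := (GaloisRepresentations.FramedGaloisRep.isUnramifiedAt_toGaloisRep_iff v _).mpr (isUnramifiedAt_dual hur)
  refine GaloisRepresentations.ArtinRep.eulerFactorAt_eq_of_forall_eulerPolynomial_eq _ fun {𝔓} h𝔓 {σ} hσ => ?_
  rw [GaloisRepresentations.ArtinRep.eulerPolynomial_eq_reverse_charpoly _ (hur' _ h𝔓)]
  change (GaloisRepresentations.FramedGaloisRep.toGaloisRep (GaloisRepresentations.FramedRep.dual ρ) σ).charpoly.reverse = _
  rw [charpoly_toGaloisRep_apply, GaloisRepresentations.FramedRep.charpoly, GaloisRepresentations.FramedRep.coe_dual_apply]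
  obtain ⟨k, hk, hk1⟩ := exists_pow_eq_one_of_finite_range ρ (finite_range_framed ρ) σ
  have hc : ((ρ σ : GL (Fin 2) ℂ) : Matrix (Fin 2) (Fin 2) ℂ).charpoly =
      X ^ 2 - C (cuspCoeff f (primesEquiv v : Nat.Primes)) * X +
        C (nebentypus f ((primesEquiv v : Nat.Primes) : ZMod N)) := by
    have := hchar 𝔓 h𝔓 σ hσ
    rw [map_heckePolynomial_weight_one] at this
    exact this
  rw [Matrix.charpoly_transpose_inv_of_pow_eq_one _ hk hk1 hc, reverse_X_sq_sub_add]

end Lang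


/-! ### Step (iii): `L(s, ρ) · N_G(s) = Φ(s) · D_G(s)`, the finite Euler quotient -/

section ArtinRep
open Literature.NumberTheory.GaloisRepresentations (ArtinRep)
open Literature.NumberTheory.GaloisRepresentations.ArtinRep

variable {K : Type*} [Field K] [NumberField K] {V : Type*} [AddCommGroup V] [Module ℂ V]
  [TopologicalSpace V] [FiniteDimensional ℂ V] [IsModuleTopology ℂ V]

/-- The multiset of **inverse roots** `μ` of the Euler factor `L_v(ρ, T) = ∏_μ (1 - μ T)` (the
eigenvalues of the chosen Frobenius on the inertia invariants; a choice,
`exists_eulerFactorAt_eq_prod`).  Ref: Deligne–Serre 1974, proof of Thm. 4.6 (iii) ("`b_p`,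
`c_p`"). [cite: DeligneSerreASENS1974, proof of Thm. 4.6, step (iii)] -/
def _root_.Literature.NumberTheory.GaloisRepresentations.ArtinRep.eulerRoots (ρ : ArtinRep K V) (v : HeightOneSpectrum (𝓞 K)) : Multiset ℂ :=
  (ρ.exists_eulerFactorAt_eq_prod v).choose

/-- The inverse roots of the Euler factors have absolute value `1`.
[cite: DeligneSerreASENS1974, proof of Thm. 4.6 (iv)] -/
theorem _root_.Literature.NumberTheory.GaloisRepresentations.ArtinRep.norm_eq_one_of_mem_eulerRoots (ρ : ArtinRep K V) {v : HeightOneSpectrum (𝓞 K)} {μ : ℂ}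
    (h : μ ∈ ρ.eulerRoots v) : ‖μ‖ = 1 :=
  (ρ.exists_eulerFactorAt_eq_prod v).choose_spec.1 μ h

/-- `L_v(ρ, T) = ∏_{μ ∈ eulerRoots} (1 - μ T)`. [cite: DeligneSerreASENS1974, proof of Thm. 4.6, step (iii)] -/
theorem _root_.Literature.NumberTheory.GaloisRepresentations.ArtinRep.eulerFactorAt_eq_prod_eulerRoots (ρ : ArtinRep K V) (v : HeightOneSpectrum (𝓞 K)) :
    ρ.eulerFactorAt v = ((ρ.eulerRoots v).map fun μ ↦ 1 - C μ * X).prod :=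
  (ρ.exists_eulerFactorAt_eq_prod v).choose_spec.2

end ArtinRep

/-- Evaluation of `∏_μ (1 - μ X)` at `x` is `∏_μ (1 - μ x)`. [folklore] -/
theorem eval_multiset_prod_one_sub_C_mul_X (m : Multiset ℂ) (x : ℂ) :
    ((m.map fun μ ↦ 1 - C μ * X).prod : ℂ[X]).eval x = (m.map fun μ ↦ 1 - μ * x).prod := by
  rw [eval_multiset_prod, Multiset.map_map]
  congr 1
  refine Multiset.map_congr rfl fun μ _ ↦ ?_
  simp

/-- `‖z‖ < 1 ⟹ 1 - z ≠ 0`. [folklore] -/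
theorem one_sub_ne_zero_of_norm_lt_one {z : ℂ} (hz : ‖z‖ < 1) : 1 - z ≠ 0 := by
  intro h
  rw [sub_eq_zero] at h
  rw [← h, norm_one] at hz
  exact lt_irrefl _ hz

/-- `‖μ p^{-s}‖ < 1` for `‖μ‖ ≤ 1`, `p ≥ 2`, `re s > 0`. [folklore] -/
theorem norm_mul_natCast_cpow_neg_lt_one {μ : ℂ} (hμ : ‖μ‖ ≤ 1) {p : ℕ} (hp : 1 < p) {s : ℂ}
    (hs : 0 < s.re) : ‖μ * (p : ℂ) ^ (-s)‖ < 1 := by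
  rw [norm_mul, norm_natCast_cpow_of_pos (by omega), neg_re]
  have hp' : (1 : ℝ) < p := by exact_mod_cast hp
  calc ‖μ‖ * (p : ℝ) ^ (-s.re) ≤ 1 * (p : ℝ) ^ (-s.re) := by gcongr
    _ < 1 := by rw [one_mul]; exact Real.rpow_lt_one_of_one_lt_of_neg hp' (by linarith)

section Lang

open EllipticCurves.ModularForms ModularForms Rat.HeightOneSpectrum

/-- The finite place of `ℚ` below the rational prime `p` (inverse of Mathlib's
`Rat.HeightOneSpectrum.primesEquiv`). [folklore] -/
abbrev placeOfPrime (p : ℕ) (hp : p.Prime) : HeightOneSpectrum (𝓞 ℚ) :=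
  (primesEquiv (R := 𝓞 ℚ)).symm ⟨p, hp⟩

/-- `primesEquiv (placeOfPrime p) = p`. [folklore] -/
@[simp] theorem primesEquiv_placeOfPrime (p : ℕ) (hp : p.Prime) :
    (primesEquiv (placeOfPrime p hp) : Nat.Primes) = ⟨p, hp⟩ :=
  Equiv.apply_symm_apply _ _

/-- **Deligne–Serre's local data at `p`** for a coefficient sequence `a` and an Artin
representation `ρ` on `ℂ²`: numerator roots the inverse roots of `L_p(ρ, T)` ("`b_p`, `c_p`",
possibly fewer), denominator root `a_p`; so the local factor is
`F_p(s) = ∏ (1 - b p^{-s}) / (1 - a_p p^{-s})` (op. cit. (iii)).  Junk `⟨0, 0⟩` at non-primes.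
[cite: DeligneSerreASENS1974, proof of Thm. 4.6, step (iii)] -/
def dsLocalData (a : ℕ → ℂ) (ρA : GaloisRepresentations.ArtinRep ℚ (Fin 2 → ℂ)) (p : ℕ) : LFunctions.EulerFactorData :=
  if hp : p.Prime then ⟨ρA.eulerRoots (placeOfPrime p hp), {a p}⟩ else ⟨0, 0⟩

/-- Unfolding lemma for `dsLocalData` at a prime. [folklore] -/
theorem dsLocalData_of_prime (a : ℕ → ℂ) (ρA : GaloisRepresentations.ArtinRep ℚ (Fin 2 → ℂ)) {p : ℕ} (hp : p.Prime) :
    dsLocalData a ρA p = ⟨ρA.eulerRoots (placeOfPrime p hp), {a p}⟩ := by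
  rw [dsLocalData, dif_pos hp]

/-- The numerator of Deligne–Serre's local factor at `p` is the Euler factor of `ρ` evaluated at
`p^{-s}`: `N_{G,p}(s) = L_p(ρ, p^{-s})`. [cite: DeligneSerreASENS1974, proof of Thm. 4.6, step (iii)] -/
theorem numFun_dsLocalData (a : ℕ → ℂ) (ρA : GaloisRepresentations.ArtinRep ℚ (Fin 2 → ℂ)) {p : ℕ} (hp : p.Prime)
    (s : ℂ) : (dsLocalData a ρA p).numFun p s =
      (ρA.eulerFactorAt (placeOfPrime p hp)).eval ((p : ℂ) ^ (-s)) := by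
  rw [dsLocalData_of_prime a ρA hp, LFunctions.EulerFactorData.numFun, GaloisRepresentations.ArtinRep.eulerFactorAt_eq_prod_eulerRoots,
    eval_multiset_prod_one_sub_C_mul_X]
  rfl

/-- The denominator of Deligne–Serre's local factor at `p` is `D_{G,p}(s) = 1 - a_p p^{-s}`.
[cite: DeligneSerreASENS1974, proof of Thm. 4.6, step (iii)] -/
theorem denFun_dsLocalData (a : ℕ → ℂ) (ρA : GaloisRepresentations.ArtinRep ℚ (Fin 2 → ℂ)) {p : ℕ} (hp : p.Prime)
    (s : ℂ) : (dsLocalData a ρA p).denFun p s = 1 - a p * (p : ℂ) ^ (-s) := by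
  rw [dsLocalData_of_prime a ρA hp, LFunctions.EulerFactorData.denFun, Multiset.map_singleton,
    Multiset.prod_singleton, LFunctions.eulerTerm]

/-- `N_{G,p}(s) ≠ 0` for `re s > 0` (the roots have absolute value `1`). [folklore] -/
theorem numFun_dsLocalData_ne_zero (a : ℕ → ℂ) (ρA : GaloisRepresentations.ArtinRep ℚ (Fin 2 → ℂ)) {p : ℕ}
    (hp : p.Prime) {s : ℂ} (hs : 0 < s.re) : (dsLocalData a ρA p).numFun p s ≠ 0 := by
  rw [dsLocalData_of_prime a ρA hp, Ne, LFunctions.EulerFactorData.numFun_eq_zero_iff]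
  rintro ⟨μ, hμ, h0⟩
  exact one_sub_ne_zero_of_norm_lt_one
    (norm_mul_natCast_cpow_neg_lt_one (ρA.norm_eq_one_of_mem_eulerRoots hμ).le hp.one_lt hs) h0

/-- The roots of Deligne–Serre's local data satisfy (4.9.2), `|α| < p^{1/2}`: the `ρ`-roots have
absolute value `1` and `|a_p| ≤ 1` (hypothesis; 1.8 for a newform), while `p ≥ 2`.
[cite: DeligneSerreASENS1974, proof of Thm. 4.6, step (iv)] -/
theorem norm_lt_sqrt_of_mem_dsLocalData {a : ℕ → ℂ} {N : ℕ}
    (hap : ∀ {p : ℕ}, p.Prime → p ∣ N → ‖a p‖ ≤ 1) (ρA : GaloisRepresentations.ArtinRep ℚ (Fin 2 → ℂ)) {p : ℕ}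
    (hp : p ∈ N.primeFactors) {α : ℂ}
    (hα : α ∈ (dsLocalData a ρA p).num + (dsLocalData a ρA p).den) : ‖α‖ < Real.sqrt p := by
  have hp' := Nat.prime_of_mem_primeFactors hp
  have h1 : (1 : ℝ) < Real.sqrt p := by
    rw [show (1 : ℝ) = Real.sqrt 1 from Real.sqrt_one.symm]
    exact Real.sqrt_lt_sqrt zero_le_one (by exact_mod_cast hp'.one_lt)
  rw [dsLocalData_of_prime a ρA hp', Multiset.mem_add, Multiset.mem_singleton] at hα
  rcases hα with h | rfl
  · rw [ρA.norm_eq_one_of_mem_eulerRoots h]; exact h1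
  · exact (hap hp' (Nat.dvd_of_mem_primeFactors hp)).trans_lt h1

variable {N : ℕ} [NeZero N]

/-- **Step (iii) of the proof of Thm. 4.6: `L(s, ρ) · N_G(s) = Φ(s) · D_G(s)`.**  Let
`Φ(s) = Σ a_n n^{-s}` have Hecke-type coefficients (`a_1 = 1`, multiplicative on coprime
arguments, `a_{p^{r+2}} = a_p a_{p^{r+1}} - e_p a_{p^r}` with `e_p = 0` and `|a_p| ≤ 1` for
`p ∣ N`), converging absolutely at `s` (`re s > 0`), and let `ρ` be an Artin representation on
`ℂ²` whose Euler factors at the `p ∤ N` are `1 - a_p T + e_p T²`.  Then, with Deligne–Serre's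
finite Euler product `∏_{p ∣ N} F_p(s) = N_G(s)/D_G(s)` (`dsLocalData`: `N_G(s) = ∏_{p ∣ N} L_p(ρ, p^{-s})`,
`D_G(s) = ∏_{p ∣ N} (1 - a_p p^{-s})`, `finiteEulerNum`/`finiteEulerDen` of
`FiniteEulerProducts`), `L(s, ρ) · N_G(s) = Φ(s) · D_G(s)`: the Euler product of `Φ`
(`LSeries_hasProd_of_recurrence`) and that of `L(s, ρ)` (`Literature.NumberTheory.GaloisRepresentations.artinLFunction`, a `tprod` over
the places of `ℚ`) differ by the finitely many factors at `p ∣ N` (`HasProd.mul`,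
`hasProd_prod_of_ne_finset_one`, `Equiv.hasProd_iff` along `primesEquiv`).  This is
"`F(s) = A^s ∏_{p ∣ N} F_p(s)`" of op. cit. (iii), before completing.
[cite: DeligneSerreASENS1974, proof of Thm. 4.6, step (iii)] -/
theorem artinLFunction_mul_finiteEulerNum_eq {a e : ℕ → ℂ} (h1 : a 1 = 1)
    (hmulc : ∀ {m n : ℕ}, m.Coprime n → a (m * n) = a m * a n)
    (hrec : ∀ {p : ℕ}, p.Prime → ∀ r : ℕ, a (p ^ (r + 2)) = a p * a (p ^ (r + 1)) - e p * a (p ^ r))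
    (he : ∀ {p : ℕ}, p.Prime → p ∣ N → e p = 0)
    (hap : ∀ {p : ℕ}, p.Prime → p ∣ N → ‖a p‖ ≤ 1) (ρA : GaloisRepresentations.ArtinRep ℚ (Fin 2 → ℂ))
    (hunr : ∀ {v : HeightOneSpectrum (𝓞 ℚ)}, ¬ ((primesEquiv v : Nat.Primes) : ℕ) ∣ N →
      ρA.eulerFactorAt v = 1 - C (a (primesEquiv v : Nat.Primes)) * X +
        C (e (primesEquiv v : Nat.Primes)) * X ^ 2)
    {s : ℂ} (hs : 0 < s.re) (hsum : LSeriesSummable a s) :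
    GaloisRepresentations.artinLFunction ρA s * LFunctions.finiteEulerNum N.primeFactors (dsLocalData a ρA) s =
      LSeries a s * LFunctions.finiteEulerDen N.primeFactors (dsLocalData a ρA) s := by
  set G := dsLocalData a ρA with hG
  -- the Euler product of `Φ`
  set Ff : Nat.Primes → ℂ := fun p ↦
    (1 - a p * (p : ℂ) ^ (-s) + e p * ((p : ℂ) ^ (-s)) ^ 2)⁻¹ with hFf
  have hEPf : HasProd Ff (LSeries a s) := LSeries_hasProd_of_recurrence h1 hmulc hrec hsum
  -- the correcting factors at `p ∣ N`
  set r' : ℕ → ℂ := fun p ↦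
    if p ∣ N then (1 - a p * (p : ℂ) ^ (-s)) * ((G p).numFun p s)⁻¹ else 1 with hr'
  set r : Nat.Primes → ℂ := fun p ↦ r' p with hr
  set S' : Finset Nat.Primes := (N.primeFactors).subtype Nat.Prime with hS'
  have hmemS' : ∀ p : Nat.Primes, p ∈ S' ↔ (p : ℕ) ∣ N := fun p ↦
    (@Finset.mem_subtype ℕ Nat.Prime _ N.primeFactors p).trans
      (by rw [Nat.mem_primeFactors]; exact ⟨fun h ↦ h.2.1, fun h ↦ ⟨p.2, h, NeZero.ne N⟩⟩)
  have hr1 : ∀ p ∉ S', r p = 1 := fun p hp ↦ by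
    rw [hmemS'] at hp
    simp only [hr, hr', if_neg hp]
  have hEPr : HasProd r (∏ p ∈ S', r p) := hasProd_prod_of_ne_finset_one hr1
  have hmul := hEPf.mul hEPr
  -- the Euler factors of `L(s, ρ)`
  set Fρ : HeightOneSpectrum (𝓞 ℚ) → ℂ := fun v ↦
    ((ρA.eulerFactorAt v).eval ((v.residueCard : ℂ) ^ (-s)))⁻¹ with hFρ
  have hkey : ∀ p : Nat.Primes, Fρ ((primesEquiv (R := 𝓞 ℚ)).symm p) = Ff p * r p := by
    rintro ⟨p, hp⟩
    have hv : (primesEquiv ((primesEquiv (R := 𝓞 ℚ)).symm ⟨p, hp⟩) : Nat.Primes) = ⟨p, hp⟩ :=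
      Equiv.apply_symm_apply _ _
    simp only [hFρ, hFf, hr, hr']
    rw [GaloisRepresentations.Rat.residueCard_eq_natGenerator,
      show natGenerator ((primesEquiv (R := 𝓞 ℚ)).symm ⟨p, hp⟩) = p from congrArg Subtype.val hv]
    by_cases hpN : p ∣ N
    · rw [if_pos hpN, show (primesEquiv (R := 𝓞 ℚ)).symm ⟨p, hp⟩ = placeOfPrime p hp from rfl,
        ← numFun_dsLocalData a ρA hp, he hp hpN, zero_mul, add_zero, ← mul_assoc,
        inv_mul_cancel₀ (one_sub_ne_zero_of_norm_lt_one
          (norm_mul_natCast_cpow_neg_lt_one (hap hp hpN) hp.one_lt hs)), one_mul]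
    · rw [if_neg hpN, mul_one, hunr (by rw [hv]; exact hpN), hv]
      simp
  have hEPρ : HasProd Fρ (LSeries a s * ∏ p ∈ S', r p) := by
    rw [← Equiv.hasProd_iff (primesEquiv (R := 𝓞 ℚ)).symm]
    have : (Fρ ∘ (primesEquiv (R := 𝓞 ℚ)).symm) = fun p ↦ Ff p * r p := funext hkey
    rw [this]
    exact hmul
  have hL : GaloisRepresentations.artinLFunction ρA s = LSeries a s * ∏ p ∈ S', r p := hEPρ.tprod_eq
  -- evaluate the finite product of correcting factors
  have hprod : (∏ p ∈ S', r p) * LFunctions.finiteEulerNum N.primeFactors G s =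
      LFunctions.finiteEulerDen N.primeFactors G s := by
    have h' : ∏ p ∈ S', r p =
        ∏ p ∈ N.primeFactors, (G p).denFun p s * ((G p).numFun p s)⁻¹ := by
      rw [show ∏ p ∈ S', r p = ∏ p ∈ N.primeFactors.filter Nat.Prime, r' p from
          @Finset.prod_subtype_eq_prod_filter ℕ ℂ N.primeFactors _ r' Nat.Prime _,
        Finset.filter_true_of_mem fun p hp ↦ Nat.prime_of_mem_primeFactors hp]
      refine Finset.prod_congr rfl fun p hp ↦ ?_
      have hp' := Nat.prime_of_mem_primeFactors hp
      simp only [hr', if_pos (Nat.dvd_of_mem_primeFactors hp)]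
      rw [denFun_dsLocalData a ρA hp']
    rw [h', LFunctions.finiteEulerNum, LFunctions.finiteEulerDen, ← Finset.prod_mul_distrib]
    refine Finset.prod_congr rfl fun p hp ↦ ?_
    rw [mul_assoc, inv_mul_cancel₀ (numFun_dsLocalData_ne_zero a ρA
      (Nat.prime_of_mem_primeFactors hp) hs), mul_one]
  rw [hL, mul_assoc, hprod]

end Lang


/-! ### Analytic lemmas: entire finite Euler products, identity principles, Lemma 4.9 in two-exponential form -/

section Analytic

open Filter Topology

/-- `s ↦ 1 - α p^{-s}` is entire. [folklore] -/
theorem differentiable_eulerTerm {p : ℕ} (hp : p ≠ 0) (α : ℂ) : Differentiable ℂ (LFunctions.eulerTerm p α) := by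
  unfold LFunctions.eulerTerm
  exact (differentiable_const _).sub ((differentiable_const _).mul
    (differentiable_id.neg.const_cpow (Or.inl (Nat.cast_ne_zero.mpr hp))))

section EulerFactorData
open Literature.NumberTheory.LFunctions (EulerFactorData)
open Literature.NumberTheory.LFunctions.EulerFactorData

/-- The local numerator `∏_α (1 - α p^{-s})` is entire. [folklore] -/
theorem _root_.Literature.NumberTheory.LFunctions.EulerFactorData.differentiable_numFun (D : EulerFactorData) {p : ℕ} (hp : p ≠ 0) :
    Differentiable ℂ (D.numFun p) := by
  unfold numFun
  induction D.num using Multiset.induction_on with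
  | empty => simp
  | cons α m ih =>
    simp only [Multiset.map_cons, Multiset.prod_cons]
    exact (differentiable_eulerTerm hp α).mul ih

/-- The local denominator `∏_β (1 - β p^{-s})` is entire. [folklore] -/
theorem _root_.Literature.NumberTheory.LFunctions.EulerFactorData.differentiable_denFun (D : EulerFactorData) {p : ℕ} (hp : p ≠ 0) :
    Differentiable ℂ (D.denFun p) := by
  unfold denFun
  induction D.den using Multiset.induction_on with
  | empty => simp
  | cons α m ih =>
    simp only [Multiset.map_cons, Multiset.prod_cons]
    exact (differentiable_eulerTerm hp α).mul ih

end EulerFactorData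

/-- The numerator of a finite Euler product is entire. [folklore] -/
theorem differentiable_finiteEulerNum {S : Finset ℕ} (hS : ∀ p ∈ S, p ≠ 0)
    (G : ℕ → LFunctions.EulerFactorData) : Differentiable ℂ (LFunctions.finiteEulerNum S G) := by
  unfold LFunctions.finiteEulerNum
  exact Differentiable.fun_finsetProd fun p hp ↦ (G p).differentiable_numFun (hS p hp)

/-- The denominator of a finite Euler product is entire. [folklore] -/
theorem differentiable_finiteEulerDen {S : Finset ℕ} (hS : ∀ p ∈ S, p ≠ 0)
    (G : ℕ → LFunctions.EulerFactorData) : Differentiable ℂ (LFunctions.finiteEulerDen S G) := by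
  unfold LFunctions.finiteEulerDen
  exact Differentiable.fun_finsetProd fun p hp ↦ (G p).differentiable_denFun (hS p hp)

/-- **Identity principle for Mathlib-meromorphic functions on `ℂ`.**  If `T` is meromorphic on
`ℂ` (in Mathlib's sense: `MeromorphicAt` everywhere, arbitrary values on a discrete set) and
vanishes on a neighbourhood of one point, then it vanishes on a punctured neighbourhood of every
point (`meromorphicOrderAt = ⊤` propagates along the connected plane). [folklore] -/
theorem Meromorphic.eventually_nhdsNE_eq_zero {T : ℂ → ℂ} (hT : Meromorphic T) {x : ℂ}
    (hx : ∀ᶠ s in 𝓝 x, T s = 0) (z : ℂ) : ∀ᶠ s in 𝓝[≠] z, T s = 0 := by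
  have hx' : meromorphicOrderAt T x = ⊤ :=
    meromorphicOrderAt_eq_top_iff.mpr (hx.filter_mono nhdsWithin_le_nhds)
  rw [← meromorphicOrderAt_eq_top_iff]
  by_contra hz
  have hT' : MeromorphicOn T Set.univ := fun y _ ↦ hT y
  exact hT'.meromorphicOrderAt_ne_top_of_isPreconnected isPreconnected_univ (Set.mem_univ z)
    (Set.mem_univ x) hz hx'

/-- `s ↦ 1 - s` maps punctured neighbourhoods to punctured neighbourhoods. [folklore] -/
theorem tendsto_one_sub_nhdsNE (s₀ : ℂ) :
    Tendsto (fun s : ℂ ↦ 1 - s) (𝓝[≠] s₀) (𝓝[≠] (1 - s₀)) := by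
  refine tendsto_nhdsWithin_of_tendsto_nhds_of_eventually_within _
    (((continuous_const.sub continuous_id).tendsto s₀).mono_left nhdsWithin_le_nhds) ?_
  filter_upwards [self_mem_nhdsWithin] with s hs
  simpa only [Set.mem_compl_iff, Set.mem_singleton_iff, sub_right_inj] using hs

/-- A two-sided polynomial identity from agreement at all `p^{-s}`: if
`P(p^{-s}) = Q(p^{-s})` for every `s ∈ ℂ` (`p ≥ 2`), then `P = Q` (the values `p^{-σ}`,
`σ ∈ ℝ`, are pairwise distinct). [folklore] -/
theorem Polynomial.eq_of_forall_eval_natCast_cpow_neg_eq {p : ℕ} (hp : 1 < p) {P Q : ℂ[X]}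
    (h : ∀ s : ℂ, P.eval ((p : ℂ) ^ (-s)) = Q.eval ((p : ℂ) ^ (-s))) : P = Q := by
  apply Polynomial.eq_of_infinite_eval_eq
  have hp0 : (0 : ℝ) < p := by exact_mod_cast (zero_lt_one.trans hp)
  have hinj : Function.Injective fun σ : ℝ ↦ (p : ℂ) ^ (-(σ : ℂ)) := by
    intro σ τ hστ
    have h' := congrArg norm hστ
    simp only [← ofReal_neg] at h'
    rw [← ofReal_natCast, ← ofReal_cpow hp0.le, ← ofReal_cpow hp0.le, norm_real, norm_real,
      Real.norm_of_nonneg (Real.rpow_nonneg hp0.le _),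
      Real.norm_of_nonneg (Real.rpow_nonneg hp0.le _), Real.rpow_def_of_pos hp0,
      Real.rpow_def_of_pos hp0, Real.exp_eq_exp] at h'
    have hlog : Real.log p ≠ 0 := Real.log_ne_zero_of_pos_of_ne_one hp0 (by exact_mod_cast hp.ne')
    have := mul_left_cancel₀ hlog h'
    linarith
  exact Set.infinite_of_injective_forall_mem hinj fun σ ↦ h σ

/-- A Dirichlet series with `a_1 ≠ 0` converging somewhere is nonzero far to the right
(`LSeries.tendsto_atTop`: `Σ a_n x^{-s} → a_1` as `x → ∞`). [folklore] -/
theorem exists_lt_re_LSeries_ne_zero {a : ℕ → ℂ} (h1 : a 1 ≠ 0) {s : ℂ} (hs : LSeriesSummable a s)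
    (c : ℝ) : ∃ x : ℝ, c < x ∧ LSeries a x ≠ 0 := by
  have ha : LSeries.abscissaOfAbsConv a < ⊤ :=
    hs.abscissaOfAbsConv_le.trans_lt (EReal.coe_lt_top _)
  have hlim := LSeries.tendsto_atTop ha
  have hev : ∀ᶠ x : ℝ in atTop, LSeries a x ≠ 0 := hlim.eventually (isOpen_ne.mem_nhds h1)
  exact ((eventually_gt_atTop c).and hev).exists

/-- **The two-exponential form of Deligne–Serre's Lemma 4.9.**  If two finite Euler products
`N_G/D_G`, `N_H/D_H` with roots `|α| < p^{1/2}` satisfy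
`c₁ e^{κ₁ s} N_G(1 - s) D_H(s) = c₂ e^{κ₂ s} N_H(s) D_G(1 - s)` for all `s` (`c₁, c₂ ≠ 0`,
`κ₁, κ₂ ∈ ℝ`), then every local factor is trivial: `N_{G,p} = D_{G,p}` and `N_{H,p} = D_{H,p}`.
Reduction to `DeligneSerre1974.lemma49` (`lemma49_holds`) with `A = e^{(κ₂ - κ₁)/2}` and
`ω = (c₂/c₁) e^{(κ₂ - κ₁)/2}`.  This is the form in which (4.9.1) arises when the conductors of
`ρ` and `ρ^∨` are not identified beforehand. [cite: DeligneSerreASENS1974, Lemma 4.9] -/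
theorem lemma49_exp {S : Finset ℕ} (hS : ∀ p ∈ S, p.Prime) (G H : ℕ → LFunctions.EulerFactorData)
    (hG : ∀ p ∈ S, ∀ α ∈ (G p).num + (G p).den, ‖α‖ < Real.sqrt p)
    (hH : ∀ p ∈ S, ∀ α ∈ (H p).num + (H p).den, ‖α‖ < Real.sqrt p)
    {c₁ c₂ : ℂ} (hc₁ : c₁ ≠ 0) (hc₂ : c₂ ≠ 0) (κ₁ κ₂ : ℝ)
    (hFE : ∀ s : ℂ, c₁ * cexp (s * κ₁) * (LFunctions.finiteEulerNum S G (1 - s) * LFunctions.finiteEulerDen S H s) =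
      c₂ * cexp (s * κ₂) * (LFunctions.finiteEulerNum S H s * LFunctions.finiteEulerDen S G (1 - s))) :
    ∀ p ∈ S, (∀ s, (G p).numFun p s = (G p).denFun p s) ∧
      (∀ s, (H p).numFun p s = (H p).denFun p s) := by
  set ℓ : ℝ := (κ₂ - κ₁) / 2 with hℓ
  set A : ℝ := Real.exp ℓ with hA
  have hA0 : 0 < A := Real.exp_pos ℓ
  have hAc : ∀ w : ℂ, (A : ℂ) ^ w = cexp (ℓ * w) := fun w ↦ by
    rw [hA, Complex.ofReal_exp, cpow_def_of_ne_zero (Complex.exp_ne_zero _),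
      Complex.log_exp (by simp [Real.pi_pos]) (by simp [Real.pi_pos.le])]
  set ω : ℂ := c₂ / c₁ * cexp ℓ with hω
  have hω0 : ω ≠ 0 := mul_ne_zero (div_ne_zero hc₂ hc₁) (Complex.exp_ne_zero _)
  have hFE' : ∀ s : ℂ, (A : ℂ) ^ (1 - s) * LFunctions.finiteEulerNum S G (1 - s) * LFunctions.finiteEulerDen S H s =
      ω * (A : ℂ) ^ s * LFunctions.finiteEulerNum S H s * LFunctions.finiteEulerDen S G (1 - s) := by
    intro s
    have e1 : cexp (ℓ * (1 - s)) * (c₂ * cexp (s * κ₂)) =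
        c₂ * cexp ℓ * cexp (ℓ * s) * (c₁ * cexp (s * κ₁)) / c₁ := by
      field_simp
      simp only [← Complex.exp_add]
      congr 1
      simp only [hℓ]
      push_cast
      ring
    have h := hFE s
    rw [hAc, hAc, hω]
    have hE : c₁ * cexp (s * κ₁) ≠ 0 := mul_ne_zero hc₁ (Complex.exp_ne_zero _)
    calc cexp (ℓ * (1 - s)) * LFunctions.finiteEulerNum S G (1 - s) * LFunctions.finiteEulerDen S H s
        = cexp (ℓ * (1 - s)) * (c₁ * cexp (s * κ₁) *
            (LFunctions.finiteEulerNum S G (1 - s) * LFunctions.finiteEulerDen S H s)) / (c₁ * cexp (s * κ₁)) := by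
          field_simp
      _ = cexp (ℓ * (1 - s)) * (c₂ * cexp (s * κ₂)) *
            (LFunctions.finiteEulerNum S H s * LFunctions.finiteEulerDen S G (1 - s)) / (c₁ * cexp (s * κ₁)) := by
          rw [h]; ring
      _ = c₂ / c₁ * cexp ℓ * cexp (ℓ * s) * LFunctions.finiteEulerNum S H s * LFunctions.finiteEulerDen S G (1 - s) := by
          rw [e1]; field_simp
  exact (LFunctions.ModularForms.DeligneSerre1974.lemma49_holds S hS A hA0 G H hG hH ω hω0 hFE').2

/-- Positive natural numbers as bases: `n^w = e^{w log n}` with the real logarithm. [folklore] -/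
theorem natCast_cpow_eq_exp {n : ℕ} (hn : n ≠ 0) (w : ℂ) :
    (n : ℂ) ^ w = cexp (w * (Real.log n : ℂ)) := by
  rw [cpow_def_of_ne_zero (Nat.cast_ne_zero.mpr hn), Complex.natCast_log, mul_comm]

end Analytic

section GaloisRep
open Literature.NumberTheory.GaloisRepresentations (GaloisRep)
open Literature.NumberTheory.GaloisRepresentations.GaloisRep

variable {K : Type*} [Field K] [NumberField K] {A : Type*} [CommRing A] [TopologicalSpace A]
  {M : Type*} [AddCommGroup M] [Module A M] [TopologicalSpace M]

/-- The global Artin conductor is a nonzero ideal (a `finprod` of powers of nonzero primes, or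
the junk value `1`). [folklore] -/
theorem _root_.Literature.NumberTheory.GaloisRepresentations.GaloisRep.artinConductor_ne_bot (ρ : GaloisRep K A M) : ρ.artinConductor ≠ ⊥ := by
  unfold artinConductor
  refine finprod_induction (p := fun I : Ideal (𝓞 K) ↦ I ≠ ⊥) one_ne_zero
    (fun I J hI hJ ↦ mul_ne_zero hI hJ) fun v ↦ pow_ne_zero _ v.ne_bot

/-- The numerical Artin conductor is a positive integer. [folklore] -/
theorem _root_.Literature.NumberTheory.GaloisRepresentations.GaloisRep.artinConductorNat_ne_zero (ρ : GaloisRep K A M) : ρ.artinConductorNat ≠ 0 := by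
  rw [artinConductorNat, Ne, Ideal.absNorm_eq_zero_iff]
  exact ρ.artinConductor_ne_bot

end GaloisRep


/-! ### Steps (iii)–(iv): the functional-equation argument and the conclusion -/

section Star

open Filter Topology

/-- **The identity (★) behind (4.9.1).**  Abstract form of Deligne–Serre's step (iii): let
`Λ` (Mathlib-meromorphic on `ℂ`) and `Λ'` satisfy `Λ(1 - s) = W Λ'(s)` (Artin), let the entire
`Λ_f`, `Λ_{f̃}` satisfy `Λ_f(1 - s) = a Λ_{f̃}(s)` (Hecke–Li), and suppose that on the
half-plane `re s > 3/2` one has `Λ(s) N_G(s) N^{s/2} = 2 M^{s/2} Λ_f(s) D_G(s)` and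
`Λ'(s) N_H(s) N^{s/2} = 2 M'^{s/2} Λ_{f̃}(s) D_H(s)` (the Euler products, completed), with
`Λ_{f̃}(s₀) ≠ 0` for some `re s₀ > 3/2`.  Then for **all** `s`,
`W M'^{s/2} N^{(1-s)/2} D_H(s) N_G(1-s) = a M^{(1-s)/2} N^{s/2} D_G(1-s) N_H(s)`.
Proof: the first identity propagates from the half-plane to punctured neighbourhoods of every
point by the identity principle for meromorphic functions
(`Meromorphic.eventually_nhdsNE_eq_zero`), in particular to `1 - s` for `s` near `s₀`; there
the two functional equations and the second identity give (★) after cancelling `2 Λ_{f̃}(s) ≠ 0`,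
and both sides of (★) are entire (`AnalyticOnNhd.eq_of_frequently_eq`).
[cite: DeligneSerreASENS1974, proof of Thm. 4.6, step (iii)] -/
theorem dsStar_identity {Λ Λ' Λf Λf' NG DG NH DH : ℂ → ℂ} {W a : ℂ} {M M' Nn : ℕ}
    (hM : M ≠ 0) (hM' : M' ≠ 0) (hN : Nn ≠ 0)
    (hΛ : Meromorphic Λ) (hFEρ : ∀ s, Λ (1 - s) = W * Λ' s)
    (hΛf : Differentiable ℂ Λf) (hΛf' : Differentiable ℂ Λf')
    (hFEf : ∀ s, Λf (1 - s) = a * Λf' s)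
    (hNG : Differentiable ℂ NG) (hDG : Differentiable ℂ DG) (hNH : Differentiable ℂ NH)
    (hDH : Differentiable ℂ DH)
    (hT : ∀ s : ℂ, 3 / 2 < s.re →
      Λ s * (NG s * (Nn : ℂ) ^ (s / 2)) - 2 * (M : ℂ) ^ (s / 2) * Λf s * DG s = 0)
    (hT' : ∀ s : ℂ, 3 / 2 < s.re →
      Λ' s * (NH s * (Nn : ℂ) ^ (s / 2)) - 2 * (M' : ℂ) ^ (s / 2) * Λf' s * DH s = 0)
    (hs₀ : ∃ s₀ : ℂ, 3 / 2 < s₀.re ∧ Λf' s₀ ≠ 0) (s : ℂ) :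
    W * (M' : ℂ) ^ (s / 2) * (Nn : ℂ) ^ ((1 - s) / 2) * DH s * NG (1 - s) =
      a * (M : ℂ) ^ ((1 - s) / 2) * (Nn : ℂ) ^ (s / 2) * DG (1 - s) * NH s := by
  obtain ⟨s₀, hs₀, hΛf's₀⟩ := hs₀
  have hsub : Differentiable ℂ fun s : ℂ ↦ 1 - s := (differentiable_const _).sub differentiable_id
  have hcpow : ∀ {c : ℕ}, c ≠ 0 → ∀ {g : ℂ → ℂ}, Differentiable ℂ g →
      Differentiable ℂ fun s ↦ (c : ℂ) ^ g s := fun hc _ hg ↦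
    hg.const_cpow (Or.inl (Nat.cast_ne_zero.mpr hc))
  have hd2 : Differentiable ℂ fun s : ℂ ↦ s / 2 := differentiable_id.div_const 2
  have hd2' : Differentiable ℂ fun s : ℂ ↦ (1 - s) / 2 := hsub.div_const 2
  set T : ℂ → ℂ := fun s ↦
    Λ s * (NG s * (Nn : ℂ) ^ (s / 2)) - 2 * (M : ℂ) ^ (s / 2) * Λf s * DG s with hTdef
  have hTmer : Meromorphic T := fun z ↦ by
    refine ((hΛ z).mul ((hNG.mul (hcpow hN hd2)).analyticAt z).meromorphicAt).sub ?_
    exact (((((differentiable_const (2 : ℂ)).mul (hcpow hM hd2)).mul hΛf).mul hDG).analyticAt z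
      ).meromorphicAt
  have hU : IsOpen {s : ℂ | 3 / 2 < s.re} := isOpen_lt continuous_const Complex.continuous_re
  have hT2 : ∀ᶠ s in 𝓝 (2 : ℂ), T s = 0 := by
    filter_upwards [hU.mem_nhds (show (3 : ℝ) / 2 < (2 : ℂ).re by norm_num)] with s hs
      using hT s hs
  have hA : ∀ᶠ s in 𝓝[≠] s₀, T (1 - s) = 0 :=
    (tendsto_one_sub_nhdsNE s₀).eventually
      (Meromorphic.eventually_nhdsNE_eq_zero hTmer hT2 (1 - s₀))
  have hB : ∀ᶠ s in 𝓝[≠] s₀, 3 / 2 < s.re ∧ Λf' s ≠ 0 :=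
    Filter.Eventually.filter_mono nhdsWithin_le_nhds
      ((show ∀ᶠ s in 𝓝 s₀, 3 / 2 < s.re from hU.mem_nhds hs₀).and
        (hΛf'.continuous.continuousAt.eventually_ne hΛf's₀))
  have hstar : ∀ᶠ s in 𝓝[≠] s₀,
      W * (M' : ℂ) ^ (s / 2) * (Nn : ℂ) ^ ((1 - s) / 2) * DH s * NG (1 - s) =
        a * (M : ℂ) ^ ((1 - s) / 2) * (Nn : ℂ) ^ (s / 2) * DG (1 - s) * NH s := by
    filter_upwards [hA, hB] with s hAs hBs
    obtain ⟨hs, hΛs⟩ := hBs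
    have h1 : Λ (1 - s) * (NG (1 - s) * (Nn : ℂ) ^ ((1 - s) / 2)) -
        2 * (M : ℂ) ^ ((1 - s) / 2) * Λf (1 - s) * DG (1 - s) = 0 := hAs
    rw [hFEρ, hFEf] at h1
    have h2 := hT' s hs
    apply mul_left_cancel₀ (mul_ne_zero two_ne_zero hΛs)
    linear_combination (NH s * (Nn : ℂ) ^ (s / 2)) * h1 -
      (W * NG (1 - s) * (Nn : ℂ) ^ ((1 - s) / 2)) * h2
  have hL : Differentiable ℂ fun s ↦
      W * (M' : ℂ) ^ (s / 2) * (Nn : ℂ) ^ ((1 - s) / 2) * DH s * NG (1 - s) :=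
    (((((differentiable_const W).mul (hcpow hM' hd2)).mul (hcpow hN hd2')).mul hDH).mul
      (hNG.comp hsub))
  have hR : Differentiable ℂ fun s ↦
      a * (M : ℂ) ^ ((1 - s) / 2) * (Nn : ℂ) ^ (s / 2) * DG (1 - s) * NH s :=
    (((((differentiable_const a).mul (hcpow hM hd2')).mul (hcpow hN hd2)).mul
      (hDG.comp hsub)).mul hNH)
  have heq := AnalyticOnNhd.eq_of_frequently_eq (hL.differentiableOn.analyticOnNhd isOpen_univ)
    (hR.differentiableOn.analyticOnNhd isOpen_univ) hstar.frequently
  exact congrFun heq s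

end Star

section Lang

open EllipticCurves.ModularForms ModularForms Rat.HeightOneSpectrum Filter Topology

variable {N : ℕ} [NeZero N] {f : CuspForm (Gamma1 N) 1} {ρ : GaloisRepresentations.FramedArtinRep ℚ 2}

/-- **Deligne–Serre 1974, Thm. 4.6 (b) at `p ∣ N`, for one pair `(f, ρ)`, from the printed
inputs.**  Let `f` be a weight-one newform on `Γ₁(N)` with Hecke relations (Prop. 5.8.5 (3),
(2)) and `|a_p| ≤ 1` for `p ∣ N` (1.8), let `ρ : Γ_ℚ → GL₂(ℂ)` be odd and attached to `f` away
from `N`, and assume the functional equations of `Λ_f` (step (i): `Λ_f(1 - s) = a Λ_{f̃}(s)`,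
`weightOne_functionalEquation`) and of `Λ(s, ρ)` (step (ii): `Λ(1 - s, ρ) = W Λ(s, ρ^∨)`,
`ArtinRep.SatisfiesFunctionalEquation`).  Then the Euler factor of `L(s, ρ)` at every `p ∣ N`
is `1 - a_p T`.  Proof = op. cit. (iii)–(iv): the Euler products give
`L(s, ρ) N_G(s) = Φ_f(s) D_G(s)` and `L(s, ρ^∨) N_H(s) = Φ_{f̃}(s) D_H(s)` on `re s > 3/2`
(`artinLFunction_mul_finiteEulerNum_eq`), whence by completing and the two functional
equations the identity (★) (`dsStar_identity`), which is (4.9.1) for the finite Euler products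
`G`, `H` in two-exponential form; Lemma 4.9 (`lemma49_exp`, from `lemma49_holds`) with (4.9.2)
(`norm_lt_sqrt_of_mem_dsLocalData`) gives `N_{G,p} = D_{G,p}`, i.e.
`L_p(ρ, p^{-s}) = 1 - a_p p^{-s}` for all `s`, a polynomial identity
(`Polynomial.eq_of_forall_eval_natCast_cpow_neg_eq`).
[cite: DeligneSerreASENS1974, Thm. 4.6 (b) and its proof, steps (iii)–(iv)] -/
theorem eulerFactorAt_eq_of_dvd_level_of_functionalEquations (hf : IsNewform1 f)
    (hρ : IsGaloisRepOfNewform1 f (algebraMap (coeffCharField f) ℂ) {p | p ∣ N} ρ)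
    (hoddρ : GaloisRepresentations.FramedGaloisRep.IsOdd ρ)
    (hmulc : ∀ {m n : ℕ}, m.Coprime n → cuspCoeff f (m * n) = cuspCoeff f m * cuspCoeff f n)
    (hrec : ∀ {p : ℕ}, p.Prime → ∀ r : ℕ, cuspCoeff f (p ^ (r + 2)) =
      cuspCoeff f p * cuspCoeff f (p ^ (r + 1)) - nebentypus f (p : ZMod N) * cuspCoeff f (p ^ r))
    (hap : ∀ {p : ℕ}, p.Prime → p ∣ N → ‖cuspCoeff f p‖ ≤ 1)
    (hFEf : ∃ a : ℂ, a ≠ 0 ∧ ∃ Λ ∈ completedCuspFormLContinuations N f,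
      ∃ Λ' ∈ completedConjCuspFormLContinuations N f, ∀ s : ℂ, Λ (1 - s) = a * Λ' s)
    (hFEρ : GaloisRepresentations.ArtinRep.SatisfiesFunctionalEquation ρ.toArtinRep
      (GaloisRepresentations.FramedArtinRep.toArtinRep (GaloisRepresentations.FramedRep.dual ρ)))
    {v : HeightOneSpectrum (𝓞 ℚ)} (hv : ((primesEquiv v : Nat.Primes) : ℕ) ∣ N) :
    ρ.toArtinRep.eulerFactorAt v = 1 - C (cuspCoeff f (primesEquiv v : Nat.Primes)) * X := by
  obtain ⟨a, ha, Λf, hΛf, Λf', hΛf', hFEf'⟩ := hFEf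
  obtain ⟨Λ, Λ', hΛ, -, hagree, W, hW, hFE⟩ := hFEρ
  have hN : N ≠ 0 := NeZero.ne N
  have hf1 : cuspCoeff f 1 = 1 := hf.2.2.2
  -- the prime
  set p : ℕ := ((primesEquiv v : Nat.Primes) : ℕ) with hpdef
  have hp : p.Prime := (primesEquiv v).2
  have hvp : placeOfPrime p hp = v := by
    rw [placeOfPrime, show (⟨p, hp⟩ : Nat.Primes) = primesEquiv v from Subtype.ext rfl,
      Equiv.symm_apply_apply]
  -- the data
  set S : Finset ℕ := N.primeFactors with hS
  have hSp : ∀ q ∈ S, q.Prime := fun q hq ↦ Nat.prime_of_mem_primeFactors hq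
  have hS0 : ∀ q ∈ S, q ≠ 0 := fun q hq ↦ (hSp q hq).ne_zero
  set ρ' : GaloisRepresentations.ArtinRep ℚ (Fin 2 → ℂ) := GaloisRepresentations.FramedArtinRep.toArtinRep (GaloisRepresentations.FramedRep.dual ρ) with hρ'
  set G : ℕ → LFunctions.EulerFactorData := dsLocalData (cuspCoeff f) ρ.toArtinRep with hG
  set H : ℕ → LFunctions.EulerFactorData :=
    dsLocalData (fun n ↦ (starRingEnd ℂ) (cuspCoeff f n)) ρ' with hH
  set M : ℕ := GaloisRepresentations.GaloisRep.artinConductorNat ρ.toGaloisRep with hM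
  set M' : ℕ := GaloisRepresentations.GaloisRep.artinConductorNat (GaloisRepresentations.FramedGaloisRep.toGaloisRep (GaloisRepresentations.FramedRep.dual ρ)) with hM'
  have hM0 : M ≠ 0 := GaloisRepresentations.GaloisRep.artinConductorNat_ne_zero _
  have hM'0 : M' ≠ 0 := GaloisRepresentations.GaloisRep.artinConductorNat_ne_zero _
  have he : ∀ {q : ℕ}, q.Prime → q ∣ N → nebentypus f (q : ZMod N) = 0 := fun hq hqN ↦
    dirichletCharacter_apply_eq_zero_of_prime_dvd _ hq hqN
  -- C3 for `(f, ρ)` and for `(f̃, ρ^∨)`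
  have hC3 : ∀ s : ℂ, 3 / 2 < s.re →
      GaloisRepresentations.artinLFunction ρ.toArtinRep s * LFunctions.finiteEulerNum S G s =
        cuspFormLSeries f s * LFunctions.finiteEulerDen S G s := fun s hs ↦
    artinLFunction_mul_finiteEulerNum_eq (e := fun q ↦ nebentypus f (q : ZMod N)) hf1 hmulc hrec
      he hap ρ.toArtinRep (fun hw ↦ eulerFactorAt_eq_of_not_dvd_level hρ hw) (by linarith)
      (LSeriesSummable_cuspCoeff (strictWidthInfty_Gamma1 N) f (by push_cast; linarith))
  have hC3' : ∀ s : ℂ, 3 / 2 < s.re →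
      GaloisRepresentations.artinLFunction ρ' s * LFunctions.finiteEulerNum S H s =
        conjCuspFormLSeries f s * LFunctions.finiteEulerDen S H s := fun s hs ↦
    artinLFunction_mul_finiteEulerNum_eq (a := fun n ↦ (starRingEnd ℂ) (cuspCoeff f n))
      (e := fun q ↦ (starRingEnd ℂ) (nebentypus f (q : ZMod N)))
      (by simp only [hf1, map_one]) (fun hmn ↦ by simp only [hmulc hmn, map_mul])
      (fun hq r ↦ by simp only [hrec hq r, map_sub, map_mul])
      (fun hq hqN ↦ by simp only [he hq hqN, map_zero])
      (fun hq hqN ↦ by rw [Complex.norm_conj]; exact hap hq hqN) ρ'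
      (fun hw ↦ dual_eulerFactorAt_eq_of_not_dvd_level hρ hw) (by linarith)
      (LSeriesSummable_conj_cuspCoeff (strictWidthInfty_Gamma1 N) f (by push_cast; linarith))
  -- the completed identities on `re s > 3/2`
  have hT : ∀ s : ℂ, 3 / 2 < s.re → Λ s * (LFunctions.finiteEulerNum S G s * (N : ℂ) ^ (s / 2)) -
      2 * (M : ℂ) ^ (s / 2) * Λf s * LFunctions.finiteEulerDen S G s = 0 := by
    intro s hs
    rw [(hagree s (by linarith)).1, GaloisRepresentations.FramedArtinRep.completedArtinLFunction_eq_of_isOdd ρ hoddρ,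
      hΛf.2 s (by push_cast; linarith), completedCuspFormL]
    linear_combination (2 * (M : ℂ) ^ (s / 2) * (2 * Real.pi : ℂ) ^ (-s) * Complex.Gamma s *
      (N : ℂ) ^ (s / 2)) * hC3 s hs
  have hT' : ∀ s : ℂ, 3 / 2 < s.re → Λ' s * (LFunctions.finiteEulerNum S H s * (N : ℂ) ^ (s / 2)) -
      2 * (M' : ℂ) ^ (s / 2) * Λf' s * LFunctions.finiteEulerDen S H s = 0 := by
    intro s hs
    rw [(hagree s (by linarith)).2,
      GaloisRepresentations.FramedArtinRep.completedArtinLFunction_eq_of_isOdd (GaloisRepresentations.FramedRep.dual ρ) (isOdd_dual hoddρ),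
      hΛf'.2 s (by push_cast; linarith), completedConjCuspFormL]
    linear_combination (2 * (M' : ℂ) ^ (s / 2) * (2 * Real.pi : ℂ) ^ (-s) * Complex.Gamma s *
      (N : ℂ) ^ (s / 2)) * hC3' s hs
  -- a point with `Λ_{f̃}(s₀) ≠ 0`
  have hs₀ : ∃ s₀ : ℂ, 3 / 2 < s₀.re ∧ Λf' s₀ ≠ 0 := by
    obtain ⟨x, hx, hne⟩ := exists_lt_re_LSeries_ne_zero
      (a := fun n ↦ (starRingEnd ℂ) (cuspCoeff f n)) (by simp [hf1])
      (LSeriesSummable_conj_cuspCoeff (strictWidthInfty_Gamma1 N) f (s := 2) (by norm_num))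
      (3 / 2)
    refine ⟨x, by simpa using hx, ?_⟩
    rw [hΛf'.2 x (by push_cast; simp only [ofReal_re]; linarith), completedConjCuspFormL,
      conjCuspFormLSeries]
    refine mul_ne_zero (mul_ne_zero (mul_ne_zero ?_ ?_)
      (Complex.Gamma_ne_zero_of_re_pos (by simp only [ofReal_re]; linarith))) hne
    · exact fun h ↦ (Nat.cast_ne_zero.mpr hN) ((cpow_eq_zero_iff _ _).mp h).1
    · exact fun h ↦ (mul_ne_zero two_ne_zero (ofReal_ne_zero.mpr Real.pi_ne_zero))
        ((cpow_eq_zero_iff _ _).mp h).1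
  -- (★)
  have hstar := dsStar_identity (W := W) (a := a) hM0 hM'0 hN hΛ hFE hΛf.1 hΛf'.1 hFEf'
    (differentiable_finiteEulerNum hS0 G) (differentiable_finiteEulerDen hS0 G)
    (differentiable_finiteEulerNum hS0 H) (differentiable_finiteEulerDen hS0 H) hT hT' hs₀
  -- two-exponential form of (4.9.1)
  set c₁ : ℂ := W * cexp ((Real.log N : ℂ) / 2) with hc₁
  set c₂ : ℂ := a * cexp ((Real.log M : ℂ) / 2) with hc₂
  have hW0 : W ≠ 0 := fun h ↦ by simp [h] at hW
  have hc₁0 : c₁ ≠ 0 := mul_ne_zero hW0 (Complex.exp_ne_zero _)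
  have hc₂0 : c₂ ≠ 0 := mul_ne_zero ha (Complex.exp_ne_zero _)
  set κ₁ : ℝ := (Real.log M' - Real.log N) / 2 with hκ₁
  set κ₂ : ℝ := (Real.log N - Real.log M) / 2 with hκ₂
  have hFEexp : ∀ s : ℂ, c₁ * cexp (s * κ₁) * (LFunctions.finiteEulerNum S G (1 - s) * LFunctions.finiteEulerDen S H s) =
      c₂ * cexp (s * κ₂) * (LFunctions.finiteEulerNum S H s * LFunctions.finiteEulerDen S G (1 - s)) := by
    intro s
    have h := hstar s
    rw [natCast_cpow_eq_exp hM'0, natCast_cpow_eq_exp hN, natCast_cpow_eq_exp hM0,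
      natCast_cpow_eq_exp hN] at h
    have e1 : W * cexp (s / 2 * (Real.log M' : ℂ)) * cexp ((1 - s) / 2 * (Real.log N : ℂ)) =
        c₁ * cexp (s * κ₁) := by
      simp only [hc₁, hκ₁, mul_assoc, ← Complex.exp_add]
      congr 2
      push_cast
      ring
    have e2 : a * cexp ((1 - s) / 2 * (Real.log M : ℂ)) * cexp (s / 2 * (Real.log N : ℂ)) =
        c₂ * cexp (s * κ₂) := by
      simp only [hc₂, hκ₂, mul_assoc, ← Complex.exp_add]
      congr 2
      push_cast
      ring
    rw [← e1, ← e2]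
    linear_combination h
  have h49 := lemma49_exp hSp G H
    (fun q hq α hα ↦ norm_lt_sqrt_of_mem_dsLocalData hap ρ.toArtinRep hq hα)
    (fun q hq α hα ↦ norm_lt_sqrt_of_mem_dsLocalData (a := fun n ↦ (starRingEnd ℂ) (cuspCoeff f n))
      (fun hq' hqN ↦ by rw [Complex.norm_conj]; exact hap hq' hqN) ρ' hq hα)
    hc₁0 hc₂0 κ₁ κ₂ hFEexp
  -- conclusion at `p`
  have hpS : p ∈ S := Nat.mem_primeFactors.mpr ⟨hp, hv, hN⟩
  obtain ⟨hGp, -⟩ := h49 p hpS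
  have hpoly : ρ.toArtinRep.eulerFactorAt (placeOfPrime p hp) = 1 - C (cuspCoeff f p) * X := by
    apply Polynomial.eq_of_forall_eval_natCast_cpow_neg_eq hp.one_lt
    intro s
    rw [← numFun_dsLocalData (cuspCoeff f) ρ.toArtinRep hp s, hGp s,
      denFun_dsLocalData _ _ hp]
    simp
  rwa [hvp] at hpoly

/-- **Deligne–Serre 1974, Thm. 4.6 (b) at the primes dividing the level (per-place form), from
its printed inputs**: step (i) `DeligneSerre1974.weightOne_functionalEquation` (Hecke–Li
functional equation in weight one), step (ii) `Lang.artin_functional_equation` (Artin–Brauer)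
with Rem. 4.5 (`DeligneSerre1974.rem45_isOdd`; archimedean factor
`FramedArtinRep.gammaFactor_eq_of_isOdd`, proved), 1.8 (`IsNewform1.cuspCoeff_of_dvd_level`,
for `|a_p| ≤ 1` at `p ∣ N`), the Hecke relations of Prop. 5.8.5 (3), (2)
(`IsNewform1.cuspCoeff_mul_of_coprime`, `IsNewform1.cuspCoeff_prime_pow_add_two`, for the
Euler products (1.7.2) of `Φ_f`, `Φ_{f̃}` on `re s > 3/2`), and Lemma 4.9 (**proved**,
`DeligneSerre1974.lemma49_holds`); steps (iii)–(iv) are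
`eulerFactorAt_eq_of_dvd_level_of_functionalEquations`.  Fed into
`artinLFunction_eq_cuspFormLSeries_of_hecke`, this reduces Thm. 4.6 (b)
(`artinLFunction_eq_cuspFormLSeries`) to standard theorems on modular forms and Artin
`L`-functions. [cite: DeligneSerreASENS1974, Thm. 4.6 (b) and its proof, (i)–(iv)] -/
theorem deligneSerre_eulerFactorAt_eq_of_dvd_level_of_functionalEquations
    (hFEf : ∀ {N : ℕ} [NeZero N], DeligneSerre1974.weightOne_functionalEquation (N := N))
    (hFEρ : artin_functional_equation (K := ℚ))
    (hodd : ∀ {N : ℕ} [NeZero N], DeligneSerre1974.rem45_isOdd (N := N))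
    (h18 : ∀ {N : ℕ} [NeZero N], IsNewform1.cuspCoeff_of_dvd_level (N := N) (k := 1))
    (hmulc : IsNewform1.cuspCoeff_mul_of_coprime) (hrec : IsNewform1.cuspCoeff_prime_pow_add_two) :
    deligneSerre_eulerFactorAt_eq_of_dvd_level := by
  intro N _ f ρ hf hρ v hv
  exact eulerFactorAt_eq_of_dvd_level_of_functionalEquations hf hρ
    (hodd hf ρ hρ (finite_range_framed ρ)) (hmulc hf) (hrec.weight_one hf)
    (fun hp hpN ↦ IsNewform1.norm_cuspCoeff_le_one_of_dvd_level h18 hf hp hpN) (hFEf hf) (hFEρ ρ) hv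

/-- **`artinLFunction_eq_cuspFormLSeries` from standard inputs** (Deligne–Serre 1974, Thm. 4.6
(b), whole proof): the weight-one functional equation (i), Artin's functional equation (ii),
oddness (Rem. 4.5), 1.8, and the Hecke relations (Diamond–Shurman Prop. 5.8.5 (3), (2)); the
Deligne–Serre-specific steps (iii)–(iv), Lemma 4.9 and Thm. 9.1 are all proved
(`deligneSerre_eulerFactorAt_eq_of_dvd_level_of_functionalEquations`,
`artinLFunction_eq_cuspFormLSeries_of_hecke`).
[cite: DeligneSerreASENS1974, Thm. 4.6 (b)] -/
theorem artinLFunction_eq_cuspFormLSeries_of_functionalEquations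
    (hFEf : ∀ {N : ℕ} [NeZero N], DeligneSerre1974.weightOne_functionalEquation (N := N))
    (hFEρ : artin_functional_equation (K := ℚ))
    (hodd : ∀ {N : ℕ} [NeZero N], DeligneSerre1974.rem45_isOdd (N := N))
    (h18 : ∀ {N : ℕ} [NeZero N], IsNewform1.cuspCoeff_of_dvd_level (N := N) (k := 1))
    (hmulc : IsNewform1.cuspCoeff_mul_of_coprime) (hrec : IsNewform1.cuspCoeff_prime_pow_add_two) :
    artinLFunction_eq_cuspFormLSeries (f := f) (ρ := ρ) :=
  artinLFunction_eq_cuspFormLSeries_of_hecke hmulc hrec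
    (deligneSerre_eulerFactorAt_eq_of_dvd_level_of_functionalEquations hFEf hFEρ hodd h18 hmulc
      hrec)

end Lang

end Literature.NumberTheory.Automorphic


/-! ## Part D.  The Hecke relations for newforms on `Γ₁(N)` (Diamond–Shurman Prop. 5.8.5),
proved from the `q`-expansion of `T_p` -/

namespace Literature.NumberTheory.Automorphic.ModularForms

open UpperHalfPlane

section PartD

variable {N : ℕ} [NeZero N] {k : ℤ}

/-- `⟨1⟩ = id` on `S_k(Γ₁(N))`: the chosen lift `α ∈ Γ₀(N)` of `1 ∈ (ℤ/Nℤ)ˣ` lies in `Γ₁(N)`,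
so `⟨1⟩ f = f ∣[k] α = f` (Diamond–Shurman §5.2, p. 168: `Γ₁(N)` acts trivially).
[cite: DiamondShurman2005, §5.2 p. 168] -/
theorem diamondOp_one_apply (f : CuspForm (Gamma1 N) k) : EllipticCurves.ModularForms.diamondOp N k 1 f = f := by
  unfold EllipticCurves.ModularForms.diamondOp
  split_ifs with h
  · apply DFunLike.coe_injective
    rw [EllipticCurves.ModularForms.coe_cuspHeckeOperatorₗ_gamma1]
    exact SlashInvariantFormClass.slash_action_eq f _
      ⟨_, EllipticCurves.ModularForms.mem_gamma1_of_gamma0Map_eq_one N h.choose_spec, rfl⟩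
  · rfl

/-- A normalised cusp form is nonzero (`a₁ = 1 ≠ 0`). [folklore] -/
theorem _root_.Literature.NumberTheory.EllipticCurves.ModularForms.IsNewform1.ne_zero {f : CuspForm (Gamma1 N) k} (hf : EllipticCurves.ModularForms.IsNewform1 f) : f ≠ 0 := by
  rintro rfl
  have h1 : (qExpansion 1 ⇑(0 : CuspForm (Gamma1 N) k)).coeff 1 = 1 := hf.2.2.2
  rw [CuspForm.coe_zero, UpperHalfPlane.qExpansion_zero, map_zero] at h1
  exact zero_ne_one h1

/-- **Discharge of `IsNewform1.mem_nebentypusSubspace_nebentypus`**: a newform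
`f ∈ S_k(Γ₁(N))` lies in the eigenspace `S_k(N, χ)` of its nebentypus `χ = nebentypus f`
(Diamond–Shurman §5.2, p. 169: `S_k(Γ₁(N)) = ⊕_χ S_k(N, χ)`; Li 1975, §3).  Proof: by
`IsNewform1`, `⟨d⟩ f = c(d) f` for every unit `d`; since `f ≠ 0`, `⟨1⟩ = id`
(`diamondOp_one_apply`) and `⟨d e⟩ = ⟨d⟩ ⟨e⟩` (`diamondOp_mul_holds`), `d ↦ c(d)` is a
homomorphism `(ℤ/Nℤ)ˣ → ℂˣ`, i.e. a Dirichlet character `χ₀` mod `N` with `f ∈ S_k(N, χ₀)`; so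
the defining `dif` of `nebentypus f` takes its first branch and `f ∈ S_k(N, nebentypus f)`.
[cite: DiamondShurman2005, §5.2 p. 169] -/
theorem _root_.Literature.NumberTheory.EllipticCurves.ModularForms.IsNewform1.mem_nebentypusSubspace_nebentypus_holds :
    EllipticCurves.ModularForms.IsNewform1.mem_nebentypusSubspace_nebentypus (N := N) (k := k) := by
  intro f hf
  suffices h : ∃ χ : DirichletCharacter ℂ N, f ∈ EllipticCurves.ModularForms.nebentypusSubspace N k χ by
    unfold EllipticCurves.ModularForms.nebentypus; rw [dif_pos h]; exact h.choose_spec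
  have hf0 : f ≠ 0 := hf.ne_zero
  choose c hc using hf.2.2.1
  have hsmul : ∀ {a b : ℂ}, a • f = b • f → a = b := fun {a b} h ↦ by
    by_contra hab
    have h' : (a - b) • f = 0 := by rw [sub_smul, h, sub_self]
    exact hf0 ((smul_eq_zero.mp h').resolve_left (sub_ne_zero.mpr hab))
  have hone : c 1 = 1 := hsmul (by rw [← hc 1, Units.val_one, diamondOp_one_apply, one_smul])
  have hmul : ∀ d e, c (d * e) = c d * c e := fun d e ↦ hsmul (by
    rw [← hc (d * e), Units.val_mul, EllipticCurves.ModularForms.diamondOp_mul_holds N k d.isUnit e.isUnit,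
      Module.End.mul_apply, hc e, map_smul, hc d, smul_smul, mul_comm])
  have hne : ∀ d, c d ≠ 0 := fun d h0 ↦ by
    have h := hmul d d⁻¹
    rw [mul_inv_cancel, hone, h0, zero_mul] at h
    exact one_ne_zero h
  let φ : (ZMod N)ˣ →* ℂˣ :=
    { toFun := fun d ↦ Units.mk0 (c d) (hne d)
      map_one' := Units.ext hone
      map_mul' := fun d e ↦ Units.ext (hmul d e) }
  refine ⟨MulChar.ofUnitHom φ, ?_⟩
  rw [EllipticCurves.ModularForms.nebentypusSubspace, Submodule.mem_iInf]
  intro d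
  rw [LinearMap.mem_ker, LinearMap.sub_apply, LinearMap.smul_apply, LinearMap.id_apply,
    MulChar.ofUnitHom_coe, hc d, sub_eq_zero]
  rfl

/-- `⟨d⟩ f = χ(d) f` for a newform `f` with nebentypus `χ` and every unit `d` of `ℤ/Nℤ`
(Diamond–Shurman §5.2, p. 169). [cite: DiamondShurman2005, §5.2 p. 169] -/
theorem _root_.Literature.NumberTheory.EllipticCurves.ModularForms.IsNewform1.diamondOp_apply_eq_nebentypus_smul {f : CuspForm (Gamma1 N) k}
    (hf : EllipticCurves.ModularForms.IsNewform1 f) (d : (ZMod N)ˣ) :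
    EllipticCurves.ModularForms.diamondOp N k (d : ZMod N) f = EllipticCurves.ModularForms.nebentypus f (d : ZMod N) • f := by
  have h := EllipticCurves.ModularForms.IsNewform1.mem_nebentypusSubspace_nebentypus_holds hf
  rw [EllipticCurves.ModularForms.nebentypusSubspace, Submodule.mem_iInf] at h
  have hd := h d
  rwa [LinearMap.mem_ker, LinearMap.sub_apply, LinearMap.smul_apply, LinearMap.id_apply,
    sub_eq_zero] at hd

/-- `⟨p⟩ f = χ(p) f` for a newform `f` with nebentypus `χ` and a prime `p ∤ N` (a unit mod `N`)
(Diamond–Shurman §5.2, p. 169). [cite: DiamondShurman2005, §5.2 p. 169] -/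
theorem _root_.Literature.NumberTheory.EllipticCurves.ModularForms.IsNewform1.diamondOp_natCast_apply_of_not_dvd {f : CuspForm (Gamma1 N) k}
    (hf : EllipticCurves.ModularForms.IsNewform1 f) {p : ℕ} (hp : p.Prime) (hpN : ¬ p ∣ N) :
    EllipticCurves.ModularForms.diamondOp N k (p : ZMod N) f = EllipticCurves.ModularForms.nebentypus f (p : ZMod N) • f := by
  obtain ⟨u, hu⟩ := ZMod.isUnit_prime_of_not_dvd hp hpN
  rw [← hu]
  exact hf.diamondOp_apply_eq_nebentypus_smul u

/-- **Discharge of `IsNewform1.heckeEigenvalue_eq_coeff`**: for a newform `f ∈ S_k(Γ₁(N))`,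
`T_p f = a_p(f) f` for every prime `p` (Diamond–Shurman Thm. 5.8.2 / Prop. 5.8.5; Li 1975,
Thm. 3): compare the coefficients of `q¹` in `T_p f = λ f`, using
`a_1(T_p f) = a_p(f)` (`qExpansion_coeff_heckeT_gamma1`, Diamond–Shurman Prop. 5.2.2 (a) /
(5.3), proved in `HeckeOperatorsGamma1QExpansionProofs`) and `a_1(f) = 1`.  The `Γ₁(N)`
companion of `IsNewform0.heckeEigenvalue_eq_coeff_holds`.
[cite: DiamondShurman2005, Prop. 5.8.5 (1) and its proof, (5.3)] -/
theorem _root_.Literature.NumberTheory.EllipticCurves.ModularForms.IsNewform1.heckeEigenvalue_eq_coeff_holds :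
    EllipticCurves.ModularForms.IsNewform1.heckeEigenvalue_eq_coeff (N := N) (k := k) := by
  intro f hf p hp
  haveI : NeZero p := ⟨hp.ne_zero⟩
  have heig := EllipticCurves.ModularForms.heckeT_eq_heckeEigenvalue_smul f p (hf.2.1 p hp)
  have h1 := EllipticCurves.ModularForms.qExpansion_coeff_heckeT_gamma1_holds N k f p hp 1
  have hcoe : ⇑(EllipticCurves.ModularForms.heckeT (Gamma1 N) k p f) = EllipticCurves.ModularForms.heckeEigenvalue f p • ⇑f := by
    rw [heig]; rfl
  have hnorm : (qExpansion 1 ⇑f).coeff 1 = 1 := hf.2.2.2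
  rw [hcoe, ModularForm.qExpansion_smul one_pos (EllipticCurves.ModularForms.HeckeTGamma1.one_mem_strictPeriods_Gamma1 N) _ f, map_smul,
    smul_eq_mul, hnorm, mul_one, mul_one, if_neg (Nat.Prime.not_dvd_one hp), mul_zero,
    ite_self, add_zero] at h1
  exact h1

/-- **The Hecke relation on Fourier coefficients of a newform on `Γ₁(N)`** (Diamond–Shurman
(5.3) with Thm. 5.8.2: `T_p f = a_p f`, `⟨p⟩ f = χ(p) f`): for `f = ∑ aₙ qⁿ ∈ S_k(Γ₁(N))` a
newform with nebentypus `χ`, every prime `p` and every `n`,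
`a_p a_n = a_{pn} + 𝟙_N(p) p^{k-1} χ(p) a_{n/p}` (the last term present only when `p ∣ n`).
This is the coefficient of `qⁿ` in `a_p f = T_p f` computed by
`qExpansion_coeff_heckeT_gamma1`. [cite: DiamondShurman2005, Prop. 5.2.2 (a), (5.3) and Prop. 5.8.5] -/
theorem _root_.Literature.NumberTheory.EllipticCurves.ModularForms.IsNewform1.cuspCoeff_prime_mul {f : CuspForm (Gamma1 N) k} (hf : EllipticCurves.ModularForms.IsNewform1 f)
    {p : ℕ} (hp : p.Prime) (n : ℕ) :
    EllipticCurves.ModularForms.cuspCoeff f p * EllipticCurves.ModularForms.cuspCoeff f n =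
      EllipticCurves.ModularForms.cuspCoeff f (p * n) +
        (if p ∣ N then 0
         else (p : ℂ) ^ (k - 1) *
          (if p ∣ n then EllipticCurves.ModularForms.nebentypus f (p : ZMod N) * EllipticCurves.ModularForms.cuspCoeff f (n / p) else 0)) := by
  haveI : NeZero p := ⟨hp.ne_zero⟩
  have heig := EllipticCurves.ModularForms.heckeT_eq_heckeEigenvalue_smul f p (hf.2.1 p hp)
  rw [EllipticCurves.ModularForms.IsNewform1.heckeEigenvalue_eq_coeff_holds hf hp] at heig
  have h := EllipticCurves.ModularForms.qExpansion_coeff_heckeT_gamma1_holds N k f p hp n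
  have hcoe : ⇑(EllipticCurves.ModularForms.heckeT (Gamma1 N) k p f) = EllipticCurves.ModularForms.cuspCoeff f p • ⇑f := by
    rw [heig]; rfl
  rw [hcoe, ModularForm.qExpansion_smul one_pos (EllipticCurves.ModularForms.HeckeTGamma1.one_mem_strictPeriods_Gamma1 N) _ f, map_smul,
    smul_eq_mul] at h
  by_cases hpN : p ∣ N
  · rw [if_pos hpN, add_zero] at h ⊢
    exact h
  · have hd : ⇑(EllipticCurves.ModularForms.diamondOp N k (p : ZMod N) f) = EllipticCurves.ModularForms.nebentypus f (p : ZMod N) • ⇑f := by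
      rw [hf.diamondOp_natCast_apply_of_not_dvd hp hpN]; rfl
    rw [hd, ModularForm.qExpansion_smul one_pos (EllipticCurves.ModularForms.HeckeTGamma1.one_mem_strictPeriods_Gamma1 N) _ f, map_smul,
      smul_eq_mul] at h
    exact h

/-- The Hecke recursion at `p`-power multiples (Diamond–Shurman Prop. 5.8.5 (2), slightly
generalised): for a newform `f ∈ S_k(Γ₁(N))`, a prime `p`, and all `m`, `r`,
`a_{p^{r+2} m} = a_p a_{p^{r+1} m} - 𝟙_N(p) p^{k-1} χ(p) a_{p^r m}`.
[cite: DiamondShurman2005, Prop. 5.8.5 (2) and its proof] -/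
theorem _root_.Literature.NumberTheory.EllipticCurves.ModularForms.IsNewform1.cuspCoeff_prime_pow_add_two_mul {f : CuspForm (Gamma1 N) k}
    (hf : EllipticCurves.ModularForms.IsNewform1 f) {p : ℕ} (hp : p.Prime) (m r : ℕ) :
    EllipticCurves.ModularForms.cuspCoeff f (p ^ (r + 1 + 1) * m) =
      EllipticCurves.ModularForms.cuspCoeff f p * EllipticCurves.ModularForms.cuspCoeff f (p ^ (r + 1) * m) -
        (if p ∣ N then 0 else (p : ℂ) ^ (k - 1) * EllipticCurves.ModularForms.nebentypus f (p : ZMod N)) *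
          EllipticCurves.ModularForms.cuspCoeff f (p ^ r * m) := by
  have h := hf.cuspCoeff_prime_mul hp (p ^ (r + 1) * m)
  have hdiv : p ^ (r + 1) * m / p = p ^ r * m := by
    rw [pow_succ', mul_assoc, Nat.mul_div_cancel_left _ hp.pos]
  rw [if_pos (Dvd.dvd.mul_right (dvd_pow_self p r.succ_ne_zero) m), hdiv, ← mul_assoc,
    ← pow_succ'] at h
  by_cases hpN : p ∣ N
  · rw [if_pos hpN] at h ⊢
    linear_combination -h
  · rw [if_neg hpN] at h ⊢
    linear_combination -h

/-- **Discharge of `IsNewform1.cuspCoeff_prime_pow_add_two`** (Diamond–Shurman Prop. 5.8.5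
(2) for newforms on `Γ₁(N)`): `a_{p^{r+2}} = a_p a_{p^{r+1}} - χ(p) p^{k-1} a_{p^r}`, where
`χ(p) = 0` for `p ∣ N` (`χ` is a Dirichlet character mod `N`).  From the Hecke relation on
coefficients (`cuspCoeff_prime_mul`, i.e. (5.3) with `T_p f = a_p f`, `⟨p⟩ f = χ(p) f`).
[cite: DiamondShurman2005, Prop. 5.8.5 (2)] -/
theorem _root_.Literature.NumberTheory.EllipticCurves.ModularForms.IsNewform1.cuspCoeff_prime_pow_add_two_holds : EllipticCurves.ModularForms.IsNewform1.cuspCoeff_prime_pow_add_two := by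
  intro N _ k f hf p hp r
  have h := hf.cuspCoeff_prime_pow_add_two_mul hp 1 r
  simp only [mul_one] at h
  rw [show r + 2 = r + 1 + 1 from rfl, h]
  by_cases hpN : p ∣ N
  · have hχ : EllipticCurves.ModularForms.nebentypus f (p : ZMod N) = 0 := by
      apply MulChar.map_nonunit
      rw [ZMod.isUnit_prime_iff_not_dvd hp]
      exact not_not_intro hpN
    rw [if_pos hpN, hχ]
    ring
  · rw [if_neg hpN]
    ring

/-- `a_{p^r m} = a_{p^r} a_m` for `p ∤ m` (Diamond–Shurman Prop. 5.8.5 (3), the case of a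
prime power against a coprime cofactor): two-step induction on `r` with the recursion
`cuspCoeff_prime_pow_add_two_mul` for `m` and for `1`. [cite: DiamondShurman2005, Prop. 5.8.5 (3) and its proof] -/
theorem _root_.Literature.NumberTheory.EllipticCurves.ModularForms.IsNewform1.cuspCoeff_prime_pow_mul_of_not_dvd {f : CuspForm (Gamma1 N) k}
    (hf : EllipticCurves.ModularForms.IsNewform1 f) {p : ℕ} (hp : p.Prime) {m : ℕ} (hpm : ¬ p ∣ m) (r : ℕ) :
    EllipticCurves.ModularForms.cuspCoeff f (p ^ r * m) = EllipticCurves.ModularForms.cuspCoeff f (p ^ r) * EllipticCurves.ModularForms.cuspCoeff f m := by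
  have h1 : EllipticCurves.ModularForms.cuspCoeff f 1 = 1 := hf.2.2.2
  have key : ∀ r : ℕ, EllipticCurves.ModularForms.cuspCoeff f (p ^ r * m) = EllipticCurves.ModularForms.cuspCoeff f (p ^ r) * EllipticCurves.ModularForms.cuspCoeff f m ∧
      EllipticCurves.ModularForms.cuspCoeff f (p ^ (r + 1) * m) = EllipticCurves.ModularForms.cuspCoeff f (p ^ (r + 1)) * EllipticCurves.ModularForms.cuspCoeff f m := by
    intro r
    induction r with
    | zero =>
      refine ⟨by rw [pow_zero, one_mul, h1, one_mul], ?_⟩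
      have h := hf.cuspCoeff_prime_mul hp m
      rw [if_neg hpm, mul_zero, ite_self, add_zero] at h
      rw [zero_add, pow_one]
      exact h.symm
    | succ r ih =>
      refine ⟨ih.2, ?_⟩
      have h' := hf.cuspCoeff_prime_pow_add_two_mul hp 1 r
      simp only [mul_one] at h'
      rw [hf.cuspCoeff_prime_pow_add_two_mul hp m r, h', ih.1, ih.2]
      ring
  exact (key r).1

/-- **Discharge of `IsNewform1.cuspCoeff_mul_of_coprime`** (Diamond–Shurman Prop. 5.8.5 (3)
for newforms on `Γ₁(N)`): `a_{mn} = a_m a_n` for `(m, n) = 1`.  Induction over the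
factorisation of `m` (`Nat.recOnPosPrimePosCoprime`): `m = 0` forces `n = 1`; `m = 1` is
`a_1 = 1`; `m = p^r` is `cuspCoeff_prime_pow_mul_of_not_dvd`; and for coprime `a, b`,
`a_{abn} = a_a a_{bn} = a_a a_b a_n = a_{ab} a_n`. [cite: DiamondShurman2005, Prop. 5.8.5 (3)] -/
theorem _root_.Literature.NumberTheory.EllipticCurves.ModularForms.IsNewform1.cuspCoeff_mul_of_coprime_holds : EllipticCurves.ModularForms.IsNewform1.cuspCoeff_mul_of_coprime := by
  intro N _ k f hf m n hmn
  have h1 : EllipticCurves.ModularForms.cuspCoeff f 1 = 1 := hf.2.2.2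
  induction m using Nat.recOnPosPrimePosCoprime generalizing n with
  | zero =>
    rw [Nat.coprime_zero_left] at hmn
    subst hmn
    rw [mul_one, h1, mul_one]
  | one => rw [one_mul, h1, one_mul]
  | prime_pow p r hp hr =>
    have hpn : ¬ p ∣ n := fun hdvd ↦ hp.one_lt.ne'
      ((Nat.Coprime.of_dvd_left (dvd_pow_self p hr.ne') hmn).eq_one_of_dvd hdvd)
    exact hf.cuspCoeff_prime_pow_mul_of_not_dvd hp hpn r
  | coprime a b ha hb hab iha ihb =>
    have han : a.Coprime n := Nat.Coprime.of_dvd_left (Dvd.intro b rfl) hmn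
    have hbn : b.Coprime n := Nat.Coprime.of_dvd_left (Dvd.intro_left a rfl) hmn
    rw [mul_assoc, iha (Nat.Coprime.mul_right hab han), ihb hbn, iha hab, mul_assoc]

end PartD

end Literature.NumberTheory.Automorphic.ModularForms

/-! ## Thm. 4.6 (b) from four standard inputs -/

namespace Literature.NumberTheory.Automorphic

open EllipticCurves.ModularForms ModularForms

variable {N : ℕ} [NeZero N] {f : CuspForm (Gamma1 N) 1} {ρ : GaloisRepresentations.FramedArtinRep ℚ 2}

/-- **Thm. 9.1 (9.3) from Thm. 4.1 and Thm. 4.6 (b) at `p ∣ N`** (the Hecke relations being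
proved in Part D): `norm_cuspCoeff_le_card_divisors_weight_one` from
`DeligneSerre1974.thm41_exists` and `deligneSerre_eulerFactorAt_eq_of_dvd_level`.
[cite: DeligneSerreASENS1974, §9 Thm. 9.1 and its proof] -/
theorem ModularForms.norm_cuspCoeff_le_card_divisors_weight_one_of'
    (h41 : ∀ {N : ℕ} [NeZero N], DeligneSerre1974.thm41_exists (N := N))
    (hloc : deligneSerre_eulerFactorAt_eq_of_dvd_level) :
    norm_cuspCoeff_le_card_divisors_weight_one :=
  norm_cuspCoeff_le_card_divisors_weight_one_of h41 IsNewform1.cuspCoeff_mul_of_coprime_holds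
    IsNewform1.cuspCoeff_prime_pow_add_two_holds hloc

/-- **`artinLFunction_eq_cuspFormLSeries` from Thm. 4.6 (b) at `p ∣ N` alone** (per-place
form `deligneSerre_eulerFactorAt_eq_of_dvd_level`), the Hecke relations being proved in
Part D. [cite: DeligneSerreASENS1974, Thm. 4.6 (b)] -/
theorem artinLFunction_eq_cuspFormLSeries_of_hecke'
    (hloc : deligneSerre_eulerFactorAt_eq_of_dvd_level) :
    artinLFunction_eq_cuspFormLSeries (f := f) (ρ := ρ) :=
  artinLFunction_eq_cuspFormLSeries_of_hecke IsNewform1.cuspCoeff_mul_of_coprime_holds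
    IsNewform1.cuspCoeff_prime_pow_add_two_holds hloc

/-- **Deligne–Serre 1974, Thm. 4.6 (b) at `p ∣ N` from four standard inputs**: the
weight-one functional equation (i), Artin's functional equation (ii), oddness (Rem. 4.5) and
1.8; steps (iii)–(iv), Lemma 4.9 and the Hecke relations are proved.
[cite: DeligneSerreASENS1974, Thm. 4.6 (b) and its proof, (i)–(iv)] -/
theorem deligneSerre_eulerFactorAt_eq_of_dvd_level_of_functionalEquations'
    (hFEf : ∀ {N : ℕ} [NeZero N], DeligneSerre1974.weightOne_functionalEquation (N := N))
    (hFEρ : artin_functional_equation (K := ℚ))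
    (hodd : ∀ {N : ℕ} [NeZero N], DeligneSerre1974.rem45_isOdd (N := N))
    (h18 : ∀ {N : ℕ} [NeZero N], IsNewform1.cuspCoeff_of_dvd_level (N := N) (k := 1)) :
    deligneSerre_eulerFactorAt_eq_of_dvd_level :=
  deligneSerre_eulerFactorAt_eq_of_dvd_level_of_functionalEquations hFEf hFEρ hodd h18
    IsNewform1.cuspCoeff_mul_of_coprime_holds IsNewform1.cuspCoeff_prime_pow_add_two_holds

/-- **`artinLFunction_eq_cuspFormLSeries` from four standard inputs** (Deligne–Serre 1974,
Thm. 4.6 (b), whole proof): the weight-one functional equation (i)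
(`DeligneSerre1974.weightOne_functionalEquation`, Hecke–Li), Artin's functional equation (ii)
(`Lang.artin_functional_equation`, Artin–Brauer), oddness (Rem. 4.5,
`DeligneSerre1974.rem45_isOdd`) and 1.8 (`IsNewform1.cuspCoeff_of_dvd_level`, Li–Ogg).
Everything else in the printed proof — the unramified comparison via Thm. 4.1, steps
(iii)–(iv), Lemma 4.9, Thm. 9.1, the Euler product (1.7.2) and the Hecke relations of
Diamond–Shurman Prop. 5.8.5 — is proved in this file and in `FiniteEulerProducts`.  Once the
four inputs are discharged, `theorem artinLFunction_eq_cuspFormLSeries_holds` is this theorem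
applied to their `_holds` versions. [cite: DeligneSerreASENS1974, Thm. 4.6 (b)] -/
theorem artinLFunction_eq_cuspFormLSeries_of_functionalEquations'
    (hFEf : ∀ {N : ℕ} [NeZero N], DeligneSerre1974.weightOne_functionalEquation (N := N))
    (hFEρ : artin_functional_equation (K := ℚ))
    (hodd : ∀ {N : ℕ} [NeZero N], DeligneSerre1974.rem45_isOdd (N := N))
    (h18 : ∀ {N : ℕ} [NeZero N], IsNewform1.cuspCoeff_of_dvd_level (N := N) (k := 1)) :
    artinLFunction_eq_cuspFormLSeries (f := f) (ρ := ρ) :=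
  artinLFunction_eq_cuspFormLSeries_of_functionalEquations hFEf hFEρ hodd h18
    IsNewform1.cuspCoeff_mul_of_coprime_holds IsNewform1.cuspCoeff_prime_pow_add_two_holds

end Literature.NumberTheory.Automorphic
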